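import Literature.Probability.RandomPlanarGeometry.HexSAWSurfaceWallRenewalSlackTwoFamilies
import Literature.Probability.RandomPlanarGeometry.HexSAWSurfaceWallRenewalSecondGap

/-!
# Slack two in the six-step law: the classification `N_{3k+1,k} = 2 + Σ_{j<k} j²`

For the self-avoiding walk on the honeycomb lattice (brick-wall frame) in the half-plane `Y ≤ 0`, an IRREDUCIBLE
POSITIVE WALL BRIDGE `ω ∈ ipwb n` with `v = visits n ω` surface visits satisfies the six-step law `6v ≤ n`
(`HexSAWSurfaceWallRenewalSixStep`), with equality exactly for the two hook staircases
(`HexSAWSurfaceWallRenewalSixStepRigid`, SLACK ZERO).  This module settles SLACK TWO: for `k ≥ 2` and `m = 6k + 2`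
(length kept symbolic, `hm : m = 6 * k + 2`)

* `filter_visits_eq_slackTwoBlocks` — `(ipwb m).filter (visits m · = k) = slackTwoBlocks k`, the five explicit families
  F2a / F2b / F2c / F3L / F3R of `HexSAWSurfaceWallRenewalSlackTwoFamilies` (which proves `⊇` and the count of the
  blocks);
* `card_filter_visits_eq_slack_two` — hence `N_{3k+1,k} = #{ω ∈ ipwb (6k+2) : visits = k} = 2 + Σ_{j<k} j²
  = 2 + (k−1)k(2k−1)/6` (`3, 7, 16, 32, 57, 93, 142, …`), the second diagonal of the irreducible census;
* `mem_slackTwoBlocks_of_visits_eq` — the pointwise form.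

PROOF (lane note PROOF-slack2 §2, §4, §5).  By `slack_two_counts` and `two_le_card_stepsD_of_slack_two` of
`HexSAWSurfaceWallRenewalSecondGap` the walk has `#down = #up ∈ {2, 3}` vertical steps, end column
`X ∈ {2k+2, 2k+4}`, and `X = 2k+2` when `#down = 3`.  §1 orders the vertical times and reads off the initial wall run
`ω i = (i, 0)` (`i ≤ p`, `p` odd), the first dive `ω (p+1) = (p, −1)` and the height profile
(`profile_of_card_stepsD_eq_two` / `_three`); between vertical times the walk moves in horizontal RUNS of constant
velocity `±1` (`run_const_velocity`), and two runs on one row are disjoint (`runs_disjoint`).  §2, two down steps: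
the order `D U D U` is impossible (`dudu_false_of_mem_ipwb`: the first wall return is a new column maximum at an even
time, hence a wall-renewal time, against irreducibility — `isWRen_of_profile`); for `D D U U` the four runs sit on rows
`−1, −2, −1, 0` (`dduu_runs`), irreducibility at the visit time `2` and at the last landing bounds the run columns from
below and above (`dduu_shield_low` / `_high`), which pins the signs (`dduu_signs`) and then every coordinate
(`dduu_tables`): F2a, F2b or F2c (`dduu_slack_two`).  §3, three down steps: of the five Dyck orders, `D U D U D U`,
`D U D D U U`, `D D U U D U` and `D D U D U U` are impossible (`dududu_false`, `dudduu_false`, `dduudu_false`,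
`dduduu_false`, collected in `three_down_orders_false`) — in each case the visit count `v = k`, computed run by run
with `visits_add` / `visits_add_eq_left` / `visits_eq_div_two_of_wall`, together with `X = 2k + 2` places the last
exit column on an already visited wall site or forces two runs on one row to cross; for `D D D U U U` the runs sit on
rows `−1, −2, −3, −2, −1, 0` (`ddduuu_runs`), the shields (`ddduuu_shield_low` / `_high`) and the located exit column
`ω r₂ 0 ≥ p + 1` (`ddduuu_e_ge`) pin the signs (`ddduuu_signs_r` excludes a rightward first run, `ddduuu_signs_l`
leaves `e₄ = e₅ = ±1`), and the tables follow (`ddduuu_table_r` / `_l`, `ddduuu_tables`): F3L or F3R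
(`ddduuu_slack_two`).  §4 identifies a walk of `saws m` agreeing with a table walk at all times `≤ m` with that table
walk (`eq_tab_walk_of_forall`) and assembles.

STATUS: lane theorem of the a-idea-1 bridge/renewal lineage (cars 71 `…SixStep`, 73 `…SixStepRigid`, 74a
`…SlackTwoFamilies`, 74b-α `…SecondGap`); this is the classification half («74b-β») of the slack-two rigidity law
(lane note FINDING-HEX-WALL-SLACK-TWO-LAW).  OURS (new in writing, modest): the classification and the closed count;
checked against the lane's enumeration of all irreducible positive wall bridges of length `≤ 26` (`N_{7,2} = 3`,
`N_{10,3} = 7`, `N_{13,4} = 16`; profiles `DDUU` / `DDDUUU` only).  The printed sources carry the renewal /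
irreducible-bridge structure (Madras–Slade §4.2, Definition 4.2.1, and the remark before (4.2.21), p. 94, that an
irreducible bridge of span `L` has at least `3L` steps; Definition 1.2.4; Kesten), the brickwork frame of the honeycomb
lattice (Enting–Jensen §7.4.2, Fig. 7.10) and the surface-visit statistic (Beaton et al. §3.1) — none states this
classification or count.  Eight lemmas carry a `set_option maxHeartbeats 400000 in` budget line (they
elaborate within the default budget on the reference farm, at 100–140k heartbeats; the line is headroom only);
the long case analyses are split into lemmas of at most a few hundred elaboration steps each.
-/

namespace Literature.Probability.RandomPlanarGeometry.SAW.HexBW.Wall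

open Finset Filter Function
open Literature.Probability.LatticeModels Literature.Probability.Percolation SimpleGraph

variable {n : ℕ} {ω : ℕ → Site 2}

/-- [folklore] Two coordinates determine a site of `ℤ²`. -/
private theorem site_ext_cls {p q : Site 2} (h0 : p 0 = q 0) (h1 : p 1 = q 1) : p = q := by
  funext k
  fin_cases k
  · exact h0
  · exact h1

/-! ### §0 The family members belong to `slackTwoBlocks k` -/

/-- `f2a k a ∈ slackTwoBlocks k` for `1 ≤ a ≤ k − 1`. [cite: EntingJensen2009, §7.4.2, Fig. 7.10] -/
theorem f2a_mem_slackTwoBlocks {k a : ℕ} (ha : 1 ≤ a) (hak : a + 1 ≤ k) : f2a k a ∈ slackTwoBlocks k := by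
  classical
  simp only [slackTwoBlocks, Finset.mem_union]
  refine Or.inl (Or.inl (Or.inl ?_))
  rw [f2aBlocks, Finset.mem_image]
  exact ⟨a - 1, by rw [Finset.mem_range]; omega, by rw [Nat.sub_add_cancel ha]⟩

/-- `f2bc k j ∈ slackTwoBlocks k` for `j ≤ 1`. [cite: EntingJensen2009, §7.4.2, Fig. 7.10] -/
theorem f2bc_mem_slackTwoBlocks {k j : ℕ} (hj : j ≤ 1) : f2bc k j ∈ slackTwoBlocks k := by
  classical
  simp only [slackTwoBlocks, Finset.mem_union]
  refine Or.inl (Or.inl (Or.inr ?_))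
  rw [f2bcBlocks, Finset.mem_image]
  exact ⟨j, by rw [Finset.mem_range]; omega, rfl⟩

/-- `f3l k a b c ∈ slackTwoBlocks k` on the F3L index range. [cite: EntingJensen2009, §7.4.2, Fig. 7.10] -/
theorem f3l_mem_slackTwoBlocks {k a b c : ℕ} (ha : 1 ≤ a) (hc : 1 ≤ c) (hac : a + c + 1 ≤ k) (hbc : b + c + 1 ≤ k) :
    f3l k a b c ∈ slackTwoBlocks k := by
  classical
  simp only [slackTwoBlocks, Finset.mem_union]
  refine Or.inl (Or.inr ?_)
  rw [f3lBlocks, Finset.mem_image]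
  refine ⟨⟨k - 1 - c, (a, b)⟩, ?_, by simp only; rw [show k - 1 - (k - 1 - c) = c by omega]⟩
  simp only [f3lIdx, Finset.mem_sigma, Finset.mem_range, Finset.mem_product, Finset.mem_Icc]
  omega

/-- `f3r k b c ∈ slackTwoBlocks k` on the F3R index range. [cite: EntingJensen2009, §7.4.2, Fig. 7.10] -/
theorem f3r_mem_slackTwoBlocks {k b c : ℕ} (hc : 1 ≤ c) (hbc : b + c + 2 ≤ k) : f3r k b c ∈ slackTwoBlocks k := by
  classical
  simp only [slackTwoBlocks, Finset.mem_union]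
  refine Or.inr ?_
  rw [f3rBlocks, Finset.mem_image]
  refine ⟨⟨k - 2 - c, b⟩, ?_, by simp only; rw [show k - 2 - (k - 2 - c) = c by omega]⟩
  simp only [f3rIdx, Finset.mem_sigma, Finset.mem_range]
  omega

/-! ### §1 The profile at slack two: ordered vertical times and the initial wall run -/

/-- **Two down steps**: the down times `p < q`, the up times `r < s`, with `p < r`, `q < s` (the walk stays in
`Y ≤ 0`), the initial wall run `ω i = (i, 0)` for `i ≤ p`, `p` odd, and the first dive `ω (p+1) = (p, −1)`; all other
steps are horizontal. (Car 73's `profile_two`, first half, at general length.)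
[cite: MadrasSlade1993, §4.2, Definition 4.2.1; EntingJensen2009, §7.4.2, Fig. 7.10] -/
theorem profile_of_card_stepsD_eq_two (hω : ω ∈ ipwb n) (hD : #(stepsD n ω) = 2) (hU : #(stepsU n ω) = 2) :
    ∃ p q r s, stepsD n ω = {p, q} ∧ stepsU n ω = {r, s} ∧ p < q ∧ r < s ∧ p < r ∧ q < s ∧ 1 ≤ p ∧ p % 2 = 1 ∧
      (∀ i, i ≤ p → ω i 0 = i ∧ ω i 1 = 0) ∧ ω (p + 1) 0 = p ∧ ω (p + 1) 1 = -1 ∧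
      (∀ i, i < n → i ≠ p → i ≠ q → i ≠ r → i ≠ s →
        ω (i + 1) 1 = ω i 1 ∧ (ω (i + 1) 0 = ω i 0 + 1 ∨ ω (i + 1) 0 = ω i 0 - 1)) ∧
      (∀ t, t ≤ n → ω t 1 = ((if r < t then 1 else 0) + (if s < t then 1 else 0)) -
        ((if p < t then 1 else 0) + (if q < t then 1 else 0))) := by
  classical
  obtain ⟨hp, hn1, hirr⟩ := mem_ipwb.1 hω
  obtain ⟨hw, hb⟩ := mem_pwb.1 hp
  obtain ⟨ha, -⟩ := mem_wbr.1 hw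
  obtain ⟨hh, hn2, -⟩ := mem_archs.1 ha
  obtain ⟨hs, hhp⟩ := mem_hpw.1 hh
  obtain ⟨h0, -, hbw, hinj⟩ := mem_saws_iff.1 hs
  have hX0 : ω 0 0 = 0 := by rw [h0]; rfl
  have hY0 : ω 0 1 = 0 := by rw [h0]; rfl
  have hb' : ∀ i, 1 ≤ i → i ≤ n → 0 < ω i 0 ∧ ω i 0 ≤ ω n 0 := fun i h1 h2 => by
    have := hb i h1 h2; rwa [hX0] at this
  obtain ⟨p, q, hpq, hDpq⟩ : ∃ p q, p < q ∧ stepsD n ω = {p, q} := by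
    obtain ⟨x, y, hxy, h⟩ := Finset.card_eq_two.1 hD
    rcases lt_or_gt_of_ne hxy with hlt | hlt
    · exact ⟨x, y, hlt, h⟩
    · exact ⟨y, x, hlt, by rw [h, Finset.pair_comm]⟩
  obtain ⟨r, s, hrs, hUrs⟩ : ∃ r s, r < s ∧ stepsU n ω = {r, s} := by
    obtain ⟨x, y, hxy, h⟩ := Finset.card_eq_two.1 hU
    rcases lt_or_gt_of_ne hxy with hlt | hlt
    · exact ⟨x, y, hlt, h⟩
    · exact ⟨y, x, hlt, by rw [h, Finset.pair_comm]⟩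
  obtain ⟨hpn, hpx, hpy, hppar⟩ := of_mem_stepsD_coord hbw (i := p) (by rw [hDpq]; simp)
  obtain ⟨hqn, hqx, hqy, hqpar⟩ := of_mem_stepsD_coord hbw (i := q) (by rw [hDpq]; simp)
  obtain ⟨hrn, hrx, hry, hrpar⟩ := of_mem_stepsU_coord hbw (i := r) (by rw [hUrs]; simp)
  obtain ⟨hsn, hsx, hsy, hspar⟩ := of_mem_stepsU_coord hbw (i := s) (by rw [hUrs]; simp)
  have hhor : ∀ i, i < n → i ≠ p → i ≠ q → i ≠ r → i ≠ s →
      ω (i + 1) 1 = ω i 1 ∧ (ω (i + 1) 0 = ω i 0 + 1 ∨ ω (i + 1) 0 = ω i 0 - 1) := fun i hi hip hiq hir his =>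
    step_horizontal_of_not_mem hbw hi
      (by rw [hUrs]; simp only [Finset.mem_insert, Finset.mem_singleton, not_or]; exact ⟨hir, his⟩)
      (by rw [hDpq]; simp only [Finset.mem_insert, Finset.mem_singleton, not_or]; exact ⟨hip, hiq⟩)
  have hpair : ∀ {x y : ℕ}, x < y → ∀ t : ℕ,
      (#(({x, y} : Finset ℕ).filter (· < t)) : ℤ) = (if x < t then 1 else 0) + (if y < t then 1 else 0) := by
    intro x y hxy t
    rw [Finset.filter_insert, Finset.filter_singleton]
    split_ifs <;> simp [Finset.card_insert_of_notMem, ne_of_lt hxy]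
  have hYt : ∀ t, t ≤ n → ω t 1 = ((if r < t then 1 else 0) + (if s < t then 1 else 0)) -
      ((if p < t then 1 else 0) + (if q < t then 1 else 0)) := fun t ht => by
    rw [apply_one_eq_card_stepsU_sub_card_stepsD hbw hY0 ht, hUrs, hDpq, hpair hrs, hpair hpq]
  have hpr : p < r := by
    have h1 := hYt (r + 1) (by omega); have h2 := hhp (r + 1) (by omega)
    have hpr' : p ≠ r := fun h => by rw [h] at hpy; omega
    have hqr' : q ≠ r := fun h => by rw [h] at hqy; omega
    split_ifs at h1 <;> omega
  have hqs : q < s := by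
    have h1 := hYt (s + 1) (by omega); have h2 := hhp (s + 1) (by omega)
    have hps' : p ≠ s := fun h => by rw [h] at hpy; omega
    have hqs' : q ≠ s := fun h => by rw [h] at hqy; omega
    split_ifs at h1 <;> omega
  -- run 0: the wall run
  have h10 := first_step_eq hbw hn1 hX0 hY0 hb
  have hp1 : 1 ≤ p := by
    by_contra h
    obtain rfl : p = 0 := by omega
    norm_num at hpx
    have := (hb' 1 le_rfl hn1).1
    omega
  obtain ⟨e0, he0, hrun0⟩ := run_const_velocity hinj (a := 0) (b := p) (by omega) (by omega)
    (fun i h1 h2 => hhor i (by omega) (by omega) (by omega) (by omega) (by omega))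
  obtain rfl : e0 = 1 := by
    have := (hrun0 1 (by omega) hp1).1
    rcases he0 with rfl | rfl <;> omega
  have hR0 : ∀ i, i ≤ p → ω i 0 = i ∧ ω i 1 = 0 := fun i hi => by
    obtain ⟨h1, h2⟩ := hrun0 i (Nat.zero_le _) hi
    rw [hX0] at h1; rw [hY0] at h2
    exact ⟨by omega, h2⟩
  have hP1x : ω (p + 1) 0 = p := by rw [hpx, (hR0 p le_rfl).1]
  have hP1y : ω (p + 1) 1 = -1 := by rw [hpy, (hR0 p le_rfl).2]; rfl
  have hpodd : p % 2 = 1 := by rw [hP1x, hP1y] at hppar; omega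
  exact ⟨p, q, r, s, hDpq, hUrs, hpq, hrs, hpr, hqs, hp1, hpodd, hR0, hP1x, hP1y, hhor, hYt⟩

/-! ### §2 Two down steps: `D U D U` is impossible, `D D U U` is F2a / F2b / F2c (PROOF-slack2 §4) -/

/-- **Profile `D U D U` is impossible** (any length): the first row `−1` run goes right (a left run would put the up
step onto the initial wall run); the middle wall run cannot go left (its dive would land on the first row `−1` run),
and going right its first visit is a new column maximum that no later site shields (the only later run below the
wall, on row `−1`, cannot pass under it without meeting the first one) — an interior wall-renewal time.
(Car 73's private `dudu_false`, which carries unused slack-zero hypotheses, at general length.) [cite: MadrasSlade1993, §4.2, Definition 4.2.1; EntingJensen2009, §7.4.2, Fig. 7.10] -/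
theorem dudu_false_of_mem_ipwb (hω : ω ∈ ipwb n) {p q r s : ℕ} (hDpq : stepsD n ω = {p, q})
    (hUrs : stepsU n ω = {r, s}) (hpq : p < q) (hrs : r < s) (hpr : p < r) (hqs : q < s) (hrq : r < q)
    (hR0 : ∀ i, i ≤ p → ω i 0 = i ∧ ω i 1 = 0) (hP1x : ω (p + 1) 0 = p) (hP1y : ω (p + 1) 1 = -1)
    (hhor : ∀ i, i < n → i ≠ p → i ≠ q → i ≠ r → i ≠ s →
      ω (i + 1) 1 = ω i 1 ∧ (ω (i + 1) 0 = ω i 0 + 1 ∨ ω (i + 1) 0 = ω i 0 - 1)) : False := by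
  classical
  obtain ⟨hp, hn1, hirr⟩ := mem_ipwb.1 hω
  obtain ⟨hw, hb⟩ := mem_pwb.1 hp
  obtain ⟨ha, -⟩ := mem_wbr.1 hw
  obtain ⟨hh, -, -⟩ := mem_archs.1 ha
  obtain ⟨hs, hhp⟩ := mem_hpw.1 hh
  obtain ⟨h0, -, hbw, hinj⟩ := mem_saws_iff.1 hs
  have hX0 : ω 0 0 = 0 := by rw [h0]; rfl
  have hb' : ∀ i, 1 ≤ i → i ≤ n → 0 < ω i 0 ∧ ω i 0 ≤ ω n 0 := fun i h1 h2 => by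
    have := hb i h1 h2; rwa [hX0] at this
  obtain ⟨hpn, hpx, hpy, hppar⟩ := of_mem_stepsD_coord hbw (i := p) (by rw [hDpq]; simp)
  obtain ⟨hqn, hqx, hqy, hqpar⟩ := of_mem_stepsD_coord hbw (i := q) (by rw [hDpq]; simp)
  obtain ⟨hrn, hrx, hry, hrpar⟩ := of_mem_stepsU_coord hbw (i := r) (by rw [hUrs]; simp)
  obtain ⟨hsn, hsx, hsy, hspar⟩ := of_mem_stepsU_coord hbw (i := s) (by rw [hUrs]; simp)
  have hmem : ∀ i, i ≤ n → i ∈ {i | i ≤ n} := fun i hi => hi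
  obtain ⟨e1, he1, hrun1⟩ := run_const_velocity hinj (a := p + 1) (b := r) (by omega) (by omega)
    (fun i h1 h2 => hhor i (by omega) (by omega) (by omega) (by omega) (by omega))
  have hx : (p : ℤ) + 1 ≤ ω r 0 := by
    by_contra hlt
    have hr1 := (hb' r (by omega) (by omega)).1
    have hτ := hR0 (ω r 0).toNat (by omega)
    have := hinj (hmem (r + 1) (by omega)) (hmem (ω r 0).toNat (by omega))
      (site_ext_cls (by rw [hrx, hτ.1]; omega) (by rw [hry, (hrun1 r (by omega) le_rfl).2, hP1y, hτ.2]; rfl))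
    omega
  obtain rfl : e1 = 1 := by
    rcases he1 with h | rfl
    · exact h
    exfalso; have := (hrun1 r (by omega) le_rfl).1; rw [hP1x] at this; omega
  have hR1x : ω (r + 1) 0 = r - 1 := by have := (hrun1 r (by omega) le_rfl).1; rw [hP1x] at this; rw [hrx]; omega
  have hR1y : ω (r + 1) 1 = 0 := by rw [hry, (hrun1 r (by omega) le_rfl).2, hP1y]; rfl
  have hrev : r % 2 = 0 := by
    have h1 := (hrun1 r (by omega) le_rfl).1; have h2 := (hrun1 r (by omega) le_rfl).2
    rw [hP1x] at h1; rw [hP1y] at h2; rw [h1, h2] at hrpar; omega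
  -- run 2 on the wall goes right (else the second down step lands on run 1, or the run crosses `ω p`)
  obtain ⟨e2, he2, hrun2⟩ := run_const_velocity hinj (a := r + 1) (b := q) (by omega) (by omega)
    (fun i h1 h2 => hhor i (by omega) (by omega) (by omega) (by omega) (by omega))
  have hq2 : r + 2 ≤ q := by
    by_contra h
    obtain rfl : q = r + 1 := by omega
    have := hinj (hmem (r + 1 + 1) (by omega)) (hmem r (by omega))
      (site_ext_cls (by rw [hqx, hR1x, (hrun1 r (by omega) le_rfl).1, hP1x]; omega)
        (by rw [hqy, hR1y, (hrun1 r (by omega) le_rfl).2, hP1y]; rfl))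
    omega
  obtain rfl : e2 = 1 := by
    rcases he2 with h | rfl
    · exact h
    exfalso
    have hQx := (hrun2 q (by omega) le_rfl).1
    have hQy := (hrun2 q (by omega) le_rfl).2
    rw [hR1x] at hQx; rw [hR1y] at hQy
    by_cases hc : p + q ≤ 2 * r
    · -- the down step at `q` lands on run 1
      have h1 := hrun1 (2 * r - q + 1) (by omega) (by omega)
      rw [hP1x, hP1y] at h1
      have := hinj (hmem (q + 1) (by omega)) (hmem (2 * r - q + 1) (by omega))
        (site_ext_cls (by rw [hqx, hQx, h1.1]; omega) (by rw [hqy, hQy, h1.2]; rfl))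
      omega
    · -- run 2 walks over `ω p`
      have h1 := hrun2 (2 * r - p) (by omega) (by omega)
      rw [hR1x, hR1y] at h1
      have h2 := hR0 p le_rfl
      have := hinj (hmem (2 * r - p) (by omega)) (hmem p (by omega))
        (site_ext_cls (by rw [h1.1, h2.1]; omega) (by rw [h1.2, h2.2]))
      omega
  have hQ1x : ω (q + 1) 0 = q - 2 := by
    rw [hqx, (hrun2 q (by omega) le_rfl).1, hR1x]; omega
  have hQ1y : ω (q + 1) 1 = -1 := by rw [hqy, (hrun2 q (by omega) le_rfl).2, hR1y]; rfl
  have hq3 : r + 3 ≤ q := by rw [hQ1x, hQ1y] at hqpar; omega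
  -- run 3 on row `−1` goes right (else the last up step lands on run 2, or the run crosses `ω r`)
  obtain ⟨e3, he3, hrun3⟩ := run_const_velocity hinj (a := q + 1) (b := s) (by omega) (by omega)
    (fun i h1 h2 => hhor i (by omega) (by omega) (by omega) (by omega) (by omega))
  have hs2 : q + 2 ≤ s := by
    by_contra h
    obtain rfl : s = q + 1 := by omega
    have := hinj (hmem (q + 1 + 1) (by omega)) (hmem q (by omega))
      (site_ext_cls (by rw [hsx, hQ1x, (hrun2 q (by omega) le_rfl).1, hR1x]; omega)
        (by rw [hsy, hQ1y, (hrun2 q (by omega) le_rfl).2, hR1y]; rfl))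
    omega
  obtain rfl : e3 = 1 := by
    rcases he3 with h | rfl
    · exact h
    exfalso
    have hSx := (hrun3 s (by omega) le_rfl).1
    have hSy := (hrun3 s (by omega) le_rfl).2
    rw [hQ1x] at hSx; rw [hQ1y] at hSy
    have hS1 := (hb' s (by omega) (by omega)).1
    by_cases hc : (r : ℤ) - 1 ≤ ω s 0
    · -- the up step at `s` lands on run 2
      have h1 := hrun2 (2 * q + 1 - s) (by omega) (by omega)
      rw [hR1x, hR1y] at h1
      have := hinj (hmem (s + 1) (by omega)) (hmem (2 * q + 1 - s) (by omega))
        (site_ext_cls (by rw [hsx, hSx, h1.1]; omega) (by rw [hsy, hSy, h1.2]; rfl))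
      omega
    · -- run 3 walks over `ω r`
      have h1 := hrun3 (2 * q - r) (by omega) (by omega)
      rw [hQ1x, hQ1y] at h1
      have h2 := hrun1 r (by omega) le_rfl
      rw [hP1x, hP1y] at h2
      have := hinj (hmem (2 * q - r) (by omega)) (hmem r (by omega))
        (site_ext_cls (by rw [h1.1, h2.1]; omega) (by rw [h1.2, h2.2]))
      omega
  have hS1x : ω (s + 1) 0 = s - 3 := by
    rw [hsx, (hrun3 s (by omega) le_rfl).1, hQ1x]; omega
  have hS1y : ω (s + 1) 1 = 0 := by rw [hsy, (hrun3 s (by omega) le_rfl).2, hQ1y]; rfl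
  -- run 4 on the wall stays right of column `s − 3`
  obtain ⟨e4, he4, hrun4⟩ := run_const_velocity hinj (a := s + 1) (b := n) (by omega) le_rfl
    (fun i h1 h2 => hhor i (by omega) (by omega) (by omega) (by omega) (by omega))
  have hR4 : ∀ j, s + 1 ≤ j → j ≤ n → (s : ℤ) - 3 ≤ ω j 0 := by
    intro j h1 h2
    have hj := (hrun4 j h1 h2).1
    have hN := (hrun4 n (by omega) le_rfl).1
    have hbn := (hb' (s + 1) (by omega) (by omega)).2
    rw [hS1x] at hj hN hbn
    rcases he4 with rfl | rfl <;> omega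
  -- the wall site `(r, 0)` at time `r + 2` is a wall-renewal time
  have hXr2 : ω (r + 2) 0 = r := by
    have := (hrun2 (r + 2) (by omega) (by omega)).1; rw [hR1x] at this; rw [this]; omega
  refine hirr (r + 2) (by omega) (by omega) (isWRen_of_profile hb (by omega) (by omega) ?_ ?_ ?_)
  · rw [(hrun2 (r + 2) (by omega) (by omega)).2, hR1y]
  · intro i h1 h2
    rw [hXr2]
    rcases Nat.lt_or_ge i (p + 1) with hi | hi
    · have := (hR0 i (by omega)).1; omega
    rcases Nat.lt_or_ge i (r + 1) with hi' | hi'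
    · have := (hrun1 i hi (by omega)).1; rw [hP1x] at this; omega
    · have := (hrun2 i hi' (by omega)).1; rw [hR1x] at this; omega
  · intro j h1 h2
    rw [hXr2]
    rcases Nat.lt_or_ge j (q + 1) with hj | hj
    · have := (hrun2 j (by omega) (by omega)).1; rw [hR1x] at this; omega
    rcases Nat.lt_or_ge j (s + 1) with hj' | hj'
    · have := (hrun3 j hj (by omega)).1; rw [hQ1x] at this; omega
    · have := hR4 j hj' h2; omega

/-- DDUU, step 1 — **the runs**: run 1 on row `−1` (direction `e1`) to the second down step at the even column
`b = ω q 0`, run 2 on row `−2` (direction `e2`) to the first up step at the even column `c = ω r 0`, run 3 on row `−1`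
(direction `e3`) to the last up step at `d = ω s 0`, run 4 rightward on the wall; the visit count `v = ⌊p/2⌋ + (m−s)/2`
and the slack-two numerics give `s = p + 4k + 1` and `d ∈ {p+2, p+4}`. [cite: MadrasSlade1993, §4.2, Definition 4.2.1; EntingJensen2009, §7.4.2, Fig. 7.10] -/
theorem dduu_runs {k m : ℕ} (hk : 2 ≤ k) (hm : m = 6 * k + 2) (hω : ω ∈ ipwb m) (hv : visits m ω = k)
    {p q r s : ℕ} (hDpq : stepsD m ω = {p, q}) (hUrs : stepsU m ω = {r, s}) (hpq : p < q) (hrs : r < s)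
    (hqr : q < r) (hp1 : 1 ≤ p) (hR0 : ∀ i, i ≤ p → ω i 0 = i ∧ ω i 1 = 0)
    (hP1x : ω (p + 1) 0 = p) (hP1y : ω (p + 1) 1 = -1)
    (hhor : ∀ i, i < m → i ≠ p → i ≠ q → i ≠ r → i ≠ s →
      ω (i + 1) 1 = ω i 1 ∧ (ω (i + 1) 0 = ω i 0 + 1 ∨ ω (i + 1) 0 = ω i 0 - 1)) :
    ∃ e1 e2 e3 : ℤ, (e1 = 1 ∨ e1 = -1) ∧ (e2 = 1 ∨ e2 = -1) ∧ (e3 = 1 ∨ e3 = -1) ∧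
      (∀ i, p + 1 ≤ i → i ≤ q → ω i 0 = p + e1 * ((i - (p + 1) : ℕ) : ℤ) ∧ ω i 1 = -1) ∧
      (∀ i, q + 1 ≤ i → i ≤ r → ω i 0 = ω q 0 + e2 * ((i - (q + 1) : ℕ) : ℤ) ∧ ω i 1 = -2) ∧
      (∀ i, r + 1 ≤ i → i ≤ s → ω i 0 = ω r 0 + e3 * ((i - (r + 1) : ℕ) : ℤ) ∧ ω i 1 = -1) ∧
      (∀ j, s + 1 ≤ j → j ≤ m → ω j 0 = ω s 0 + ((j - (s + 1) : ℕ) : ℤ) ∧ ω j 1 = 0) ∧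
      s = p + 4 * k + 1 ∧ (ω s 0 = p + 2 ∨ ω s 0 = p + 4) ∧ ω q 0 % 2 = 0 ∧ ω r 0 % 2 = 0 ∧ 0 < ω q 0 ∧
      0 < ω r 0 ∧ p + 2 ≤ q ∧ q + 2 ≤ r ∧ s < m := by
  classical
  obtain ⟨hpw, hn1, hirr⟩ := mem_ipwb.1 hω
  obtain ⟨hw, hb⟩ := mem_pwb.1 hpw
  obtain ⟨ha, -⟩ := mem_wbr.1 hw
  obtain ⟨hh, -, -⟩ := mem_archs.1 ha
  obtain ⟨hs, hhp⟩ := mem_hpw.1 hh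
  obtain ⟨h0, -, hbw, hinj⟩ := mem_saws_iff.1 hs
  have hX0 : ω 0 0 = 0 := by rw [h0]; rfl
  have hb' : ∀ i, 1 ≤ i → i ≤ m → 0 < ω i 0 ∧ ω i 0 ≤ ω m 0 := fun i h1 h2 => by
    have := hb i h1 h2; rwa [hX0] at this
  have hmem : ∀ i, i ≤ m → i ∈ {i | i ≤ m} := fun i hi => hi
  obtain ⟨hpn, hpx, hpy, hppar⟩ := of_mem_stepsD_coord hbw (i := p) (by rw [hDpq]; simp)
  obtain ⟨hqn, hqx, hqy, hqpar⟩ := of_mem_stepsD_coord hbw (i := q) (by rw [hDpq]; simp)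
  obtain ⟨hrn, hrx, hry, hrpar⟩ := of_mem_stepsU_coord hbw (i := r) (by rw [hUrs]; simp)
  obtain ⟨hsn, hsx, hsy, hspar⟩ := of_mem_stepsU_coord hbw (i := s) (by rw [hUrs]; simp)
  -- run 1 on row `−1`
  obtain ⟨e1, he1, hrun1⟩ := run_const_velocity hinj (a := p + 1) (b := q) (by omega) (by omega)
    (fun i h1 h2 => hhor i (by omega) (by omega) (by omega) (by omega) (by omega))
  have hQy : ω q 1 = -1 := by rw [(hrun1 q (by omega) le_rfl).2, hP1y]
  have hQ1y : ω (q + 1) 1 = -2 := by rw [hqy, hQy]; rfl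
  have hbev : ω q 0 % 2 = 0 := by rw [hqx, hQ1y] at hqpar; omega
  have hb1 := (hb' q (by omega) (by omega)).1
  -- run 2 on row `−2`
  obtain ⟨e2, he2, hrun2⟩ := run_const_velocity hinj (a := q + 1) (b := r) (by omega) (by omega)
    (fun i h1 h2 => hhor i (by omega) (by omega) (by omega) (by omega) (by omega))
  have hRy : ω r 1 = -2 := by rw [(hrun2 r (by omega) le_rfl).2, hQ1y]
  have hR1y : ω (r + 1) 1 = -1 := by rw [hry, hRy]; rfl
  have hcev : ω r 0 % 2 = 0 := by rw [hRy] at hrpar; omega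
  have hc1 := (hb' r (by omega) (by omega)).1
  -- run 3 on row `−1`
  obtain ⟨e3, he3, hrun3⟩ := run_const_velocity hinj (a := r + 1) (b := s) (by omega) (by omega)
    (fun i h1 h2 => hhor i (by omega) (by omega) (by omega) (by omega) (by omega))
  have hSy : ω s 1 = -1 := by rw [(hrun3 s (by omega) le_rfl).2, hR1y]
  have hS1y : ω (s + 1) 1 = 0 := by rw [hsy, hSy]; rfl
  have hsev : s % 2 = 0 := by have := parity_apply hs (show s ≤ m by omega); rw [hSy] at this; omega
  -- run 4 on the wall goes right
  obtain ⟨e4, he4, hrun4⟩ := run_const_velocity hinj (a := s + 1) (b := m) (by omega) le_rfl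
    (fun i h1 h2 => hhor i (by omega) (by omega) (by omega) (by omega) (by omega))
  obtain rfl : e4 = 1 := by
    rcases he4 with h | rfl
    · exact h
    exfalso
    have hN := (hrun4 m (by omega) le_rfl).1
    have hbn := (hb' (s + 1) (by omega) (by omega)).2
    rw [hsx] at hN hbn
    omega
  have hR4 : ∀ j, s + 1 ≤ j → j ≤ m → ω j 0 = ω s 0 + ((j - (s + 1) : ℕ) : ℤ) ∧ ω j 1 = 0 := fun j h1 h2 => by
    obtain ⟨hx, hy⟩ := hrun4 j h1 h2
    rw [hsx] at hx; rw [hS1y] at hy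
    exact ⟨by rw [hx]; ring, hy⟩
  -- the visit count `v = ⌊p/2⌋ + (m − s)/2`
  have hvf : visits m ω = p / 2 + (m - s) / 2 := by
    have hv1 : visits p ω = p / 2 := visits_eq_div_two_of_wall (fun i _ h2 => (hR0 i h2).2)
    have hv2 : visits s ω = visits p ω := by
      have := visits_add_eq_left (k := p) (b := s - p) (ζ := ω) (fun j hj1 hj2 => ?_)
      · rwa [show p + (s - p) = s by omega] at this
      rintro ⟨-, hy⟩
      rcases Nat.lt_or_ge (p + j) (q + 1) with hj | hj
      · have := (hrun1 (p + j) (by omega) (by omega)).2; rw [hP1y] at this; omega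
      rcases Nat.lt_or_ge (p + j) (r + 1) with hj' | hj'
      · have := (hrun2 (p + j) hj (by omega)).2; rw [hQ1y] at this; omega
      · have := (hrun3 (p + j) hj' (by omega)).2; rw [hR1y] at this; omega
    have hv3 : visits m ω = visits s ω + visits (m - s) (fun _ => (0 : Site 2)) := by
      have := visits_add (a := s) (b := m - s) (ζ := ω) (ξ := fun _ => (0 : Site 2)) hsev (fun j hj1 hj2 => ?_)
      · rwa [show s + (m - s) = m by omega] at this
      rw [(hR4 (s + j) (by omega) (by omega)).2]; rfl
    have hv4 : visits (m - s) (fun _ => (0 : Site 2)) = (m - s) / 2 := visits_eq_div_two_of_wall (fun i _ _ => rfl)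
    rw [hv3, hv2, hv1, hv4]
  -- slack-two numerics
  obtain ⟨hX, -, -, -, -, -, -⟩ := slack_two_counts hk hm hω hv
  have hN := (hR4 m (by omega) le_rfl).1
  rw [hvf] at hv
  have hpodd : p % 2 = 1 := by rw [hP1x, hP1y] at hppar; omega
  have hs_eq : s = p + 4 * k + 1 := by omega
  have hd2 : ω s 0 = p + 2 ∨ ω s 0 = p + 4 := by
    rcases hX with hX | hX <;> · rw [hN] at hX; omega
  have hq2 : p + 2 ≤ q := by
    by_contra h
    obtain rfl : q = p + 1 := by omega
    rw [hqx, hP1x] at hqpar; rw [hQ1y] at hqpar; omega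
  have hr2 : q + 2 ≤ r := by
    by_contra h
    obtain rfl : r = q + 1 := by omega
    have := hinj (hmem (q + 1 + 1) (by omega)) (hmem q (by omega)) (site_ext_cls (by rw [hrx, hqx]) (by rw [hR1y, hQy]))
    omega
  refine ⟨e1, e2, e3, he1, he2, he3, fun i h1 h2 => ⟨by rw [(hrun1 i h1 h2).1, hP1x], by rw [(hrun1 i h1 h2).2, hP1y]⟩,
    fun i h1 h2 => ⟨by rw [(hrun2 i h1 h2).1, hqx], by rw [(hrun2 i h1 h2).2, hQ1y]⟩,
    fun i h1 h2 => ⟨by rw [(hrun3 i h1 h2).1, hrx], by rw [(hrun3 i h1 h2).2, hR1y]⟩, hR4, hs_eq, hd2, hbev, hcev, hb1,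
    hc1, hq2, hr2, hsn⟩

/-- DDUU, step 2a — **rows `−1` are shared**: run 1 and run 3 occupy disjoint column sets (self-avoidance).
[cite: MadrasSlade1993, §4.2, Definition 4.2.1; EntingJensen2009, §7.4.2, Fig. 7.10] -/
theorem dduu_row_disjoint {m p q r s : ℕ} {e1 e3 : ℤ} (hinj : Set.InjOn ω {i | i ≤ m}) (hqr : q < r) (hsm : s < m)
    (hrun1 : ∀ i, p + 1 ≤ i → i ≤ q → ω i 0 = p + e1 * ((i - (p + 1) : ℕ) : ℤ) ∧ ω i 1 = -1)
    (hrun3 : ∀ i, r + 1 ≤ i → i ≤ s → ω i 0 = ω r 0 + e3 * ((i - (r + 1) : ℕ) : ℤ) ∧ ω i 1 = -1) :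
    ∀ i j, p + 1 ≤ i → i ≤ q → r + 1 ≤ j → j ≤ s → ω i 0 ≠ ω j 0 := by
  intro i j hi1 hi2 hj1 hj2 hx
  have hmem : ∀ i, i ≤ m → i ∈ {i | i ≤ m} := fun i hi => hi
  have := hinj (hmem i (by omega)) (hmem j (by omega))
    (site_ext_cls hx (by rw [(hrun1 i hi1 hi2).2, (hrun3 j hj1 hj2).2]))
  omega

/-- DDUU, step 2b — **(I1) the visit `(2,0)` is shielded from below**: if the initial wall run carries a visit
(`p ≥ 3`) then `min (b, c) ≤ 2`, else `2` is a wall-renewal time. [cite: MadrasSlade1993, §4.2, Definition 4.2.1; EntingJensen2009, §7.4.2, Fig. 7.10] -/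
theorem dduu_shield_low {m p q r s : ℕ} {e1 e2 e3 : ℤ}
    (hb : ∀ i, 1 ≤ i → i ≤ m → ω 0 0 < ω i 0 ∧ ω i 0 ≤ ω m 0) (hirr : ∀ t, 1 ≤ t → t < m → ¬ IsWRen m ω t)
    (hR0 : ∀ i, i ≤ p → ω i 0 = i ∧ ω i 1 = 0) (he1 : e1 = 1 ∨ e1 = -1) (he2 : e2 = 1 ∨ e2 = -1)
    (he3 : e3 = 1 ∨ e3 = -1)
    (hrun1 : ∀ i, p + 1 ≤ i → i ≤ q → ω i 0 = p + e1 * ((i - (p + 1) : ℕ) : ℤ) ∧ ω i 1 = -1)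
    (hrun2 : ∀ i, q + 1 ≤ i → i ≤ r → ω i 0 = ω q 0 + e2 * ((i - (q + 1) : ℕ) : ℤ) ∧ ω i 1 = -2)
    (hrun3 : ∀ i, r + 1 ≤ i → i ≤ s → ω i 0 = ω r 0 + e3 * ((i - (r + 1) : ℕ) : ℤ) ∧ ω i 1 = -1)
    (hR4 : ∀ j, s + 1 ≤ j → j ≤ m → ω j 0 = ω s 0 + ((j - (s + 1) : ℕ) : ℤ) ∧ ω j 1 = 0)
    (hp3 : 3 ≤ p) (hpq : p < q) (hqr : q < r) (hrs : r < s) (hsm : s < m) (hd : (p : ℤ) + 2 ≤ ω s 0)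
    (hbq : ω q 0 = p + e1 * ((q - (p + 1) : ℕ) : ℤ)) (hcr : ω r 0 = ω q 0 + e2 * ((r - (q + 1) : ℕ) : ℤ))
    (hds : ω s 0 = ω r 0 + e3 * ((s - (r + 1) : ℕ) : ℤ)) :
    ω q 0 ≤ 2 ∨ ω r 0 ≤ 2 := by
  by_contra hcon
  simp only [not_or, not_le] at hcon
  obtain ⟨hb2, hc2⟩ := hcon
  refine hirr 2 (by omega) (by omega) (isWRen_of_profile hb (by omega) (by omega) (hR0 2 (by omega)).2 ?_ ?_)
  · intro i h1 h2; rw [(hR0 i (by omega)).1, (hR0 2 (by omega)).1]; omega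
  · intro j h1 h2
    rw [(hR0 2 (by omega)).1]
    rcases Nat.lt_or_ge j (p + 1) with hj | hj
    · rw [(hR0 j (by omega)).1]; omega
    rcases Nat.lt_or_ge j (q + 1) with hj1 | hj1
    · have := (hrun1 j hj (by omega)).1; rcases he1 with rfl | rfl <;> omega
    rcases Nat.lt_or_ge j (r + 1) with hj2 | hj2
    · have := (hrun2 j hj1 (by omega)).1; rcases he2 with rfl | rfl <;> omega
    rcases Nat.lt_or_ge j (s + 1) with hj3 | hj3
    · have := (hrun3 j hj2 (by omega)).1; rcases he3 with rfl | rfl <;> omega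
    · have := (hR4 j hj3 h2).1; omega

/-- DDUU, step 2c — **(I2) the visit `(X−2, 0)` is shielded from above**: if the final wall run carries two visits
(`s + 4 ≤ m`) then `max (b, c) ≥ X − 1`, else `m − 2` is a wall-renewal time. [cite: MadrasSlade1993, §4.2, Definition 4.2.1; EntingJensen2009, §7.4.2, Fig. 7.10] -/
theorem dduu_shield_high {m p q r s : ℕ} {e1 e2 e3 : ℤ}
    (hb : ∀ i, 1 ≤ i → i ≤ m → ω 0 0 < ω i 0 ∧ ω i 0 ≤ ω m 0) (hirr : ∀ t, 1 ≤ t → t < m → ¬ IsWRen m ω t)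
    (hR0 : ∀ i, i ≤ p → ω i 0 = i ∧ ω i 1 = 0) (he1 : e1 = 1 ∨ e1 = -1) (he2 : e2 = 1 ∨ e2 = -1)
    (he3 : e3 = 1 ∨ e3 = -1)
    (hrun1 : ∀ i, p + 1 ≤ i → i ≤ q → ω i 0 = p + e1 * ((i - (p + 1) : ℕ) : ℤ) ∧ ω i 1 = -1)
    (hrun2 : ∀ i, q + 1 ≤ i → i ≤ r → ω i 0 = ω q 0 + e2 * ((i - (q + 1) : ℕ) : ℤ) ∧ ω i 1 = -2)
    (hrun3 : ∀ i, r + 1 ≤ i → i ≤ s → ω i 0 = ω r 0 + e3 * ((i - (r + 1) : ℕ) : ℤ) ∧ ω i 1 = -1)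
    (hR4 : ∀ j, s + 1 ≤ j → j ≤ m → ω j 0 = ω s 0 + ((j - (s + 1) : ℕ) : ℤ) ∧ ω j 1 = 0)
    (hs4 : s + 4 ≤ m) (hm2 : m % 2 = 0) (hpq : p < q) (hqr : q < r) (hrs : r < s) (hd : (p : ℤ) + 2 ≤ ω s 0)
    (hbq : ω q 0 = p + e1 * ((q - (p + 1) : ℕ) : ℤ)) (hcr : ω r 0 = ω q 0 + e2 * ((r - (q + 1) : ℕ) : ℤ))
    (hds : ω s 0 = ω r 0 + e3 * ((s - (r + 1) : ℕ) : ℤ)) :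
    ω m 0 ≤ ω q 0 + 1 ∨ ω m 0 ≤ ω r 0 + 1 := by
  by_contra hcon
  simp only [not_or, not_le] at hcon
  obtain ⟨hb2, hc2⟩ := hcon
  have hM2 := hR4 (m - 2) (by omega) (by omega)
  have hN := (hR4 m (by omega) le_rfl).1
  refine hirr (m - 2) (by omega) (by omega) (isWRen_of_profile hb (by omega) (by omega) hM2.2 ?_ ?_)
  · intro i h1 h2
    rw [hM2.1]
    rcases Nat.lt_or_ge i (p + 1) with hi | hi
    · rw [(hR0 i (by omega)).1]; omega
    rcases Nat.lt_or_ge i (q + 1) with hi1 | hi1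
    · have := (hrun1 i hi (by omega)).1; rcases he1 with rfl | rfl <;> omega
    rcases Nat.lt_or_ge i (r + 1) with hi2 | hi2
    · have := (hrun2 i hi1 (by omega)).1; rcases he2 with rfl | rfl <;> omega
    rcases Nat.lt_or_ge i (s + 1) with hi3 | hi3
    · have := (hrun3 i hi2 (by omega)).1; rcases he3 with rfl | rfl <;> omega
    · have := (hR4 i hi3 (by omega)).1; omega
  · intro j h1 h2
    rw [hM2.1, (hR4 j (by omega) h2).1]; omega

/-- DDUU, step 3 — **the signs**: run 1 is the hairpin return to column `2` (`e1 = −1`, `b = 2`), run 2 goes right and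
beyond column `p`. Rightward run 1 is excluded by (I1) (`p ≥ 3`: then `c = 2` and run 3 climbs through column `p`) or
(I2) (`p = 1`: the last up column `d ∈ {3,5}` is met by run 1, or the lengths force `c = 2k+1+A` against parity /
size); `b > 2` with `c = 2` puts `b` on run 3; leftward run 2 leaves the half-plane; `c ≤ p` lands the first up step on
run 1. [cite: MadrasSlade1993, §4.2, Definition 4.2.1; EntingJensen2009, §7.4.2, Fig. 7.10] -/
theorem dduu_signs {k m p q r s : ℕ} {e1 e2 e3 : ℤ} (hk : 2 ≤ k) (hm : m = 6 * k + 2) (he1 : e1 = 1 ∨ e1 = -1)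
    (he2 : e2 = 1 ∨ e2 = -1) (he3 : e3 = 1 ∨ e3 = -1) (hp1 : 1 ≤ p) (hpodd : p % 2 = 1) (hrs : r < s)
    (hs_eq : s = p + 4 * k + 1) (hd2 : ω s 0 = p + 2 ∨ ω s 0 = p + 4) (hbev : ω q 0 % 2 = 0) (hcev : ω r 0 % 2 = 0)
    (hb1 : 0 < ω q 0) (hc1 : 0 < ω r 0) (hq2 : p + 2 ≤ q) (hr2 : q + 2 ≤ r) (hsm : s < m)
    (hbq : ω q 0 = p + e1 * ((q - (p + 1) : ℕ) : ℤ)) (hcr : ω r 0 = ω q 0 + e2 * ((r - (q + 1) : ℕ) : ℤ))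
    (hds : ω s 0 = ω r 0 + e3 * ((s - (r + 1) : ℕ) : ℤ)) (hN : ω m 0 = ω s 0 + ((m - (s + 1) : ℕ) : ℤ))
    (hP1x : ω (p + 1) 0 = p) (hrx : ω (r + 1) 0 = ω r 0)
    (hrun1 : ∀ i, p + 1 ≤ i → i ≤ q → ω i 0 = p + e1 * ((i - (p + 1) : ℕ) : ℤ))
    (hrun3 : ∀ i, r + 1 ≤ i → i ≤ s → ω i 0 = ω r 0 + e3 * ((i - (r + 1) : ℕ) : ℤ))
    (hdisj : ∀ i j, p + 1 ≤ i → i ≤ q → r + 1 ≤ j → j ≤ s → ω i 0 ≠ ω j 0)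
    (hI1 : 3 ≤ p → ω q 0 ≤ 2 ∨ ω r 0 ≤ 2) (hI2 : s + 4 ≤ m → ω m 0 ≤ ω q 0 + 1 ∨ ω m 0 ≤ ω r 0 + 1) :
    e1 = -1 ∧ ω q 0 = 2 ∧ e2 = 1 ∧ (p : ℤ) < ω r 0 := by
  have hE1 : e1 = -1 := by
    rcases he1 with rfl | h
    swap
    · exact h
    exfalso
    rcases Nat.lt_or_ge p 3 with hp3 | hp3
    · -- `p = 1`: the final run carries `k ≥ 2` visits, so (I2) applies
      obtain rfl : p = 1 := by omega
      rcases hI2 (by omega) with hbM | hcM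
      · -- `d ≤ b`: the last up column `d` lies on run 1
        refine hdisj ((ω s 0).toNat + 1) s (by omega) (by omega) (by omega) le_rfl ?_
        rw [hrun1 ((ω s 0).toNat + 1) (by omega) (by omega)]; omega
      · -- `c ≥ X − 1 > d`: run 1 must stop before column `d`, then the lengths do not add up
        have hbd : ω q 0 < ω s 0 := by
          by_contra hge
          refine hdisj ((ω s 0).toNat + 1) s (by omega) (by omega) (by omega) le_rfl ?_
          rw [hrun1 ((ω s 0).toNat + 1) (by omega) (by omega)]; omega
        rcases he2 with rfl | rfl <;> rcases he3 with rfl | rfl <;> omega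
    · -- `p ≥ 3`: (I1) gives `c ≤ 2` (`b > p`), so `c = 2` and run 3 climbs right through column `p = ω (p+1) 0`
      rcases hI1 hp3 with hb2 | hc2
      · omega
      · rcases he3 with rfl | rfl
        · refine hdisj (p + 1) (r + 1 + (p - (ω r 0).toNat)) le_rfl (by omega) (by omega) (by omega) ?_
          rw [hP1x, hrun3 (r + 1 + (p - (ω r 0).toNat)) (by omega) (by omega)]; omega
        · omega
  subst hE1
  have hp3 : 3 ≤ p := by omega
  have hb2 : ω q 0 = 2 := by
    rcases hI1 hp3 with hb2 | hc2
    · omega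
    · exfalso
      rcases he3 with rfl | rfl
      · refine hdisj q (r + 1 + ((ω q 0).toNat - 2)) (by omega) le_rfl (by omega) (by omega) ?_
        rw [hrun3 (r + 1 + ((ω q 0).toNat - 2)) (by omega) (by omega)]; omega
      · omega
  have hE2 : e2 = 1 := by
    rcases he2 with h | rfl
    · exact h
    exfalso; omega
  subst hE2
  refine ⟨rfl, hb2, rfl, ?_⟩
  by_contra hle
  refine hdisj (p + 1 + (p - (ω r 0).toNat)) (r + 1) (by omega) (by omega) le_rfl (by omega) ?_
  rw [hrun1 (p + 1 + (p - (ω r 0).toNat)) (by omega) (by omega), hrx]; omega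

set_option maxHeartbeats 400000 in
/-- DDUU, step 4 — **the tables**: with the signs fixed, run 3 rightward forces `p = 2k − 1`, `d = p + 4`,
`c ∈ {2k, 2k+2}` (F2c / F2b), run 3 leftward forces `c = 2k + 2`, `d = p + 2` (F2a with `a = (p−1)/2`).
[cite: MadrasSlade1993, §4.2, Definition 4.2.1; EntingJensen2009, §7.4.2, Fig. 7.10] -/
theorem dduu_tables {k m p q r s : ℕ} {e3 : ℤ} (hk : 2 ≤ k) (hm : m = 6 * k + 2) (he3 : e3 = 1 ∨ e3 = -1)
    (hR0 : ∀ i, i ≤ p → ω i 0 = i ∧ ω i 1 = 0)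
    (hrun1 : ∀ i, p + 1 ≤ i → i ≤ q → ω i 0 = p + (-1) * ((i - (p + 1) : ℕ) : ℤ) ∧ ω i 1 = -1)
    (hrun2 : ∀ i, q + 1 ≤ i → i ≤ r → ω i 0 = ω q 0 + 1 * ((i - (q + 1) : ℕ) : ℤ) ∧ ω i 1 = -2)
    (hrun3 : ∀ i, r + 1 ≤ i → i ≤ s → ω i 0 = ω r 0 + e3 * ((i - (r + 1) : ℕ) : ℤ) ∧ ω i 1 = -1)
    (hR4 : ∀ j, s + 1 ≤ j → j ≤ m → ω j 0 = ω s 0 + ((j - (s + 1) : ℕ) : ℤ) ∧ ω j 1 = 0)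
    (hpodd : p % 2 = 1) (hp3 : 3 ≤ p) (hrs : r < s) (hr2 : q + 2 ≤ r) (hsm : s < m) (hs_eq : s = p + 4 * k + 1)
    (hd2 : ω s 0 = p + 2 ∨ ω s 0 = p + 4) (hcev : ω r 0 % 2 = 0) (hb2 : ω q 0 = 2)
    (hbq : ω q 0 = p + (-1) * ((q - (p + 1) : ℕ) : ℤ)) (hcr : ω r 0 = ω q 0 + 1 * ((r - (q + 1) : ℕ) : ℤ))
    (hds : ω s 0 = ω r 0 + e3 * ((s - (r + 1) : ℕ) : ℤ)) (hcp : (p : ℤ) < ω r 0) :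
    (∃ a, 1 ≤ a ∧ a + 1 ≤ k ∧ ∀ i, i ≤ m → ω i 0 = f2aX k a i ∧ ω i 1 = f2aY k a i) ∨
      ∃ j, j ≤ 1 ∧ ∀ i, i ≤ m → ω i 0 = f2bcX k j i ∧ ω i 1 = f2bcY k j i := by
  have hq_eq : q = 2 * p - 1 := by omega
  rcases he3 with rfl | rfl
  · -- run 3 rightward: F2b (`c = 2k+2`) or F2c (`c = 2k`)
    right
    have hp_eq : p = 2 * k - 1 := by omega
    obtain ⟨j, hj, hc⟩ : ∃ j : ℕ, j ≤ 1 ∧ ω r 0 = 2 * k + 2 * j := by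
      rcases (show ω r 0 = 2 * k ∨ ω r 0 = 2 * k + 2 by omega) with h | h
      · exact ⟨0, by omega, by rw [h]; ring⟩
      · exact ⟨1, le_rfl, by rw [h]; ring⟩
    have hr_eq : r = 6 * k - 4 + 2 * j := by omega
    have hd : ω s 0 = 2 * k + 3 := by omega
    clear hd2 hcr hds hcp hbq
    refine ⟨j, hj, fun i hi => ?_⟩
    simp only [f2bcX, f2bcY]
    rcases Nat.lt_or_ge i (p + 1) with h1 | h1
    · obtain ⟨hx, hy⟩ := hR0 i (by omega)
      rw [hx, hy]; constructor <;> split_ifs <;> omega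
    rcases Nat.lt_or_ge i (q + 1) with h2 | h2
    · obtain ⟨hx, hy⟩ := hrun1 i h1 (by omega)
      rw [hx, hy]; constructor <;> split_ifs <;> omega
    rcases Nat.lt_or_ge i (r + 1) with h3 | h3
    · obtain ⟨hx, hy⟩ := hrun2 i h2 (by omega)
      rw [hx, hy]; constructor <;> split_ifs <;> omega
    rcases Nat.lt_or_ge i (s + 1) with h4 | h4
    · obtain ⟨hx, hy⟩ := hrun3 i h3 (by omega)
      rw [hx, hy]; constructor <;> split_ifs <;> omega
    · obtain ⟨hx, hy⟩ := hR4 i h4 hi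
      rw [hx, hy]; constructor <;> split_ifs <;> omega
  · -- run 3 leftward: F2a with `a = (p−1)/2`
    left
    have hc : ω r 0 = 2 * k + 2 := by omega
    have hd : ω s 0 = p + 2 := by omega
    have hr_eq : r = 2 * p + 2 * k := by omega
    clear hd2 hcr hds hcp hbq
    refine ⟨p / 2, by omega, by omega, fun i hi => ?_⟩
    simp only [f2aX, f2aY]
    rcases Nat.lt_or_ge i (p + 1) with h1 | h1
    · obtain ⟨hx, hy⟩ := hR0 i (by omega)
      rw [hx, hy]; constructor <;> split_ifs <;> omega
    rcases Nat.lt_or_ge i (q + 1) with h2 | h2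
    · obtain ⟨hx, hy⟩ := hrun1 i h1 (by omega)
      rw [hx, hy]; constructor <;> split_ifs <;> omega
    rcases Nat.lt_or_ge i (r + 1) with h3 | h3
    · obtain ⟨hx, hy⟩ := hrun2 i h2 (by omega)
      rw [hx, hy]; constructor <;> split_ifs <;> omega
    rcases Nat.lt_or_ge i (s + 1) with h4 | h4
    · obtain ⟨hx, hy⟩ := hrun3 i h3 (by omega)
      rw [hx, hy]; constructor <;> split_ifs <;> omega
    · obtain ⟨hx, hy⟩ := hR4 i h4 hi
      rw [hx, hy]; constructor <;> split_ifs <;> omega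

/-- **Profile `D D U U` at slack two is F2a, F2b or F2c** (as coordinate tables): with `v = a + f = k` visits on the
initial and final wall runs, the three middle runs have total length `2p + 2q − 2` and the last up step is at the column
`s = p + 2 + 2A` (`X = 2k + 2 + 2A`); the shielding requirements (the visit `(2,0)` needs a later column `≤ 2` below the
wall if `a ≥ 1`; the visit `(X−2, 0)` needs an earlier column `≥ X − 1` if `f ≥ 2`) and row-`−1` disjointness leave
exactly: the hairpin at `2` closed by a leftward row-`−1` return (F2a, `A = 0`), or the hook with a stretched exit
(F2b / F2c, `A = 1`, `f = 1`). PROOF-slack2 §4 = `dduu_runs` + `dduu_row_disjoint` + `dduu_shield_low/high` +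
`dduu_signs` + `dduu_tables`. [cite: MadrasSlade1993, §4.2, Definition 4.2.1; EntingJensen2009, §7.4.2, Fig. 7.10] -/
theorem dduu_slack_two {k m : ℕ} (hk : 2 ≤ k) (hm : m = 6 * k + 2) (hω : ω ∈ ipwb m) (hv : visits m ω = k)
    {p q r s : ℕ} (hDpq : stepsD m ω = {p, q}) (hUrs : stepsU m ω = {r, s}) (hpq : p < q) (hrs : r < s)
    (hqr : q < r) (hp1 : 1 ≤ p) (hpodd : p % 2 = 1) (hR0 : ∀ i, i ≤ p → ω i 0 = i ∧ ω i 1 = 0)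
    (hP1x : ω (p + 1) 0 = p) (hP1y : ω (p + 1) 1 = -1)
    (hhor : ∀ i, i < m → i ≠ p → i ≠ q → i ≠ r → i ≠ s →
      ω (i + 1) 1 = ω i 1 ∧ (ω (i + 1) 0 = ω i 0 + 1 ∨ ω (i + 1) 0 = ω i 0 - 1)) :
    (∃ a, 1 ≤ a ∧ a + 1 ≤ k ∧ ∀ i, i ≤ m → ω i 0 = f2aX k a i ∧ ω i 1 = f2aY k a i) ∨
      ∃ j, j ≤ 1 ∧ ∀ i, i ≤ m → ω i 0 = f2bcX k j i ∧ ω i 1 = f2bcY k j i := by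
  classical
  obtain ⟨hpw, hn1, hirr⟩ := mem_ipwb.1 hω
  obtain ⟨hw, hb⟩ := mem_pwb.1 hpw
  obtain ⟨ha, -⟩ := mem_wbr.1 hw
  obtain ⟨hh, hm2, -⟩ := mem_archs.1 ha
  obtain ⟨hs, -⟩ := mem_hpw.1 hh
  obtain ⟨-, -, -, hinj⟩ := mem_saws_iff.1 hs
  obtain ⟨e1, e2, e3, he1, he2, he3, hrun1, hrun2, hrun3, hR4, hs_eq, hd2, hbev, hcev, hb1, hc1, hq2, hr2, hsm⟩ :=
    dduu_runs hk hm hω hv hDpq hUrs hpq hrs hqr hp1 hR0 hP1x hP1y hhor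
  have hbq := (hrun1 q (by omega) le_rfl).1
  have hcr := (hrun2 r (by omega) le_rfl).1
  have hds := (hrun3 s (by omega) le_rfl).1
  have hN := (hR4 m (by omega) le_rfl).1
  have hrx : ω (r + 1) 0 = ω r 0 := by rw [(hrun3 (r + 1) le_rfl (by omega)).1]; simp
  have hd : (p : ℤ) + 2 ≤ ω s 0 := by omega
  have hdisj := dduu_row_disjoint hinj hqr hsm hrun1 hrun3
  have hI1 : 3 ≤ p → ω q 0 ≤ 2 ∨ ω r 0 ≤ 2 := fun hp3 =>
    dduu_shield_low hb hirr hR0 he1 he2 he3 hrun1 hrun2 hrun3 hR4 hp3 hpq hqr hrs hsm hd hbq hcr hds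
  have hI2 : s + 4 ≤ m → ω m 0 ≤ ω q 0 + 1 ∨ ω m 0 ≤ ω r 0 + 1 := fun hs4 =>
    dduu_shield_high hb hirr hR0 he1 he2 he3 hrun1 hrun2 hrun3 hR4 hs4 hm2 hpq hqr hrs hd hbq hcr hds
  obtain ⟨rfl, hb2, rfl, hcp⟩ := dduu_signs hk hm he1 he2 he3 hp1 hpodd hrs hs_eq hd2 hbev hcev hb1 hc1 hq2 hr2 hsm
    hbq hcr hds hN hP1x hrx (fun i h1 h2 => (hrun1 i h1 h2).1) (fun i h1 h2 => (hrun3 i h1 h2).1) hdisj hI1 hI2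
  exact dduu_tables hk hm he3 hR0 hrun1 hrun2 hrun3 hR4 hpodd (by omega) hrs hr2 hsm hs_eq hd2 hcev hb2 hbq hcr hds hcp

/-! ### §3 Three down steps (then `X = 2k + 2`): only `D D D U U U`, which is F3L / F3R (PROOF-slack2 §5) -/

/-- **Three down steps**: the down times `p₁ < p₂ < p₃` and up times `r₁ < r₂ < r₃` with `pᵢ < rᵢ` (the walk stays
in `Y ≤ 0`), the initial wall run and first dive as in `profile_of_card_stepsD_eq_two`, the other steps horizontal,
and the height formula. [cite: MadrasSlade1993, §4.2, Definition 4.2.1; EntingJensen2009, §7.4.2, Fig. 7.10] -/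
theorem profile_of_card_stepsD_eq_three (hω : ω ∈ ipwb n) (hD : #(stepsD n ω) = 3) (hU : #(stepsU n ω) = 3) :
    ∃ p₁ p₂ p₃ r₁ r₂ r₃, stepsD n ω = {p₁, p₂, p₃} ∧ stepsU n ω = {r₁, r₂, r₃} ∧ p₁ < p₂ ∧ p₂ < p₃ ∧ r₁ < r₂ ∧
      r₂ < r₃ ∧ p₁ < r₁ ∧ p₂ < r₂ ∧ p₃ < r₃ ∧ 1 ≤ p₁ ∧ p₁ % 2 = 1 ∧ (∀ i, i ≤ p₁ → ω i 0 = i ∧ ω i 1 = 0) ∧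
      ω (p₁ + 1) 0 = p₁ ∧ ω (p₁ + 1) 1 = -1 ∧
      (∀ i, i < n → i ∉ stepsD n ω → i ∉ stepsU n ω →
        ω (i + 1) 1 = ω i 1 ∧ (ω (i + 1) 0 = ω i 0 + 1 ∨ ω (i + 1) 0 = ω i 0 - 1)) ∧
      (∀ t, t ≤ n → ω t 1 = ((if r₁ < t then 1 else 0) + (if r₂ < t then 1 else 0) + (if r₃ < t then 1 else 0)) -
        ((if p₁ < t then 1 else 0) + (if p₂ < t then 1 else 0) + (if p₃ < t then 1 else 0))) := by
  classical
  obtain ⟨hp, hn1, hirr⟩ := mem_ipwb.1 hω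
  obtain ⟨hw, hb⟩ := mem_pwb.1 hp
  obtain ⟨ha, -⟩ := mem_wbr.1 hw
  obtain ⟨hh, hn2, -⟩ := mem_archs.1 ha
  obtain ⟨hs, hhp⟩ := mem_hpw.1 hh
  obtain ⟨h0, -, hbw, hinj⟩ := mem_saws_iff.1 hs
  have hX0 : ω 0 0 = 0 := by rw [h0]; rfl
  have hY0 : ω 0 1 = 0 := by rw [h0]; rfl
  have hb' : ∀ i, 1 ≤ i → i ≤ n → 0 < ω i 0 ∧ ω i 0 ≤ ω n 0 := fun i h1 h2 => by
    have := hb i h1 h2; rwa [hX0] at this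
  -- sorting three distinct naturals
  have sort3 : ∀ S : Finset ℕ, #S = 3 → ∃ a b c, a < b ∧ b < c ∧ S = {a, b, c} := by
    intro S hS
    obtain ⟨x, y, z, hxy, hxz, hyz, rfl⟩ := Finset.card_eq_three.1 hS
    refine ⟨min x (min y z), x + y + z - min x (min y z) - max x (max y z), max x (max y z), ?_, ?_, ?_⟩
    · rcases Nat.lt_or_gt_of_ne hxy with h | h <;> rcases Nat.lt_or_gt_of_ne hxz with h' | h' <;>
        rcases Nat.lt_or_gt_of_ne hyz with h'' | h'' <;> omega
    · rcases Nat.lt_or_gt_of_ne hxy with h | h <;> rcases Nat.lt_or_gt_of_ne hxz with h' | h' <;>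
        rcases Nat.lt_or_gt_of_ne hyz with h'' | h'' <;> omega
    · ext t
      simp only [Finset.mem_insert, Finset.mem_singleton]
      omega
  obtain ⟨p₁, p₂, p₃, h12, h23, hDs⟩ := sort3 _ hD
  obtain ⟨r₁, r₂, r₃, hr12, hr23, hUs⟩ := sort3 _ hU
  obtain ⟨hpn1, hpx1, hpy1, hppar1⟩ := of_mem_stepsD_coord hbw (i := p₁) (by rw [hDs]; simp)
  obtain ⟨hpn2, hpx2, hpy2, -⟩ := of_mem_stepsD_coord hbw (i := p₂) (by rw [hDs]; simp)
  obtain ⟨hpn3, hpx3, hpy3, -⟩ := of_mem_stepsD_coord hbw (i := p₃) (by rw [hDs]; simp)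
  obtain ⟨hrn1, hrx1, hry1, -⟩ := of_mem_stepsU_coord hbw (i := r₁) (by rw [hUs]; simp)
  obtain ⟨hrn2, hrx2, hry2, -⟩ := of_mem_stepsU_coord hbw (i := r₂) (by rw [hUs]; simp)
  obtain ⟨hrn3, hrx3, hry3, -⟩ := of_mem_stepsU_coord hbw (i := r₃) (by rw [hUs]; simp)
  have hhor : ∀ i, i < n → i ∉ stepsD n ω → i ∉ stepsU n ω →
      ω (i + 1) 1 = ω i 1 ∧ (ω (i + 1) 0 = ω i 0 + 1 ∨ ω (i + 1) 0 = ω i 0 - 1) := fun i hi hiD hiU =>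
    step_horizontal_of_not_mem hbw hi hiU hiD
  have htriple : ∀ {x y z : ℕ}, x < y → y < z → ∀ t : ℕ,
      (#(({x, y, z} : Finset ℕ).filter (· < t)) : ℤ) =
        (if x < t then 1 else 0) + (if y < t then 1 else 0) + (if z < t then 1 else 0) := by
    intro x y z hxy hyz t
    rw [Finset.filter_insert, Finset.filter_insert, Finset.filter_singleton]
    split_ifs <;> simp [Finset.card_insert_of_notMem, ne_of_lt hxy, ne_of_lt hyz, ne_of_lt (hxy.trans hyz)]
  have hYt : ∀ t, t ≤ n → ω t 1 = ((if r₁ < t then 1 else 0) + (if r₂ < t then 1 else 0) + (if r₃ < t then 1 else 0)) -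
      ((if p₁ < t then 1 else 0) + (if p₂ < t then 1 else 0) + (if p₃ < t then 1 else 0)) := fun t ht => by
    rw [apply_one_eq_card_stepsU_sub_card_stepsD hbw hY0 ht, hUs, hDs, htriple hr12 hr23, htriple h12 h23]
  -- a down time is not an up time
  have hne : ∀ {a b : ℕ}, ω (a + 1) 1 = ω a 1 - 1 → ω (b + 1) 1 = ω b 1 + 1 → a ≠ b := by
    intro a b ha hb h; rw [h] at ha; omega
  have h1 : p₁ < r₁ := by
    have hy := hYt (r₁ + 1) (by omega); have hle := hhp (r₁ + 1) (by omega)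
    have := hne hpy1 hry1; have := hne hpy2 hry1; have := hne hpy3 hry1
    rw [if_pos (show r₁ < r₁ + 1 by omega), if_neg (show ¬ r₂ < r₁ + 1 by omega),
      if_neg (show ¬ r₃ < r₁ + 1 by omega)] at hy
    split_ifs at hy <;> omega
  have h2 : p₂ < r₂ := by
    have hy := hYt (r₂ + 1) (by omega); have hle := hhp (r₂ + 1) (by omega)
    have := hne hpy1 hry2; have := hne hpy2 hry2; have := hne hpy3 hry2
    rw [if_pos (show r₁ < r₂ + 1 by omega), if_pos (show r₂ < r₂ + 1 by omega),
      if_neg (show ¬ r₃ < r₂ + 1 by omega)] at hy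
    split_ifs at hy <;> omega
  have h3 : p₃ < r₃ := by
    have hy := hYt (r₃ + 1) (by omega); have hle := hhp (r₃ + 1) (by omega)
    have := hne hpy1 hry3; have := hne hpy2 hry3; have := hne hpy3 hry3
    rw [if_pos (show r₁ < r₃ + 1 by omega), if_pos (show r₂ < r₃ + 1 by omega),
      if_pos (show r₃ < r₃ + 1 by omega)] at hy
    split_ifs at hy <;> omega
  -- run 0: the wall run
  have h10 := first_step_eq hbw hn1 hX0 hY0 hb
  have hp1 : 1 ≤ p₁ := by
    by_contra h
    obtain rfl : p₁ = 0 := by omega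
    norm_num at hpx1
    have := (hb' 1 le_rfl hn1).1
    omega
  have hnotD : ∀ i, i < p₁ → i ∉ stepsD n ω := fun i hi h => by
    rw [hDs] at h; simp only [Finset.mem_insert, Finset.mem_singleton] at h; omega
  have hnotU : ∀ i, i < p₁ → i ∉ stepsU n ω := fun i hi h => by
    rw [hUs] at h; simp only [Finset.mem_insert, Finset.mem_singleton] at h; omega
  obtain ⟨e0, he0, hrun0⟩ := run_const_velocity hinj (a := 0) (b := p₁) (by omega) (by omega)
    (fun i h1' h2' => hhor i (by omega) (hnotD i h2') (hnotU i h2'))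
  obtain rfl : e0 = 1 := by
    have := (hrun0 1 (by omega) hp1).1
    rcases he0 with rfl | rfl <;> omega
  have hR0 : ∀ i, i ≤ p₁ → ω i 0 = i ∧ ω i 1 = 0 := fun i hi => by
    obtain ⟨h1', h2'⟩ := hrun0 i (Nat.zero_le _) hi
    rw [hX0] at h1'; rw [hY0] at h2'
    exact ⟨by omega, h2'⟩
  have hP1x : ω (p₁ + 1) 0 = p₁ := by rw [hpx1, (hR0 p₁ le_rfl).1]
  have hP1y : ω (p₁ + 1) 1 = -1 := by rw [hpy1, (hR0 p₁ le_rfl).2]; rfl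
  have hpodd : p₁ % 2 = 1 := by rw [hP1x, hP1y] at hppar1; omega
  exact ⟨p₁, p₂, p₃, r₁, r₂, r₃, hDs, hUs, h12, h23, hr12, hr23, h1, h2, h3, hp1, hpodd, hR0, hP1x, hP1y, hhor, hYt⟩

/-- DUDUDU, step 1 — **the first three runs go right**: run 1 on row `−1` from the first dive, the interior wall run
from the first wall return `(r₁ − 1, 0)`, and run 3 on row `−1` from the second dive `(p₂ − 2, −1)`, up to the second
wall return `(r₂ − 3, 0)` (each forced by self-avoidance: a leftward run would land a vertical step on the previous
run or walk over its start). [cite: MadrasSlade1993, §4.2, Definition 4.2.1; EntingJensen2009, §7.4.2, Fig. 7.10] -/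
theorem dududu_head {k m : ℕ} (hm : m = 6 * k + 2) (hω : ω ∈ ipwb m) (hv : visits m ω = k)
    {p₁ p₂ p₃ r₁ r₂ r₃ : ℕ} (hD : stepsD m ω = {p₁, p₂, p₃}) (hU : stepsU m ω = {r₁, r₂, r₃}) (h12 : p₁ < p₂)
    (h23 : p₂ < p₃) (hr12 : r₁ < r₂) (hr23 : r₂ < r₃) (h1 : p₁ < r₁) (h2 : p₂ < r₂) (h3 : p₃ < r₃)
    (hp1 : 1 ≤ p₁) (hpodd : p₁ % 2 = 1) (hR0 : ∀ i, i ≤ p₁ → ω i 0 = i ∧ ω i 1 = 0)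
    (hP1x : ω (p₁ + 1) 0 = p₁) (hP1y : ω (p₁ + 1) 1 = -1)
    (hhor : ∀ i, i < m → i ∉ stepsD m ω → i ∉ stepsU m ω →
      ω (i + 1) 1 = ω i 1 ∧ (ω (i + 1) 0 = ω i 0 + 1 ∨ ω (i + 1) 0 = ω i 0 - 1))
    (hYt : ∀ t, t ≤ m → ω t 1 = ((if r₁ < t then 1 else 0) + (if r₂ < t then 1 else 0) + (if r₃ < t then 1 else 0)) -
      ((if p₁ < t then 1 else 0) + (if p₂ < t then 1 else 0) + (if p₃ < t then 1 else 0)))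
    (ho1 : r₁ < p₂) (ho2 : r₂ < p₃) :
    (∀ i, p₁ + 1 ≤ i → i ≤ r₁ → ω i 0 = ω (p₁ + 1) 0 + 1 * ((i - (p₁ + 1) : ℕ) : ℤ) ∧ ω i 1 = ω (p₁ + 1) 1) ∧
      ω (r₁ + 1) 0 = r₁ - 1 ∧ ω (r₁ + 1) 1 = 0 ∧ r₁ % 2 = 0 ∧
      (∀ i, r₁ + 1 ≤ i → i ≤ p₂ → ω i 0 = ω (r₁ + 1) 0 + 1 * ((i - (r₁ + 1) : ℕ) : ℤ) ∧ ω i 1 = ω (r₁ + 1) 1) ∧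
      r₁ + 3 ≤ p₂ ∧ ω (p₂ + 1) 0 = p₂ - 2 ∧ ω (p₂ + 1) 1 = -1 ∧
      (∀ i, p₂ + 1 ≤ i → i ≤ r₂ → ω i 0 = ω (p₂ + 1) 0 + 1 * ((i - (p₂ + 1) : ℕ) : ℤ) ∧ ω i 1 = ω (p₂ + 1) 1) ∧
      p₂ + 2 ≤ r₂ ∧ ω (r₂ + 1) 0 = r₂ - 3 ∧ ω (r₂ + 1) 1 = 0 := by
  classical
  obtain ⟨hp, hn1, hirr⟩ := mem_ipwb.1 hω
  obtain ⟨hw, hb⟩ := mem_pwb.1 hp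
  obtain ⟨ha, -⟩ := mem_wbr.1 hw
  obtain ⟨hh, -, -⟩ := mem_archs.1 ha
  obtain ⟨hs, hhp⟩ := mem_hpw.1 hh
  obtain ⟨h0, -, hbw, hinj⟩ := mem_saws_iff.1 hs
  have hX0 : ω 0 0 = 0 := by rw [h0]; rfl
  have hb' : ∀ i, 1 ≤ i → i ≤ m → 0 < ω i 0 ∧ ω i 0 ≤ ω m 0 := fun i h1 h2 => by
    have := hb i h1 h2; rwa [hX0] at this
  have hmD : ∀ i, i ∈ stepsD m ω ↔ i = p₁ ∨ i = p₂ ∨ i = p₃ := fun i => by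
    rw [hD]; simp only [Finset.mem_insert, Finset.mem_singleton]
  have hmU : ∀ i, i ∈ stepsU m ω ↔ i = r₁ ∨ i = r₂ ∨ i = r₃ := fun i => by
    rw [hU]; simp only [Finset.mem_insert, Finset.mem_singleton]
  obtain ⟨hqn, hqx, hqy, hqpar⟩ := of_mem_stepsD_coord hbw (i := p₂) ((hmD _).2 (by simp))
  obtain ⟨hq3n, hq3x, hq3y, hq3par⟩ := of_mem_stepsD_coord hbw (i := p₃) ((hmD _).2 (by simp))
  obtain ⟨hrn, hrx, hry, hrpar⟩ := of_mem_stepsU_coord hbw (i := r₁) ((hmU _).2 (by simp))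
  obtain ⟨hsn, hsx, hsy, hspar⟩ := of_mem_stepsU_coord hbw (i := r₂) ((hmU _).2 (by simp))
  obtain ⟨hr3n, hr3x, hr3y, hr3par⟩ := of_mem_stepsU_coord hbw (i := r₃) ((hmU _).2 (by simp))
  have hhor' : ∀ i, i < m → i ≠ p₁ → i ≠ p₂ → i ≠ p₃ → i ≠ r₁ → i ≠ r₂ → i ≠ r₃ →
      ω (i + 1) 1 = ω i 1 ∧ (ω (i + 1) 0 = ω i 0 + 1 ∨ ω (i + 1) 0 = ω i 0 - 1) :=
    fun i hi n1 n2 n3 n4 n5 n6 => hhor i hi (by rw [hmD]; omega) (by rw [hmU]; omega)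
  have hmem : ∀ i, i ≤ m → i ∈ {i | i ≤ m} := fun i hi => hi
  -- run 1 on row `−1` goes right and the first up step returns to the wall at column `r₁ − 1`
  obtain ⟨e1, he1, hrun1⟩ := run_const_velocity hinj (a := p₁ + 1) (b := r₁) (by omega) (by omega)
    (fun i hi1 hi2 => hhor' i (by omega) (by omega) (by omega) (by omega) (by omega) (by omega) (by omega))
  have hx : (p₁ : ℤ) + 1 ≤ ω r₁ 0 := by
    by_contra hlt
    have hr1 := (hb' r₁ (by omega) (by omega)).1
    have hτ := hR0 (ω r₁ 0).toNat (by omega)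
    have := hinj (hmem (r₁ + 1) (by omega)) (hmem (ω r₁ 0).toNat (by omega))
      (site_ext_cls (by rw [hrx, hτ.1]; omega) (by rw [hry, (hrun1 r₁ (by omega) le_rfl).2, hP1y, hτ.2]; rfl))
    omega
  obtain rfl : e1 = 1 := by
    rcases he1 with h | rfl
    · exact h
    exfalso; have := (hrun1 r₁ (by omega) le_rfl).1; rw [hP1x] at this; omega
  have hR1x : ω (r₁ + 1) 0 = r₁ - 1 := by
    have := (hrun1 r₁ (by omega) le_rfl).1; rw [hP1x] at this; rw [hrx]; omega
  have hR1y : ω (r₁ + 1) 1 = 0 := by rw [hry, (hrun1 r₁ (by omega) le_rfl).2, hP1y]; rfl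
  have hrev : r₁ % 2 = 0 := by
    have h1 := (hrun1 r₁ (by omega) le_rfl).1; have h2 := (hrun1 r₁ (by omega) le_rfl).2
    rw [hP1x] at h1; rw [hP1y] at h2; rw [h1, h2] at hrpar; omega
  -- run 2 on the wall goes right (else the second down step lands on run 1, or the run crosses `ω p₁`)
  obtain ⟨e2, he2, hrun2⟩ := run_const_velocity hinj (a := r₁ + 1) (b := p₂) (by omega) (by omega)
    (fun i hi1 hi2 => hhor' i (by omega) (by omega) (by omega) (by omega) (by omega) (by omega) (by omega))
  have hq2 : r₁ + 2 ≤ p₂ := by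
    by_contra h
    obtain rfl : p₂ = r₁ + 1 := by omega
    have := hinj (hmem (r₁ + 1 + 1) (by omega)) (hmem r₁ (by omega))
      (site_ext_cls (by rw [hqx, hR1x, (hrun1 r₁ (by omega) le_rfl).1, hP1x]; omega)
        (by rw [hqy, hR1y, (hrun1 r₁ (by omega) le_rfl).2, hP1y]; rfl))
    omega
  obtain rfl : e2 = 1 := by
    rcases he2 with h | rfl
    · exact h
    exfalso
    have hQx := (hrun2 p₂ (by omega) le_rfl).1
    have hQy := (hrun2 p₂ (by omega) le_rfl).2
    rw [hR1x] at hQx; rw [hR1y] at hQy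
    by_cases hc : p₁ + p₂ ≤ 2 * r₁
    · have h1 := hrun1 (2 * r₁ - p₂ + 1) (by omega) (by omega)
      rw [hP1x, hP1y] at h1
      have := hinj (hmem (p₂ + 1) (by omega)) (hmem (2 * r₁ - p₂ + 1) (by omega))
        (site_ext_cls (by rw [hqx, hQx, h1.1]; omega) (by rw [hqy, hQy, h1.2]; rfl))
      omega
    · have h1 := hrun2 (2 * r₁ - p₁) (by omega) (by omega)
      rw [hR1x, hR1y] at h1
      have h2 := hR0 p₁ le_rfl
      have := hinj (hmem (2 * r₁ - p₁) (by omega)) (hmem p₁ (by omega))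
        (site_ext_cls (by rw [h1.1, h2.1]; omega) (by rw [h1.2, h2.2]))
      omega
  have hQ1x : ω (p₂ + 1) 0 = p₂ - 2 := by
    rw [hqx, (hrun2 p₂ (by omega) le_rfl).1, hR1x]; omega
  have hQ1y : ω (p₂ + 1) 1 = -1 := by rw [hqy, (hrun2 p₂ (by omega) le_rfl).2, hR1y]; rfl
  have hq3 : r₁ + 3 ≤ p₂ := by rw [hQ1x, hQ1y] at hqpar; omega
  -- run 3 on row `−1` goes right (else the second up step lands on run 2, or the run crosses `ω r₁`)
  obtain ⟨e3, he3, hrun3⟩ := run_const_velocity hinj (a := p₂ + 1) (b := r₂) (by omega) (by omega)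
    (fun i hi1 hi2 => hhor' i (by omega) (by omega) (by omega) (by omega) (by omega) (by omega) (by omega))
  have hs2 : p₂ + 2 ≤ r₂ := by
    by_contra h
    obtain rfl : r₂ = p₂ + 1 := by omega
    have := hinj (hmem (p₂ + 1 + 1) (by omega)) (hmem p₂ (by omega))
      (site_ext_cls (by rw [hsx, hQ1x, (hrun2 p₂ (by omega) le_rfl).1, hR1x]; omega)
        (by rw [hsy, hQ1y, (hrun2 p₂ (by omega) le_rfl).2, hR1y]; rfl))
    omega
  obtain rfl : e3 = 1 := by
    rcases he3 with h | rfl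
    · exact h
    exfalso
    have hSx := (hrun3 r₂ (by omega) le_rfl).1
    have hSy := (hrun3 r₂ (by omega) le_rfl).2
    rw [hQ1x] at hSx; rw [hQ1y] at hSy
    have hS1 := (hb' r₂ (by omega) (by omega)).1
    by_cases hc : (r₁ : ℤ) - 1 ≤ ω r₂ 0
    · have h1 := hrun2 (2 * p₂ + 1 - r₂) (by omega) (by omega)
      rw [hR1x, hR1y] at h1
      have := hinj (hmem (r₂ + 1) (by omega)) (hmem (2 * p₂ + 1 - r₂) (by omega))
        (site_ext_cls (by rw [hsx, hSx, h1.1]; omega) (by rw [hsy, hSy, h1.2]; rfl))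
      omega
    · have h1 := hrun3 (2 * p₂ - r₁) (by omega) (by omega)
      rw [hQ1x, hQ1y] at h1
      have h2 := hrun1 r₁ (by omega) le_rfl
      rw [hP1x, hP1y] at h2
      have := hinj (hmem (2 * p₂ - r₁) (by omega)) (hmem r₁ (by omega))
        (site_ext_cls (by rw [h1.1, h2.1]; omega) (by rw [h1.2, h2.2]))
      omega
  have hS1x : ω (r₂ + 1) 0 = r₂ - 3 := by
    rw [hsx, (hrun3 r₂ (by omega) le_rfl).1, hQ1x]; omega
  have hS1y : ω (r₂ + 1) 1 = 0 := by rw [hsy, (hrun3 r₂ (by omega) le_rfl).2, hQ1y]; rfl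
  exact ⟨hrun1, hR1x, hR1y, hrev, hrun2, hq3, hQ1x, hQ1y, hrun3, hs2, hS1x, hS1y⟩

set_option maxHeartbeats 400000 in
/-- **The order `D U D U D U` is impossible at slack two** (PROOF-slack2 §5 ¶1): the first run goes right (else the
second down step would land on the initial wall run or the first wall return would revisit it), so the first wall
return `(r₁ − 1, 0)` at the even time `r₁ + 1` is a new column maximum; every later run is pushed right of it by
self-avoidance, so that time is a wall-renewal time (`isWRen_of_profile`), against irreducibility.
[cite: MadrasSlade1993, §4.2, Definition 4.2.1; EntingJensen2009, §7.4.2, Fig. 7.10] -/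
theorem dududu_false {k m : ℕ} (hm : m = 6 * k + 2) (hω : ω ∈ ipwb m) (hv : visits m ω = k)
    {p₁ p₂ p₃ r₁ r₂ r₃ : ℕ} (hD : stepsD m ω = {p₁, p₂, p₃}) (hU : stepsU m ω = {r₁, r₂, r₃}) (h12 : p₁ < p₂)
    (h23 : p₂ < p₃) (hr12 : r₁ < r₂) (hr23 : r₂ < r₃) (h1 : p₁ < r₁) (h2 : p₂ < r₂) (h3 : p₃ < r₃)
    (hp1 : 1 ≤ p₁) (hpodd : p₁ % 2 = 1) (hR0 : ∀ i, i ≤ p₁ → ω i 0 = i ∧ ω i 1 = 0)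
    (hP1x : ω (p₁ + 1) 0 = p₁) (hP1y : ω (p₁ + 1) 1 = -1)
    (hhor : ∀ i, i < m → i ∉ stepsD m ω → i ∉ stepsU m ω →
      ω (i + 1) 1 = ω i 1 ∧ (ω (i + 1) 0 = ω i 0 + 1 ∨ ω (i + 1) 0 = ω i 0 - 1))
    (hYt : ∀ t, t ≤ m → ω t 1 = ((if r₁ < t then 1 else 0) + (if r₂ < t then 1 else 0) + (if r₃ < t then 1 else 0)) -
      ((if p₁ < t then 1 else 0) + (if p₂ < t then 1 else 0) + (if p₃ < t then 1 else 0)))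
    (ho1 : r₁ < p₂) (ho2 : r₂ < p₃) : False := by
  classical
  obtain ⟨hp, hn1, hirr⟩ := mem_ipwb.1 hω
  obtain ⟨hw, hb⟩ := mem_pwb.1 hp
  obtain ⟨ha, -⟩ := mem_wbr.1 hw
  obtain ⟨hh, -, -⟩ := mem_archs.1 ha
  obtain ⟨hs, hhp⟩ := mem_hpw.1 hh
  obtain ⟨h0, -, hbw, hinj⟩ := mem_saws_iff.1 hs
  have hX0 : ω 0 0 = 0 := by rw [h0]; rfl
  have hb' : ∀ i, 1 ≤ i → i ≤ m → 0 < ω i 0 ∧ ω i 0 ≤ ω m 0 := fun i h1 h2 => by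
    have := hb i h1 h2; rwa [hX0] at this
  have hmD : ∀ i, i ∈ stepsD m ω ↔ i = p₁ ∨ i = p₂ ∨ i = p₃ := fun i => by
    rw [hD]; simp only [Finset.mem_insert, Finset.mem_singleton]
  have hmU : ∀ i, i ∈ stepsU m ω ↔ i = r₁ ∨ i = r₂ ∨ i = r₃ := fun i => by
    rw [hU]; simp only [Finset.mem_insert, Finset.mem_singleton]
  obtain ⟨hqn, hqx, hqy, hqpar⟩ := of_mem_stepsD_coord hbw (i := p₂) ((hmD _).2 (by simp))
  obtain ⟨hq3n, hq3x, hq3y, hq3par⟩ := of_mem_stepsD_coord hbw (i := p₃) ((hmD _).2 (by simp))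
  obtain ⟨hrn, hrx, hry, hrpar⟩ := of_mem_stepsU_coord hbw (i := r₁) ((hmU _).2 (by simp))
  obtain ⟨hsn, hsx, hsy, hspar⟩ := of_mem_stepsU_coord hbw (i := r₂) ((hmU _).2 (by simp))
  obtain ⟨hr3n, hr3x, hr3y, hr3par⟩ := of_mem_stepsU_coord hbw (i := r₃) ((hmU _).2 (by simp))
  have hhor' : ∀ i, i < m → i ≠ p₁ → i ≠ p₂ → i ≠ p₃ → i ≠ r₁ → i ≠ r₂ → i ≠ r₃ →
      ω (i + 1) 1 = ω i 1 ∧ (ω (i + 1) 0 = ω i 0 + 1 ∨ ω (i + 1) 0 = ω i 0 - 1) :=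
    fun i hi n1 n2 n3 n4 n5 n6 => hhor i hi (by rw [hmD]; omega) (by rw [hmU]; omega)
  have hmem : ∀ i, i ≤ m → i ∈ {i | i ≤ m} := fun i hi => hi
  obtain ⟨hrun1, hR1x, hR1y, hrev, hrun2, hq3, hQ1x, hQ1y, hrun3, hs2, hS1x, hS1y⟩ :=
    dududu_head hm hω hv hD hU h12 h23 hr12 hr23 h1 h2 h3 hp1 hpodd hR0 hP1x hP1y hhor hYt ho1 ho2
  -- run 4 on the wall goes right (else the third down step lands on run 3, or the run crosses `ω p₂`)
  obtain ⟨e4, he4, hrun4⟩ := run_const_velocity hinj (a := r₂ + 1) (b := p₃) (by omega) (by omega)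
    (fun i hi1 hi2 => hhor' i (by omega) (by omega) (by omega) (by omega) (by omega) (by omega) (by omega))
  have hq32 : r₂ + 2 ≤ p₃ := by
    by_contra h
    obtain rfl : p₃ = r₂ + 1 := by omega
    have := hinj (hmem (r₂ + 1 + 1) (by omega)) (hmem r₂ (by omega))
      (site_ext_cls (by rw [hq3x, hS1x, (hrun3 r₂ (by omega) le_rfl).1, hQ1x]; omega)
        (by rw [hq3y, hS1y, (hrun3 r₂ (by omega) le_rfl).2, hQ1y]; rfl))
    omega
  obtain rfl : e4 = 1 := by
    rcases he4 with h | rfl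
    · exact h
    exfalso
    have hQx := (hrun4 p₃ (by omega) le_rfl).1
    have hQy := (hrun4 p₃ (by omega) le_rfl).2
    rw [hS1x] at hQx; rw [hS1y] at hQy
    by_cases hc : p₂ + p₃ ≤ 2 * r₂
    · -- the third down step lands on run 3
      have h1 := hrun3 (2 * r₂ - p₃ + 1) (by omega) (by omega)
      rw [hQ1x, hQ1y] at h1
      have := hinj (hmem (p₃ + 1) (by omega)) (hmem (2 * r₂ - p₃ + 1) (by omega))
        (site_ext_cls (by rw [hq3x, hQx, h1.1]; omega) (by rw [hq3y, hQy, h1.2]; rfl))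
      omega
    · -- run 4 walks over `ω p₂`
      have h1 := hrun4 (2 * r₂ - p₂) (by omega) (by omega)
      rw [hS1x, hS1y] at h1
      have h2 := hrun2 p₂ (by omega) le_rfl
      rw [hR1x, hR1y] at h2
      have := hinj (hmem (2 * r₂ - p₂) (by omega)) (hmem p₂ (by omega))
        (site_ext_cls (by rw [h1.1, h2.1]; omega) (by rw [h1.2, h2.2]))
      omega
  have hT1x : ω (p₃ + 1) 0 = p₃ - 4 := by
    rw [hq3x, (hrun4 p₃ (by omega) le_rfl).1, hS1x]; omega
  have hT1y : ω (p₃ + 1) 1 = -1 := by rw [hq3y, (hrun4 p₃ (by omega) le_rfl).2, hS1y]; rfl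
  have hq33 : r₂ + 3 ≤ p₃ := by rw [hT1x, hT1y] at hq3par; omega
  -- run 5 on row `−1` goes right (else the last up step lands on run 4, or the run crosses `ω r₂`)
  obtain ⟨e5, he5, hrun5⟩ := run_const_velocity hinj (a := p₃ + 1) (b := r₃) (by omega) (by omega)
    (fun i hi1 hi2 => hhor' i (by omega) (by omega) (by omega) (by omega) (by omega) (by omega) (by omega))
  have hs32 : p₃ + 2 ≤ r₃ := by
    by_contra h
    obtain rfl : r₃ = p₃ + 1 := by omega
    have := hinj (hmem (p₃ + 1 + 1) (by omega)) (hmem p₃ (by omega))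
      (site_ext_cls (by rw [hr3x, hT1x, (hrun4 p₃ (by omega) le_rfl).1, hS1x]; omega)
        (by rw [hr3y, hT1y, (hrun4 p₃ (by omega) le_rfl).2, hS1y]; rfl))
    omega
  obtain rfl : e5 = 1 := by
    rcases he5 with h | rfl
    · exact h
    exfalso
    have hSx := (hrun5 r₃ (by omega) le_rfl).1
    have hSy := (hrun5 r₃ (by omega) le_rfl).2
    rw [hT1x] at hSx; rw [hT1y] at hSy
    have hS1 := (hb' r₃ (by omega) (by omega)).1
    by_cases hc : (r₂ : ℤ) - 3 ≤ ω r₃ 0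
    · -- the last up step lands on run 4
      have h1 := hrun4 (2 * p₃ + 1 - r₃) (by omega) (by omega)
      rw [hS1x, hS1y] at h1
      have := hinj (hmem (r₃ + 1) (by omega)) (hmem (2 * p₃ + 1 - r₃) (by omega))
        (site_ext_cls (by rw [hr3x, hSx, h1.1]; omega) (by rw [hr3y, hSy, h1.2]; rfl))
      omega
    · -- run 5 walks over `ω r₂`
      have h1 := hrun5 (2 * p₃ - r₂) (by omega) (by omega)
      rw [hT1x, hT1y] at h1
      have h2 := hrun3 r₂ (by omega) le_rfl
      rw [hQ1x, hQ1y] at h2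
      have := hinj (hmem (2 * p₃ - r₂) (by omega)) (hmem r₂ (by omega))
        (site_ext_cls (by rw [h1.1, h2.1]; omega) (by rw [h1.2, h2.2]))
      omega
  have hU1x : ω (r₃ + 1) 0 = r₃ - 5 := by
    rw [hr3x, (hrun5 r₃ (by omega) le_rfl).1, hT1x]; omega
  have hU1y : ω (r₃ + 1) 1 = 0 := by rw [hr3y, (hrun5 r₃ (by omega) le_rfl).2, hT1y]; rfl
  -- run 6 on the wall stays right of column `r₃ − 5`
  obtain ⟨e6, he6, hrun6⟩ := run_const_velocity hinj (a := r₃ + 1) (b := m) (by omega) le_rfl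
    (fun i hi1 hi2 => hhor' i (by omega) (by omega) (by omega) (by omega) (by omega) (by omega) (by omega))
  have hR6 : ∀ j, r₃ + 1 ≤ j → j ≤ m → (r₃ : ℤ) - 5 ≤ ω j 0 := by
    intro j hj1 hj2
    have hj := (hrun6 j hj1 hj2).1
    have hN := (hrun6 m (by omega) le_rfl).1
    have hbn := (hb' (r₃ + 1) (by omega) (by omega)).2
    rw [hU1x] at hj hN hbn
    rcases he6 with rfl | rfl <;> omega
  -- the wall site `(r₁, 0)` at time `r₁ + 2` is a wall-renewal time
  have hXr2 : ω (r₁ + 2) 0 = r₁ := by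
    have := (hrun2 (r₁ + 2) (by omega) (by omega)).1; rw [hR1x] at this; rw [this]; omega
  refine hirr (r₁ + 2) (by omega) (by omega) (isWRen_of_profile hb (by omega) (by omega) ?_ ?_ ?_)
  · rw [(hrun2 (r₁ + 2) (by omega) (by omega)).2, hR1y]
  · intro i hi1 hi2
    rw [hXr2]
    rcases Nat.lt_or_ge i (p₁ + 1) with hi | hi
    · have := (hR0 i (by omega)).1; omega
    rcases Nat.lt_or_ge i (r₁ + 1) with hi' | hi'
    · have := (hrun1 i hi (by omega)).1; rw [hP1x] at this; omega
    · have := (hrun2 i hi' (by omega)).1; rw [hR1x] at this; omega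
  · intro j hj1 hj2
    rw [hXr2]
    rcases Nat.lt_or_ge j (p₂ + 1) with hj | hj
    · have := (hrun2 j (by omega) (by omega)).1; rw [hR1x] at this; omega
    rcases Nat.lt_or_ge j (r₂ + 1) with hja | hja
    · have := (hrun3 j hj (by omega)).1; rw [hQ1x] at this; omega
    rcases Nat.lt_or_ge j (p₃ + 1) with hjb | hjb
    · have := (hrun4 j hja (by omega)).1; rw [hS1x] at this; omega
    rcases Nat.lt_or_ge j (r₃ + 1) with hjc | hjc
    · have := (hrun5 j hjb (by omega)).1; rw [hT1x] at this; omega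
    · have := hR6 j hjc hj2; omega

/-- **The order `D U D D U U` is impossible at slack two** (PROOF-slack2 §5 ¶2): as for `D U D U D U` the first wall
return is `(r₁ − 1, 0)` and the interior wall run goes right to the second dive at `(p₂ − 2, 0)`; the visit count
`k = (p₁ − 1)/2 + (p₂ − r₁ − 1)/2 + (m − r₃)/2` and the end column `X = 2k + 2 = ω (r₃+1) 0 + (m − r₃ − 1)` give the
last exit column `ω (r₃+1) 0 = p₁ + p₂ − r₁ + 1 ≤ p₂ − 2`, a wall site already visited (or above the first run).
[cite: MadrasSlade1993, §4.2, Definition 4.2.1; EntingJensen2009, §7.4.2, Fig. 7.10] -/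
theorem dudduu_false {k m : ℕ} (hk : 2 ≤ k) (hm : m = 6 * k + 2) (hω : ω ∈ ipwb m) (hv : visits m ω = k)
    {p₁ p₂ p₃ r₁ r₂ r₃ : ℕ} (hD : stepsD m ω = {p₁, p₂, p₃}) (hU : stepsU m ω = {r₁, r₂, r₃}) (h12 : p₁ < p₂)
    (h23 : p₂ < p₃) (hr12 : r₁ < r₂) (hr23 : r₂ < r₃) (h1 : p₁ < r₁) (h2 : p₂ < r₂) (h3 : p₃ < r₃)
    (hp1 : 1 ≤ p₁) (hpodd : p₁ % 2 = 1) (hR0 : ∀ i, i ≤ p₁ → ω i 0 = i ∧ ω i 1 = 0)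
    (hP1x : ω (p₁ + 1) 0 = p₁) (hP1y : ω (p₁ + 1) 1 = -1)
    (hhor : ∀ i, i < m → i ∉ stepsD m ω → i ∉ stepsU m ω →
      ω (i + 1) 1 = ω i 1 ∧ (ω (i + 1) 0 = ω i 0 + 1 ∨ ω (i + 1) 0 = ω i 0 - 1))
    (hYt : ∀ t, t ≤ m → ω t 1 = ((if r₁ < t then 1 else 0) + (if r₂ < t then 1 else 0) + (if r₃ < t then 1 else 0)) -
      ((if p₁ < t then 1 else 0) + (if p₂ < t then 1 else 0) + (if p₃ < t then 1 else 0)))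
    (ho1 : r₁ < p₂) (ho2 : p₃ < r₂) : False := by
  classical
  obtain ⟨hp, hn1, hirr⟩ := mem_ipwb.1 hω
  obtain ⟨hw, hb⟩ := mem_pwb.1 hp
  obtain ⟨ha, -⟩ := mem_wbr.1 hw
  obtain ⟨hh, -, -⟩ := mem_archs.1 ha
  obtain ⟨hs, hhp⟩ := mem_hpw.1 hh
  obtain ⟨h0, -, hbw, hinj⟩ := mem_saws_iff.1 hs
  have hX0 : ω 0 0 = 0 := by rw [h0]; rfl
  have hb' : ∀ i, 1 ≤ i → i ≤ m → 0 < ω i 0 ∧ ω i 0 ≤ ω m 0 := fun i h1 h2 => by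
    have := hb i h1 h2; rwa [hX0] at this
  have hmD : ∀ i, i ∈ stepsD m ω ↔ i = p₁ ∨ i = p₂ ∨ i = p₃ := fun i => by
    rw [hD]; simp only [Finset.mem_insert, Finset.mem_singleton]
  have hmU : ∀ i, i ∈ stepsU m ω ↔ i = r₁ ∨ i = r₂ ∨ i = r₃ := fun i => by
    rw [hU]; simp only [Finset.mem_insert, Finset.mem_singleton]
  obtain ⟨hqn, hqx, hqy, hqpar⟩ := of_mem_stepsD_coord hbw (i := p₂) ((hmD _).2 (by simp))
  obtain ⟨hq3n, hq3x, hq3y, hq3par⟩ := of_mem_stepsD_coord hbw (i := p₃) ((hmD _).2 (by simp))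
  obtain ⟨hrn, hrx, hry, hrpar⟩ := of_mem_stepsU_coord hbw (i := r₁) ((hmU _).2 (by simp))
  obtain ⟨hsn, hsx, hsy, hspar⟩ := of_mem_stepsU_coord hbw (i := r₂) ((hmU _).2 (by simp))
  obtain ⟨hr3n, hr3x, hr3y, hr3par⟩ := of_mem_stepsU_coord hbw (i := r₃) ((hmU _).2 (by simp))
  have hhor' : ∀ i, i < m → i ≠ p₁ → i ≠ p₂ → i ≠ p₃ → i ≠ r₁ → i ≠ r₂ → i ≠ r₃ →
      ω (i + 1) 1 = ω i 1 ∧ (ω (i + 1) 0 = ω i 0 + 1 ∨ ω (i + 1) 0 = ω i 0 - 1) :=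
    fun i hi n1 n2 n3 n4 n5 n6 => hhor i hi (by rw [hmD]; omega) (by rw [hmU]; omega)
  have hmem : ∀ i, i ≤ m → i ∈ {i | i ≤ m} := fun i hi => hi
  -- run 1 on row `−1` goes right and the first up step returns to the wall at column `r₁ − 1`
  obtain ⟨e1, he1, hrun1⟩ := run_const_velocity hinj (a := p₁ + 1) (b := r₁) (by omega) (by omega)
    (fun i hi1 hi2 => hhor' i (by omega) (by omega) (by omega) (by omega) (by omega) (by omega) (by omega))
  have hx : (p₁ : ℤ) + 1 ≤ ω r₁ 0 := by
    by_contra hlt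
    have hr1 := (hb' r₁ (by omega) (by omega)).1
    have hτ := hR0 (ω r₁ 0).toNat (by omega)
    have := hinj (hmem (r₁ + 1) (by omega)) (hmem (ω r₁ 0).toNat (by omega))
      (site_ext_cls (by rw [hrx, hτ.1]; omega) (by rw [hry, (hrun1 r₁ (by omega) le_rfl).2, hP1y, hτ.2]; rfl))
    omega
  obtain rfl : e1 = 1 := by
    rcases he1 with h | rfl
    · exact h
    exfalso; have := (hrun1 r₁ (by omega) le_rfl).1; rw [hP1x] at this; omega
  have hR1x : ω (r₁ + 1) 0 = r₁ - 1 := by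
    have := (hrun1 r₁ (by omega) le_rfl).1; rw [hP1x] at this; rw [hrx]; omega
  have hR1y : ω (r₁ + 1) 1 = 0 := by rw [hry, (hrun1 r₁ (by omega) le_rfl).2, hP1y]; rfl
  have hrev : r₁ % 2 = 0 := by
    have h1 := (hrun1 r₁ (by omega) le_rfl).1; have h2 := (hrun1 r₁ (by omega) le_rfl).2
    rw [hP1x] at h1; rw [hP1y] at h2; rw [h1, h2] at hrpar; omega
  -- run 2 on the wall goes right (else the second down step lands on run 1, or the run crosses `ω p₁`)
  obtain ⟨e2, he2, hrun2⟩ := run_const_velocity hinj (a := r₁ + 1) (b := p₂) (by omega) (by omega)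
    (fun i hi1 hi2 => hhor' i (by omega) (by omega) (by omega) (by omega) (by omega) (by omega) (by omega))
  have hq2 : r₁ + 2 ≤ p₂ := by
    by_contra h
    obtain rfl : p₂ = r₁ + 1 := by omega
    have := hinj (hmem (r₁ + 1 + 1) (by omega)) (hmem r₁ (by omega))
      (site_ext_cls (by rw [hqx, hR1x, (hrun1 r₁ (by omega) le_rfl).1, hP1x]; omega)
        (by rw [hqy, hR1y, (hrun1 r₁ (by omega) le_rfl).2, hP1y]; rfl))
    omega
  obtain rfl : e2 = 1 := by
    rcases he2 with h | rfl
    · exact h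
    exfalso
    have hQx := (hrun2 p₂ (by omega) le_rfl).1
    have hQy := (hrun2 p₂ (by omega) le_rfl).2
    rw [hR1x] at hQx; rw [hR1y] at hQy
    by_cases hc : p₁ + p₂ ≤ 2 * r₁
    · have h1 := hrun1 (2 * r₁ - p₂ + 1) (by omega) (by omega)
      rw [hP1x, hP1y] at h1
      have := hinj (hmem (p₂ + 1) (by omega)) (hmem (2 * r₁ - p₂ + 1) (by omega))
        (site_ext_cls (by rw [hqx, hQx, h1.1]; omega) (by rw [hqy, hQy, h1.2]; rfl))
      omega
    · have h1 := hrun2 (2 * r₁ - p₁) (by omega) (by omega)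
      rw [hR1x, hR1y] at h1
      have h2 := hR0 p₁ le_rfl
      have := hinj (hmem (2 * r₁ - p₁) (by omega)) (hmem p₁ (by omega))
        (site_ext_cls (by rw [h1.1, h2.1]; omega) (by rw [h1.2, h2.2]))
      omega
  have hQ1x : ω (p₂ + 1) 0 = p₂ - 2 := by
    rw [hqx, (hrun2 p₂ (by omega) le_rfl).1, hR1x]; omega
  have hQ1y : ω (p₂ + 1) 1 = -1 := by rw [hqy, (hrun2 p₂ (by omega) le_rfl).2, hR1y]; rfl
  have hq3 : r₁ + 3 ≤ p₂ := by rw [hQ1x, hQ1y] at hqpar; omega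
  -- heights after the second down step: row `−1` until `p₃`, row `−2` until `r₂`, row `−1` until `r₃`, then the wall
  obtain ⟨e3, -, hrun3⟩ := run_const_velocity hinj (a := p₂ + 1) (b := p₃) (by omega) (by omega)
    (fun i hi1 hi2 => hhor' i (by omega) (by omega) (by omega) (by omega) (by omega) (by omega) (by omega))
  have hC1y : ω (p₃ + 1) 1 = -2 := by rw [hq3y, (hrun3 p₃ (by omega) le_rfl).2, hQ1y]; rfl
  obtain ⟨e4, -, hrun4⟩ := run_const_velocity hinj (a := p₃ + 1) (b := r₂) (by omega) (by omega)
    (fun i hi1 hi2 => hhor' i (by omega) (by omega) (by omega) (by omega) (by omega) (by omega) (by omega))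
  have hD1y : ω (r₂ + 1) 1 = -1 := by rw [hsy, (hrun4 r₂ (by omega) le_rfl).2, hC1y]; rfl
  obtain ⟨e5, -, hrun5⟩ := run_const_velocity hinj (a := r₂ + 1) (b := r₃) (by omega) (by omega)
    (fun i hi1 hi2 => hhor' i (by omega) (by omega) (by omega) (by omega) (by omega) (by omega) (by omega))
  have hSy : ω r₃ 1 = -1 := by rw [(hrun5 r₃ (by omega) le_rfl).2, hD1y]
  have hS1y : ω (r₃ + 1) 1 = 0 := by rw [hr3y, hSy]; rfl
  have hsev : r₃ % 2 = 0 := by have := parity_apply hs (show r₃ ≤ m by omega); rw [hSy] at this; omega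
  -- the final wall run goes right
  obtain ⟨e6, he6, hrun6⟩ := run_const_velocity hinj (a := r₃ + 1) (b := m) (by omega) le_rfl
    (fun i hi1 hi2 => hhor' i (by omega) (by omega) (by omega) (by omega) (by omega) (by omega) (by omega))
  obtain rfl : e6 = 1 := by
    rcases he6 with h | rfl
    · exact h
    exfalso
    have hN := (hrun6 m (by omega) le_rfl).1
    have hbn := (hb' (r₃ + 1) (by omega) (by omega)).2
    omega
  have hN := (hrun6 m (by omega) le_rfl).1
  -- the visit count: initial wall run, interior wall run `r₁+1 … p₂`, final wall run
  have hvf : visits m ω = p₁ / 2 + (p₂ - r₁) / 2 + (m - r₃) / 2 := by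
    have hv1 : visits p₁ ω = p₁ / 2 := visits_eq_div_two_of_wall (fun i _ hi2 => (hR0 i hi2).2)
    have hv2 : visits r₁ ω = visits p₁ ω := by
      have := visits_add_eq_left (k := p₁) (b := r₁ - p₁) (ζ := ω) (fun j hj1 hj2 => ?_)
      · rwa [show p₁ + (r₁ - p₁) = r₁ by omega] at this
      rintro ⟨-, hy⟩
      have := (hrun1 (p₁ + j) (by omega) (by omega)).2; rw [hP1y] at this; omega
    have hv3 : visits m ω = visits r₁ ω + visits (m - r₁) (fun j => ω (r₁ + j)) := by
      have := visits_add (a := r₁) (b := m - r₁) (ζ := ω) (ξ := fun j => ω (r₁ + j)) hrev (fun j _ _ => rfl)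
      rwa [show r₁ + (m - r₁) = m by omega] at this
    have hv4 : visits (p₂ - r₁) (fun j => ω (r₁ + j)) = (p₂ - r₁) / 2 :=
      visits_eq_div_two_of_wall (fun i hi1 hi2 => by
        show ω (r₁ + i) 1 = 0
        rw [(hrun2 (r₁ + i) (by omega) (by omega)).2, hR1y])
    have hv5 : visits (r₃ - r₁) (fun j => ω (r₁ + j)) = visits (p₂ - r₁) (fun j => ω (r₁ + j)) := by
      have := visits_add_eq_left (k := p₂ - r₁) (b := r₃ - p₂) (ζ := fun j => ω (r₁ + j)) (fun j hj1 hj2 => ?_)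
      · rwa [show p₂ - r₁ + (r₃ - p₂) = r₃ - r₁ by omega] at this
      rintro ⟨-, hy⟩
      have hy : ω (r₁ + (p₂ - r₁ + j)) 1 = 0 := hy
      rw [show r₁ + (p₂ - r₁ + j) = p₂ + j by omega] at hy
      rcases Nat.lt_or_ge (p₂ + j) (p₃ + 1) with hj | hj
      · have := (hrun3 (p₂ + j) (by omega) (by omega)).2; rw [hQ1y] at this; omega
      rcases Nat.lt_or_ge (p₂ + j) (r₂ + 1) with hja | hja
      · have := (hrun4 (p₂ + j) hj (by omega)).2; rw [hC1y] at this; omega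
      · have := (hrun5 (p₂ + j) hja (by omega)).2; rw [hD1y] at this; omega
    have hv6 : visits (m - r₁) (fun j => ω (r₁ + j)) =
        visits (r₃ - r₁) (fun j => ω (r₁ + j)) + visits (m - r₃) (fun _ => (0 : Site 2)) := by
      have := visits_add (a := r₃ - r₁) (b := m - r₃) (ζ := fun j => ω (r₁ + j)) (ξ := fun _ => (0 : Site 2))
        (by omega) (fun j hj1 hj2 => ?_)
      · rwa [show r₃ - r₁ + (m - r₃) = m - r₁ by omega] at this
      show ω (r₁ + (r₃ - r₁ + j)) 1 = (0 : Site 2) 1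
      rw [show r₁ + (r₃ - r₁ + j) = r₃ + j by omega, (hrun6 (r₃ + j) (by omega) (by omega)).2, hS1y]; rfl
    have hv7 : visits (m - r₃) (fun _ => (0 : Site 2)) = (m - r₃) / 2 := visits_eq_div_two_of_wall (fun i _ _ => rfl)
    rw [hv3, hv2, hv1, hv6, hv5, hv4, hv7]; omega
  -- slack-two numerics: three down steps force `X = 2k + 2`, whence the exit column `ω (r₃+1) 0 = p₁ + p₂ − r₁ + 1`
  have hcard : #(stepsD m ω) = 3 := by
    rw [hD, Finset.card_insert_of_notMem (by simp; omega), Finset.card_insert_of_notMem (by simp; omega),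
      Finset.card_singleton]
  obtain ⟨hX, -, -, hX4, -, -, -⟩ := slack_two_counts hk hm hω hv
  have hX2 : ω m 0 = 2 * k + 2 := by
    rcases hX with h | h
    · exact h
    · have := hX4 h; omega
  rw [hvf] at hv
  have hpar2 : p₂ % 2 = 1 := by have := parity_apply hs (show p₂ + 1 ≤ m by omega); rw [hQ1x, hQ1y] at this; omega
  have hx5 : ω (r₃ + 1) 0 = p₁ + p₂ - r₁ + 1 := by rw [hN] at hX2; omega
  -- but the exit site `(ω (r₃+1) 0, 0)` must be a fresh wall site right of the interior wall run
  have hS1 := (hb' (r₃ + 1) (by omega) (by omega)).1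
  rcases lt_or_ge (ω (r₃ + 1) 0) (p₁ + 1 : ℤ) with h1 | h1
  · -- on the initial wall run
    have hτ := hR0 (ω (r₃ + 1) 0).toNat (by omega)
    have := hinj (hmem (r₃ + 1) (by omega)) (hmem (ω (r₃ + 1) 0).toNat (by omega))
      (site_ext_cls (by rw [hτ.1]; omega) (by rw [hS1y, hτ.2]))
    omega
  rcases lt_or_ge (ω (r₃ + 1) 0) (r₁ - 1 : ℤ) with h2 | h2
  · -- above run 1: the up step at `r₃` starts on run 1
    have h1' := hrun1 ((ω (r₃ + 1) 0).toNat + 1) (by omega) (by omega)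
    rw [hP1x, hP1y] at h1'
    have := hinj (hmem r₃ (by omega)) (hmem ((ω (r₃ + 1) 0).toNat + 1) (by omega))
      (site_ext_cls (by rw [h1'.1]; omega) (by rw [hSy, h1'.2]))
    omega
  · -- on the interior wall run
    have h1' := hrun2 ((ω (r₃ + 1) 0).toNat + 2) (by omega) (by omega)
    rw [hR1x, hR1y] at h1'
    have := hinj (hmem (r₃ + 1) (by omega)) (hmem ((ω (r₃ + 1) 0).toNat + 2) (by omega))
      (site_ext_cls (by rw [h1'.1]; omega) (by rw [hS1y, h1'.2]))
    omega

set_option maxHeartbeats 400000 in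
/-- **The order `D D U U D U` is impossible at slack two** (PROOF-slack2 §5 ¶3): the visit count
`k = (p₁ − 1)/2 + (p₃ − r₂ − 1)/2 + (m − r₃)/2` and `X = 2k + 2` give the last exit column
`ω r₃ 0 = p₁ + (p₃ − r₂ − 1) + 2`; the final wall run must clear the first wall return `x₄ = ω r₂ 0 ≥ p₁ + 1` and the
interior wall run: if that run goes right this forces `x₄ = p₁ + 1`, of the wrong parity; if it goes left it ends at
`(p₁ + 1, 0)`, and the last run below the wall, from `(p₁ + 1, −1)` to the column `x₄ + 1`, passes the site `ω r₂`.
[cite: MadrasSlade1993, §4.2, Definition 4.2.1; EntingJensen2009, §7.4.2, Fig. 7.10] -/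
theorem dduudu_false {k m : ℕ} (hk : 2 ≤ k) (hm : m = 6 * k + 2) (hω : ω ∈ ipwb m) (hv : visits m ω = k)
    {p₁ p₂ p₃ r₁ r₂ r₃ : ℕ} (hD : stepsD m ω = {p₁, p₂, p₃}) (hU : stepsU m ω = {r₁, r₂, r₃}) (h12 : p₁ < p₂)
    (h23 : p₂ < p₃) (hr12 : r₁ < r₂) (hr23 : r₂ < r₃) (h1 : p₁ < r₁) (h2 : p₂ < r₂) (h3 : p₃ < r₃)
    (hp1 : 1 ≤ p₁) (hpodd : p₁ % 2 = 1) (hR0 : ∀ i, i ≤ p₁ → ω i 0 = i ∧ ω i 1 = 0)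
    (hP1y : ω (p₁ + 1) 1 = -1)
    (hhor : ∀ i, i < m → i ∉ stepsD m ω → i ∉ stepsU m ω →
      ω (i + 1) 1 = ω i 1 ∧ (ω (i + 1) 0 = ω i 0 + 1 ∨ ω (i + 1) 0 = ω i 0 - 1))
    (ho1 : p₂ < r₁) (ho2 : r₂ < p₃) : False := by
  classical
  obtain ⟨hp, hn1, hirr⟩ := mem_ipwb.1 hω
  obtain ⟨hw, hb⟩ := mem_pwb.1 hp
  obtain ⟨ha, -⟩ := mem_wbr.1 hw
  obtain ⟨hh, -, -⟩ := mem_archs.1 ha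
  obtain ⟨hs, hhp⟩ := mem_hpw.1 hh
  obtain ⟨h0, -, hbw, hinj⟩ := mem_saws_iff.1 hs
  have hX0 : ω 0 0 = 0 := by rw [h0]; rfl
  have hb' : ∀ i, 1 ≤ i → i ≤ m → 0 < ω i 0 ∧ ω i 0 ≤ ω m 0 := fun i h1 h2 => by
    have := hb i h1 h2; rwa [hX0] at this
  have hmD : ∀ i, i ∈ stepsD m ω ↔ i = p₁ ∨ i = p₂ ∨ i = p₃ := fun i => by
    rw [hD]; simp only [Finset.mem_insert, Finset.mem_singleton]
  have hmU : ∀ i, i ∈ stepsU m ω ↔ i = r₁ ∨ i = r₂ ∨ i = r₃ := fun i => by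
    rw [hU]; simp only [Finset.mem_insert, Finset.mem_singleton]
  obtain ⟨hqn, hqx, hqy, hqpar⟩ := of_mem_stepsD_coord hbw (i := p₂) ((hmD _).2 (by simp))
  obtain ⟨hq3n, hq3x, hq3y, hq3par⟩ := of_mem_stepsD_coord hbw (i := p₃) ((hmD _).2 (by simp))
  obtain ⟨hrn, hrx, hry, hrpar⟩ := of_mem_stepsU_coord hbw (i := r₁) ((hmU _).2 (by simp))
  obtain ⟨hsn, hsx, hsy, hspar⟩ := of_mem_stepsU_coord hbw (i := r₂) ((hmU _).2 (by simp))
  obtain ⟨hr3n, hr3x, hr3y, hr3par⟩ := of_mem_stepsU_coord hbw (i := r₃) ((hmU _).2 (by simp))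
  have hhor' : ∀ i, i < m → i ≠ p₁ → i ≠ p₂ → i ≠ p₃ → i ≠ r₁ → i ≠ r₂ → i ≠ r₃ →
      ω (i + 1) 1 = ω i 1 ∧ (ω (i + 1) 0 = ω i 0 + 1 ∨ ω (i + 1) 0 = ω i 0 - 1) :=
    fun i hi n1 n2 n3 n4 n5 n6 => hhor i hi (by rw [hmD]; omega) (by rw [hmU]; omega)
  have hmem : ∀ i, i ≤ m → i ∈ {i | i ≤ m} := fun i hi => hi
  -- heights: rows `−1, −2, −1`, the wall from `r₂ + 1` to `p₃`, row `−1` until `r₃`, then the wall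
  obtain ⟨e1, -, hrun1⟩ := run_const_velocity hinj (a := p₁ + 1) (b := p₂) (by omega) (by omega)
    (fun i hi1 hi2 => hhor' i (by omega) (by omega) (by omega) (by omega) (by omega) (by omega) (by omega))
  have hQ1y : ω (p₂ + 1) 1 = -2 := by rw [hqy, (hrun1 p₂ (by omega) le_rfl).2, hP1y]; rfl
  obtain ⟨e2, -, hrun2⟩ := run_const_velocity hinj (a := p₂ + 1) (b := r₁) (by omega) (by omega)
    (fun i hi1 hi2 => hhor' i (by omega) (by omega) (by omega) (by omega) (by omega) (by omega) (by omega))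
  have hC1y : ω (r₁ + 1) 1 = -1 := by rw [hry, (hrun2 r₁ (by omega) le_rfl).2, hQ1y]; rfl
  obtain ⟨e3, -, hrun3⟩ := run_const_velocity hinj (a := r₁ + 1) (b := r₂) (by omega) (by omega)
    (fun i hi1 hi2 => hhor' i (by omega) (by omega) (by omega) (by omega) (by omega) (by omega) (by omega))
  have hSy : ω r₂ 1 = -1 := by rw [(hrun3 r₂ (by omega) le_rfl).2, hC1y]
  have hW1y : ω (r₂ + 1) 1 = 0 := by rw [hsy, hSy]; rfl
  have hr2ev : r₂ % 2 = 0 := by have := parity_apply hs (show r₂ ≤ m by omega); rw [hSy] at this; omega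
  obtain ⟨ε, hε, hrunW⟩ := run_const_velocity hinj (a := r₂ + 1) (b := p₃) (by omega) (by omega)
    (fun i hi1 hi2 => hhor' i (by omega) (by omega) (by omega) (by omega) (by omega) (by omega) (by omega))
  have hTy : ω p₃ 1 = 0 := by rw [(hrunW p₃ (by omega) le_rfl).2, hW1y]
  have hT1y : ω (p₃ + 1) 1 = -1 := by rw [hq3y, hTy]; rfl
  have hcW : ω p₃ 0 = ω r₂ 0 + ε * ((p₃ - (r₂ + 1) : ℕ) : ℤ) := by rw [(hrunW p₃ (by omega) le_rfl).1, hsx]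
  have hp3odd : p₃ % 2 = 1 := by
    have := parity_apply hs (show p₃ + 1 ≤ m by omega); rw [hq3x, hT1y] at this; omega
  obtain ⟨e5, he5, hrun5⟩ := run_const_velocity hinj (a := p₃ + 1) (b := r₃) (by omega) (by omega)
    (fun i hi1 hi2 => hhor' i (by omega) (by omega) (by omega) (by omega) (by omega) (by omega) (by omega))
  have hUy : ω r₃ 1 = -1 := by rw [(hrun5 r₃ (by omega) le_rfl).2, hT1y]
  have hU1y : ω (r₃ + 1) 1 = 0 := by rw [hr3y, hUy]; rfl
  have hr3ev : r₃ % 2 = 0 := by have := parity_apply hs (show r₃ ≤ m by omega); rw [hUy] at this; omega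
  have hx6 : ω r₃ 0 = ω p₃ 0 + e5 * ((r₃ - (p₃ + 1) : ℕ) : ℤ) := by rw [(hrun5 r₃ (by omega) le_rfl).1, hq3x]
  -- the final wall run goes right
  obtain ⟨e6, he6, hrun6⟩ := run_const_velocity hinj (a := r₃ + 1) (b := m) (by omega) le_rfl
    (fun i hi1 hi2 => hhor' i (by omega) (by omega) (by omega) (by omega) (by omega) (by omega) (by omega))
  obtain rfl : e6 = 1 := by
    rcases he6 with h | rfl
    · exact h
    exfalso
    have hN := (hrun6 m (by omega) le_rfl).1
    have hbn := (hb' (r₃ + 1) (by omega) (by omega)).2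
    omega
  have hN := (hrun6 m (by omega) le_rfl).1
  -- the visit count: initial wall run, interior wall run `r₂+1 … p₃`, final wall run
  have hvf : visits m ω = p₁ / 2 + (p₃ - r₂) / 2 + (m - r₃) / 2 := by
    have hv1 : visits p₁ ω = p₁ / 2 := visits_eq_div_two_of_wall (fun i _ hi2 => (hR0 i hi2).2)
    have hv2 : visits r₂ ω = visits p₁ ω := by
      have := visits_add_eq_left (k := p₁) (b := r₂ - p₁) (ζ := ω) (fun j hj1 hj2 => ?_)
      · rwa [show p₁ + (r₂ - p₁) = r₂ by omega] at this
      rintro ⟨-, hy⟩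
      rcases Nat.lt_or_ge (p₁ + j) (p₂ + 1) with hj | hj
      · have := (hrun1 (p₁ + j) (by omega) (by omega)).2; rw [hP1y] at this; omega
      rcases Nat.lt_or_ge (p₁ + j) (r₁ + 1) with hja | hja
      · have := (hrun2 (p₁ + j) hj (by omega)).2; rw [hQ1y] at this; omega
      · have := (hrun3 (p₁ + j) hja (by omega)).2; rw [hC1y] at this; omega
    have hv3 : visits m ω = visits r₂ ω + visits (m - r₂) (fun j => ω (r₂ + j)) := by
      have := visits_add (a := r₂) (b := m - r₂) (ζ := ω) (ξ := fun j => ω (r₂ + j)) hr2ev (fun j _ _ => rfl)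
      rwa [show r₂ + (m - r₂) = m by omega] at this
    have hv4 : visits (p₃ - r₂) (fun j => ω (r₂ + j)) = (p₃ - r₂) / 2 :=
      visits_eq_div_two_of_wall (fun i hi1 hi2 => by
        show ω (r₂ + i) 1 = 0
        rw [(hrunW (r₂ + i) (by omega) (by omega)).2, hW1y])
    have hv5 : visits (r₃ - r₂) (fun j => ω (r₂ + j)) = visits (p₃ - r₂) (fun j => ω (r₂ + j)) := by
      have := visits_add_eq_left (k := p₃ - r₂) (b := r₃ - p₃) (ζ := fun j => ω (r₂ + j)) (fun j hj1 hj2 => ?_)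
      · rwa [show p₃ - r₂ + (r₃ - p₃) = r₃ - r₂ by omega] at this
      rintro ⟨-, hy⟩
      have hy : ω (r₂ + (p₃ - r₂ + j)) 1 = 0 := hy
      rw [show r₂ + (p₃ - r₂ + j) = p₃ + j by omega, (hrun5 (p₃ + j) (by omega) (by omega)).2, hT1y] at hy
      omega
    have hv6 : visits (m - r₂) (fun j => ω (r₂ + j)) =
        visits (r₃ - r₂) (fun j => ω (r₂ + j)) + visits (m - r₃) (fun _ => (0 : Site 2)) := by
      have := visits_add (a := r₃ - r₂) (b := m - r₃) (ζ := fun j => ω (r₂ + j)) (ξ := fun _ => (0 : Site 2))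
        (by omega) (fun j hj1 hj2 => ?_)
      · rwa [show r₃ - r₂ + (m - r₃) = m - r₂ by omega] at this
      show ω (r₂ + (r₃ - r₂ + j)) 1 = (0 : Site 2) 1
      rw [show r₂ + (r₃ - r₂ + j) = r₃ + j by omega, (hrun6 (r₃ + j) (by omega) (by omega)).2, hU1y]; rfl
    have hv7 : visits (m - r₃) (fun _ => (0 : Site 2)) = (m - r₃) / 2 := visits_eq_div_two_of_wall (fun i _ _ => rfl)
    rw [hv3, hv2, hv1, hv6, hv5, hv4, hv7]; omega
  -- slack-two numerics: `X = 2k + 2`, whence the last exit column `ω r₃ 0 = p₁ + p₃ − r₂ + 1`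
  have hcard : #(stepsD m ω) = 3 := by
    rw [hD, Finset.card_insert_of_notMem (by simp; omega), Finset.card_insert_of_notMem (by simp; omega),
      Finset.card_singleton]
  obtain ⟨hX, -, -, hX4, -, -, -⟩ := slack_two_counts hk hm hω hv
  have hX2 : ω m 0 = 2 * k + 2 := by
    rcases hX with h | h
    · exact h
    · have := hX4 h; omega
  rw [hvf] at hv
  have hx6v : ω r₃ 0 = p₁ + p₃ - r₂ + 1 := by rw [hr3x] at hN; rw [hN] at hX2; omega
  -- geometry: the first wall return `x₄ = ω r₂ 0` lies right of the initial run, the last exit right of `x₄`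
  have hx4p : (p₁ : ℤ) + 1 ≤ ω r₂ 0 := by
    by_contra hlt
    have hs1 := (hb' r₂ (by omega) (by omega)).1
    have hτ := hR0 (ω r₂ 0).toNat (by omega)
    have := hinj (hmem (r₂ + 1) (by omega)) (hmem (ω r₂ 0).toNat (by omega))
      (site_ext_cls (by rw [hsx, hτ.1]; omega) (by rw [hW1y, hτ.2]))
    omega
  have hx64 : ω r₂ 0 < ω r₃ 0 := by
    by_contra hle
    -- the final wall run passes the wall-return site `ω (r₂ + 1)`
    have hbm := (hb' (r₂ + 1) (by omega) (by omega)).2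
    have h1 := hrun6 (r₃ + 1 + ((ω r₂ 0).toNat - (ω r₃ 0).toNat)) (by omega) (by omega)
    rw [hr3x, hU1y] at h1
    have hpos := (hb' r₃ (by omega) (by omega)).1
    have := hinj (hmem (r₃ + 1 + ((ω r₂ 0).toNat - (ω r₃ 0).toNat)) (by omega)) (hmem (r₂ + 1) (by omega))
      (site_ext_cls (by rw [h1.1, hsx]; omega) (by rw [h1.2, hW1y]))
    omega
  rcases hε with rfl | rfl
  · -- the interior wall run goes right: the exit must clear it, forcing `x₄ = p₁ + 1`, of the wrong parity
    by_cases hcol : ω r₃ 0 ≤ ω r₂ 0 + ((p₃ - (r₂ + 1) : ℕ) : ℤ)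
    · have h1 := hrunW (r₂ + 1 + ((ω r₃ 0).toNat - (ω r₂ 0).toNat)) (by omega) (by omega)
      rw [hsx, hW1y] at h1
      have hpos := (hb' r₂ (by omega) (by omega)).1
      have := hinj (hmem (r₃ + 1) (by omega)) (hmem (r₂ + 1 + ((ω r₃ 0).toNat - (ω r₂ 0).toNat)) (by omega))
        (site_ext_cls (by rw [hr3x, h1.1]; omega) (by rw [hU1y, h1.2]))
      omega
    · rw [hSy] at hspar; omega
  · -- the interior wall run goes left to `ω p₃ 0 = p₁ + 1`; then run 5 passes the site `ω r₂` under `x₄`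
    have hcp : (p₁ : ℤ) + 1 ≤ ω p₃ 0 := by
      by_contra hlt
      have hs1 := (hb' p₃ (by omega) (by omega)).1
      have hτ := hR0 (ω p₃ 0).toNat (by omega)
      have := hinj (hmem p₃ (by omega)) (hmem (ω p₃ 0).toNat (by omega))
        (site_ext_cls (by rw [hτ.1]; omega) (by rw [hTy, hτ.2]))
      omega
    obtain rfl : e5 = 1 := by rcases he5 with rfl | rfl <;> [rfl; (exfalso; omega)]
    have h1 := hrun5 (p₃ + 1 + ((ω r₂ 0).toNat - (ω p₃ 0).toNat)) (by omega) (by omega)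
    rw [hq3x, hT1y] at h1
    have := hinj (hmem (p₃ + 1 + ((ω r₂ 0).toNat - (ω p₃ 0).toNat)) (by omega)) (hmem r₂ (by omega))
      (site_ext_cls (by rw [h1.1]; omega) (by rw [h1.2, hSy]))
    omega

set_option maxHeartbeats 400000 in
/-- **Two runs on one row are disjoint** (self-avoidance, for runs given in closed form). [cite: MadrasSlade1993, §4.2, Definition 4.2.1; EntingJensen2009, §7.4.2, Fig. 7.10] -/
theorem runs_disjoint {m a₁ b₁ a₂ b₂ : ℕ} {x₁ x₂ e₁ e₂ y : ℤ} (hinj : Set.InjOn ω {i | i ≤ m}) (hlt : b₁ < a₂)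
    (hbm : b₂ ≤ m) (hrunA : ∀ i, a₁ ≤ i → i ≤ b₁ → ω i 0 = x₁ + e₁ * ((i - a₁ : ℕ) : ℤ) ∧ ω i 1 = y)
    (hrunB : ∀ i, a₂ ≤ i → i ≤ b₂ → ω i 0 = x₂ + e₂ * ((i - a₂ : ℕ) : ℤ) ∧ ω i 1 = y) :
    ∀ i j, a₁ ≤ i → i ≤ b₁ → a₂ ≤ j → j ≤ b₂ → ω i 0 ≠ ω j 0 := by
  intro i j hi1 hi2 hj1 hj2 hx
  have hmem : ∀ i, i ≤ m → i ∈ {i | i ≤ m} := fun i hi => hi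
  have := hinj (hmem i (by omega)) (hmem j (by omega))
    (site_ext_cls hx (by rw [(hrunA i hi1 hi2).2, (hrunB j hj1 hj2).2]))
  omega

set_option maxHeartbeats 400000 in
/-- DDUDUU, step 1 — **the runs**: rows `−1, −2, −1, −2, −1`, then the final wall run rightward; the columns
`c₂ = ω p₂ 0`, `c₃ = ω r₁ 0`, `c₄ = ω p₃ 0`, `c₅ = ω r₂ 0` are even, and the visit count forces `r₃ = p₁ + 4k + 1` and the
last up column `ω r₃ 0 = p₁ + 2`. [cite: MadrasSlade1993, §4.2, Definition 4.2.1; EntingJensen2009, §7.4.2, Fig. 7.10] -/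
theorem dduduu_runs {k m : ℕ} (hk : 2 ≤ k) (hm : m = 6 * k + 2) (hω : ω ∈ ipwb m) (hv : visits m ω = k)
    {p₁ p₂ p₃ r₁ r₂ r₃ : ℕ} (hD : stepsD m ω = {p₁, p₂, p₃}) (hU : stepsU m ω = {r₁, r₂, r₃}) (h12 : p₁ < p₂)
    (ho1 : p₂ < r₁) (ho2 : r₁ < p₃) (ho3 : p₃ < r₂) (hr23 : r₂ < r₃) (hp1 : 1 ≤ p₁)
    (hR0 : ∀ i, i ≤ p₁ → ω i 0 = i ∧ ω i 1 = 0) (hP1x : ω (p₁ + 1) 0 = p₁) (hP1y : ω (p₁ + 1) 1 = -1)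
    (hhor : ∀ i, i < m → i ∉ stepsD m ω → i ∉ stepsU m ω →
      ω (i + 1) 1 = ω i 1 ∧ (ω (i + 1) 0 = ω i 0 + 1 ∨ ω (i + 1) 0 = ω i 0 - 1)) :
    ∃ e₁ e₂ e₃ e₄ e₅ : ℤ, (e₁ = 1 ∨ e₁ = -1) ∧ (e₂ = 1 ∨ e₂ = -1) ∧ (e₃ = 1 ∨ e₃ = -1) ∧ (e₄ = 1 ∨ e₄ = -1) ∧
      (e₅ = 1 ∨ e₅ = -1) ∧
      (∀ i, p₁ + 1 ≤ i → i ≤ p₂ → ω i 0 = p₁ + e₁ * ((i - (p₁ + 1) : ℕ) : ℤ) ∧ ω i 1 = -1) ∧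
      (∀ i, p₂ + 1 ≤ i → i ≤ r₁ → ω i 0 = ω p₂ 0 + e₂ * ((i - (p₂ + 1) : ℕ) : ℤ) ∧ ω i 1 = -2) ∧
      (∀ i, r₁ + 1 ≤ i → i ≤ p₃ → ω i 0 = ω r₁ 0 + e₃ * ((i - (r₁ + 1) : ℕ) : ℤ) ∧ ω i 1 = -1) ∧
      (∀ i, p₃ + 1 ≤ i → i ≤ r₂ → ω i 0 = ω p₃ 0 + e₄ * ((i - (p₃ + 1) : ℕ) : ℤ) ∧ ω i 1 = -2) ∧
      (∀ i, r₂ + 1 ≤ i → i ≤ r₃ → ω i 0 = ω r₂ 0 + e₅ * ((i - (r₂ + 1) : ℕ) : ℤ) ∧ ω i 1 = -1) ∧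
      ω r₃ 0 = p₁ + 2 ∧ ω p₂ 0 % 2 = 0 ∧ ω r₁ 0 % 2 = 0 ∧ ω p₃ 0 % 2 = 0 ∧ ω r₂ 0 % 2 = 0 ∧
      0 < ω p₂ 0 ∧ 0 < ω r₁ 0 ∧ 0 < ω p₃ 0 ∧ 0 < ω r₂ 0 ∧ r₁ + 2 ≤ p₃ ∧ r₃ < m := by
  classical
  obtain ⟨hpw, hn1, hirr⟩ := mem_ipwb.1 hω
  obtain ⟨hw, hb⟩ := mem_pwb.1 hpw
  obtain ⟨ha, -⟩ := mem_wbr.1 hw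
  obtain ⟨hh, -, -⟩ := mem_archs.1 ha
  obtain ⟨hs, hhp⟩ := mem_hpw.1 hh
  obtain ⟨h0, -, hbw, hinj⟩ := mem_saws_iff.1 hs
  have hX0 : ω 0 0 = 0 := by rw [h0]; rfl
  have hb' : ∀ i, 1 ≤ i → i ≤ m → 0 < ω i 0 ∧ ω i 0 ≤ ω m 0 := fun i h1 h2 => by
    have := hb i h1 h2; rwa [hX0] at this
  have hmem : ∀ i, i ≤ m → i ∈ {i | i ≤ m} := fun i hi => hi
  have hmD : ∀ i, i ∈ stepsD m ω ↔ i = p₁ ∨ i = p₂ ∨ i = p₃ := fun i => by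
    rw [hD]; simp only [Finset.mem_insert, Finset.mem_singleton]
  have hmU : ∀ i, i ∈ stepsU m ω ↔ i = r₁ ∨ i = r₂ ∨ i = r₃ := fun i => by
    rw [hU]; simp only [Finset.mem_insert, Finset.mem_singleton]
  obtain ⟨-, -, -, hppar1⟩ := of_mem_stepsD_coord hbw (i := p₁) ((hmD _).2 (by simp))
  obtain ⟨hpn2, hpx2, hpy2, hppar2⟩ := of_mem_stepsD_coord hbw (i := p₂) ((hmD _).2 (by simp))
  obtain ⟨hpn3, hpx3, hpy3, hppar3⟩ := of_mem_stepsD_coord hbw (i := p₃) ((hmD _).2 (by simp))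
  obtain ⟨hrn1, hrx1, hry1, hrpar1⟩ := of_mem_stepsU_coord hbw (i := r₁) ((hmU _).2 (by simp))
  obtain ⟨hrn2, hrx2, hry2, hrpar2⟩ := of_mem_stepsU_coord hbw (i := r₂) ((hmU _).2 (by simp))
  obtain ⟨hrn3, hrx3, hry3, hrpar3⟩ := of_mem_stepsU_coord hbw (i := r₃) ((hmU _).2 (by simp))
  have hhor' : ∀ i, i < m → i ≠ p₁ → i ≠ p₂ → i ≠ p₃ → i ≠ r₁ → i ≠ r₂ → i ≠ r₃ →
      ω (i + 1) 1 = ω i 1 ∧ (ω (i + 1) 0 = ω i 0 + 1 ∨ ω (i + 1) 0 = ω i 0 - 1) :=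
    fun i hi n1 n2 n3 n4 n5 n6 => hhor i hi (by rw [hmD]; omega) (by rw [hmU]; omega)
  -- run 1 on row `−1`
  obtain ⟨e1, he1, hrun1⟩ := run_const_velocity hinj (a := p₁ + 1) (b := p₂) (by omega) (by omega)
    (fun i hi1 hi2 => hhor' i (by omega) (by omega) (by omega) (by omega) (by omega) (by omega) (by omega))
  have hQy : ω p₂ 1 = -1 := by rw [(hrun1 p₂ (by omega) le_rfl).2, hP1y]
  have hQ1y : ω (p₂ + 1) 1 = -2 := by rw [hpy2, hQy]; rfl
  have hbev : ω p₂ 0 % 2 = 0 := by rw [hpx2, hQ1y] at hppar2; omega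
  have hb1 := (hb' p₂ (by omega) (by omega)).1
  -- run 2 on row `−2`
  obtain ⟨e2, he2, hrun2⟩ := run_const_velocity hinj (a := p₂ + 1) (b := r₁) (by omega) (by omega)
    (fun i hi1 hi2 => hhor' i (by omega) (by omega) (by omega) (by omega) (by omega) (by omega) (by omega))
  have hCy : ω r₁ 1 = -2 := by rw [(hrun2 r₁ (by omega) le_rfl).2, hQ1y]
  have hC1y : ω (r₁ + 1) 1 = -1 := by rw [hry1, hCy]; rfl
  have hcev : ω r₁ 0 % 2 = 0 := by rw [hCy] at hrpar1; omega
  have hc1 := (hb' r₁ (by omega) (by omega)).1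
  -- run 3 on row `−1`
  obtain ⟨e3, he3, hrun3⟩ := run_const_velocity hinj (a := r₁ + 1) (b := p₃) (by omega) (by omega)
    (fun i hi1 hi2 => hhor' i (by omega) (by omega) (by omega) (by omega) (by omega) (by omega) (by omega))
  have hDy : ω p₃ 1 = -1 := by rw [(hrun3 p₃ (by omega) le_rfl).2, hC1y]
  have hD1y : ω (p₃ + 1) 1 = -2 := by rw [hpy3, hDy]; rfl
  have hdev : ω p₃ 0 % 2 = 0 := by rw [hpx3, hD1y] at hppar3; omega
  have hd1 := (hb' p₃ (by omega) (by omega)).1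
  -- run 4 on row `−2`
  obtain ⟨e4, he4, hrun4⟩ := run_const_velocity hinj (a := p₃ + 1) (b := r₂) (by omega) (by omega)
    (fun i hi1 hi2 => hhor' i (by omega) (by omega) (by omega) (by omega) (by omega) (by omega) (by omega))
  have hEy : ω r₂ 1 = -2 := by rw [(hrun4 r₂ (by omega) le_rfl).2, hD1y]
  have hE1y : ω (r₂ + 1) 1 = -1 := by rw [hry2, hEy]; rfl
  have heev : ω r₂ 0 % 2 = 0 := by rw [hEy] at hrpar2; omega
  have he1' := (hb' r₂ (by omega) (by omega)).1
  -- run 5 on row `−1`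
  obtain ⟨e5, he5, hrun5⟩ := run_const_velocity hinj (a := r₂ + 1) (b := r₃) (by omega) (by omega)
    (fun i hi1 hi2 => hhor' i (by omega) (by omega) (by omega) (by omega) (by omega) (by omega) (by omega))
  have hSy : ω r₃ 1 = -1 := by rw [(hrun5 r₃ (by omega) le_rfl).2, hE1y]
  have hS1y : ω (r₃ + 1) 1 = 0 := by rw [hry3, hSy]; rfl
  have hsev : r₃ % 2 = 0 := by have := parity_apply hs (show r₃ ≤ m by omega); rw [hSy] at this; omega
  -- run 6 on the wall goes right
  obtain ⟨e6, he6, hrun6⟩ := run_const_velocity hinj (a := r₃ + 1) (b := m) (by omega) le_rfl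
    (fun i hi1 hi2 => hhor' i (by omega) (by omega) (by omega) (by omega) (by omega) (by omega) (by omega))
  obtain rfl : e6 = 1 := by
    rcases he6 with h | rfl
    · exact h
    exfalso
    have hN := (hrun6 m (by omega) le_rfl).1
    have hbn := (hb' (r₃ + 1) (by omega) (by omega)).2
    rw [hrx3] at hN hbn
    omega
  have hR6 : ∀ j, r₃ + 1 ≤ j → j ≤ m → ω j 0 = ω r₃ 0 + ((j - (r₃ + 1) : ℕ) : ℤ) ∧ ω j 1 = 0 := fun j hj1 hj2 => by
    obtain ⟨hx, hy⟩ := hrun6 j hj1 hj2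
    rw [hrx3] at hx; rw [hS1y] at hy
    exact ⟨by rw [hx]; ring, hy⟩
  -- the visit count
  have hvf : visits m ω = p₁ / 2 + (m - r₃) / 2 := by
    have hv1 : visits p₁ ω = p₁ / 2 := visits_eq_div_two_of_wall (fun i _ hi2 => (hR0 i hi2).2)
    have hv2 : visits r₃ ω = visits p₁ ω := by
      have := visits_add_eq_left (k := p₁) (b := r₃ - p₁) (ζ := ω) (fun j hj1 hj2 => ?_)
      · rwa [show p₁ + (r₃ - p₁) = r₃ by omega] at this
      rintro ⟨-, hy⟩
      rcases Nat.lt_or_ge (p₁ + j) (p₂ + 1) with hj | hj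
      · have := (hrun1 (p₁ + j) (by omega) (by omega)).2; rw [hP1y] at this; omega
      rcases Nat.lt_or_ge (p₁ + j) (r₁ + 1) with hja | hja
      · have := (hrun2 (p₁ + j) hj (by omega)).2; rw [hQ1y] at this; omega
      rcases Nat.lt_or_ge (p₁ + j) (p₃ + 1) with hjb | hjb
      · have := (hrun3 (p₁ + j) hja (by omega)).2; rw [hC1y] at this; omega
      rcases Nat.lt_or_ge (p₁ + j) (r₂ + 1) with hjc | hjc
      · have := (hrun4 (p₁ + j) hjb (by omega)).2; rw [hD1y] at this; omega
      · have := (hrun5 (p₁ + j) hjc (by omega)).2; rw [hE1y] at this; omega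
    have hv3 : visits m ω = visits r₃ ω + visits (m - r₃) (fun _ => (0 : Site 2)) := by
      have := visits_add (a := r₃) (b := m - r₃) (ζ := ω) (ξ := fun _ => (0 : Site 2)) hsev (fun j hj1 hj2 => ?_)
      · rwa [show r₃ + (m - r₃) = m by omega] at this
      rw [(hR6 (r₃ + j) (by omega) (by omega)).2]; rfl
    have hv4 : visits (m - r₃) (fun _ => (0 : Site 2)) = (m - r₃) / 2 := visits_eq_div_two_of_wall (fun i _ _ => rfl)
    rw [hv3, hv2, hv1, hv4]
  -- slack-two numerics
  have hcard : #(stepsD m ω) = 3 := by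
    rw [hD, Finset.card_insert_of_notMem (by simp; omega), Finset.card_insert_of_notMem (by simp; omega),
      Finset.card_singleton]
  obtain ⟨hX, -, -, hX4, -, -, -⟩ := slack_two_counts hk hm hω hv
  have hX2 : ω m 0 = 2 * k + 2 := by
    rcases hX with h | h
    · exact h
    · have := hX4 h; omega
  have hN := (hR6 m (by omega) le_rfl).1
  rw [hvf] at hv
  have hpodd : p₁ % 2 = 1 := by rw [hP1x, hP1y] at hppar1; omega
  have hg : ω r₃ 0 = p₁ + 2 := by rw [hN] at hX2; omega
  have hr2 : r₁ + 2 ≤ p₃ := by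
    by_contra h
    obtain rfl : p₃ = r₁ + 1 := by omega
    have := hinj (hmem (r₁ + 1 + 1) (by omega)) (hmem r₁ (by omega))
      (site_ext_cls (by rw [hpx3, hrx1]) (by rw [hD1y, hCy]))
    omega
  refine ⟨e1, e2, e3, e4, e5, he1, he2, he3, he4, he5,
    fun i hi1 hi2 => ⟨by rw [(hrun1 i hi1 hi2).1, hP1x], by rw [(hrun1 i hi1 hi2).2, hP1y]⟩,
    fun i hi1 hi2 => ⟨by rw [(hrun2 i hi1 hi2).1, hpx2], by rw [(hrun2 i hi1 hi2).2, hQ1y]⟩,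
    fun i hi1 hi2 => ⟨by rw [(hrun3 i hi1 hi2).1, hrx1], by rw [(hrun3 i hi1 hi2).2, hC1y]⟩,
    fun i hi1 hi2 => ⟨by rw [(hrun4 i hi1 hi2).1, hpx3], by rw [(hrun4 i hi1 hi2).2, hD1y]⟩,
    fun i hi1 hi2 => ⟨by rw [(hrun5 i hi1 hi2).1, hrx2], by rw [(hrun5 i hi1 hi2).2, hE1y]⟩,
    hg, hbev, hcev, hdev, heev, hb1, hc1, hd1, he1', hr2, hrn3⟩

/-- **The order `D D U D U U` is impossible at slack two** (PROOF-slack2 §5 ¶4): by `dduduu_runs` the last up step is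
at the column `p₁ + 2`, two columns right of the first dive, both on row `−1`; the middle row-`−1` run (from `ω r₁` to
`ω p₃`) lies either left of the first run or right of the last one, and then one of the two row-`−2` runs joining
them passes under an endpoint of the other (`runs_disjoint`).
[cite: MadrasSlade1993, §4.2, Definition 4.2.1; EntingJensen2009, §7.4.2, Fig. 7.10] -/
theorem dduduu_false {k m : ℕ} (hk : 2 ≤ k) (hm : m = 6 * k + 2) (hω : ω ∈ ipwb m) (hv : visits m ω = k)
    {p₁ p₂ p₃ r₁ r₂ r₃ : ℕ} (hD : stepsD m ω = {p₁, p₂, p₃}) (hU : stepsU m ω = {r₁, r₂, r₃}) (h12 : p₁ < p₂)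
    (hr23 : r₂ < r₃) (h2 : p₂ < r₂)
    (hp1 : 1 ≤ p₁) (hpodd : p₁ % 2 = 1) (hR0 : ∀ i, i ≤ p₁ → ω i 0 = i ∧ ω i 1 = 0)
    (hP1x : ω (p₁ + 1) 0 = p₁) (hP1y : ω (p₁ + 1) 1 = -1)
    (hhor : ∀ i, i < m → i ∉ stepsD m ω → i ∉ stepsU m ω →
      ω (i + 1) 1 = ω i 1 ∧ (ω (i + 1) 0 = ω i 0 + 1 ∨ ω (i + 1) 0 = ω i 0 - 1))
    (ho1 : p₂ < r₁) (ho2 : r₁ < p₃) (ho3 : p₃ < r₂) : False := by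
  obtain ⟨hpw, -, -⟩ := mem_ipwb.1 hω
  obtain ⟨hw, -⟩ := mem_pwb.1 hpw
  have hinj : Set.InjOn ω {i | i ≤ m} :=
    (mem_saws_iff.1 (mem_hpw.1 (mem_archs.1 (mem_wbr.1 hw).1).1).1).2.2.2
  obtain ⟨e₁, e₂, e₃, e₄, e₅, he₁, he₂, he₃, he₄, he₅, hrun1, hrun2, hrun3, hrun4, hrun5, hg, hbev, hcev, hdev, heev,
    hb1, hc1, hd1, he1, hr2, hsm⟩ :=
    dduduu_runs hk hm hω hv hD hU h12 ho1 ho2 ho3 hr23 hp1 hR0 hP1x hP1y hhor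
  have hb := (hrun1 p₂ (by omega) le_rfl).1
  have hc := (hrun2 r₁ (by omega) le_rfl).1
  have hd := (hrun3 p₃ (by omega) le_rfl).1
  have he := (hrun4 r₂ (by omega) le_rfl).1
  have hg' := (hrun5 r₃ (by omega) le_rfl).1
  have h3s : ω (r₁ + 1) 0 = ω r₁ 0 := by simpa using (hrun3 (r₁ + 1) le_rfl (by omega)).1
  have h4s : ω (p₃ + 1) 0 = ω p₃ 0 := by simpa using (hrun4 (p₃ + 1) le_rfl (by omega)).1
  have h5s : ω (r₂ + 1) 0 = ω r₂ 0 := by simpa using (hrun5 (r₂ + 1) le_rfl (by omega)).1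
  have hd15 := runs_disjoint hinj (show p₂ < r₂ + 1 by omega) hsm.le hrun1 hrun5
  have hd13 := runs_disjoint hinj (show p₂ < r₁ + 1 by omega) (show p₃ ≤ m by omega) hrun1 hrun3
  have hd35 := runs_disjoint hinj (show p₃ < r₂ + 1 by omega) hsm.le hrun3 hrun5
  have hd24 := runs_disjoint hinj (show r₁ < p₃ + 1 by omega) (show r₂ ≤ m by omega) hrun2 hrun4
  -- `c₅ ≥ p₁ + 1`: else run 5, rising to `p₁ + 2`, crosses the column `p₁` of `ω (p₁+1)`
  have hep : (p₁ : ℤ) + 1 ≤ ω r₂ 0 := by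
    by_contra hlt
    rcases he₅ with rfl | rfl
    · refine hd15 (p₁ + 1) (r₂ + 1 + (p₁ - (ω r₂ 0).toNat)) le_rfl (by omega) (by omega) (by omega) ?_
      rw [hP1x, (hrun5 (r₂ + 1 + (p₁ - (ω r₂ 0).toNat)) (by omega) (by omega)).1]; omega
    · omega
  -- `c₂ ≤ p₁ + 1`: else `(p₁+2, −1)` lies on run 1 and is the last site of run 5
  have hbp : ω p₂ 0 ≤ p₁ + 1 := by
    by_contra hlt
    obtain rfl : e₁ = 1 := by rcases he₁ with rfl | rfl <;> omega
    refine hd15 (p₁ + 3) r₃ (by omega) (by omega) (by omega) le_rfl ?_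
    rw [(hrun1 (p₁ + 3) (by omega) (by omega)).1, hg]; omega
  -- `c₂ < c₅` (equality would identify `ω p₂` with the landing site of the second up step)
  have hbe : ω p₂ 0 < ω r₂ 0 := by
    rcases lt_or_ge (ω p₂ 0) (ω r₂ 0) with h | h
    · exact h
    exfalso
    refine hd15 p₂ (r₂ + 1) (by omega) le_rfl le_rfl (by omega) ?_
    rw [h5s]; omega
  rcases lt_or_ge (ω r₁ 0) (p₁ : ℤ) with hcp | hcp
  · -- run 3 starts left of `p₁`: it stays left of run 1, and run 4 then passes under `ω (p₂+1)`
    have hdp : ω p₃ 0 < p₁ := by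
      by_contra hle
      obtain rfl : e₃ = 1 := by rcases he₃ with rfl | rfl <;> omega
      refine hd13 (p₁ + 1) (r₁ + 1 + (p₁ - (ω r₁ 0).toNat)) le_rfl (by omega) (by omega) (by omega) ?_
      rw [hP1x, (hrun3 (r₁ + 1 + (p₁ - (ω r₁ 0).toNat)) (by omega) (by omega)).1]; omega
    have hcb : ω r₁ 0 < ω p₂ 0 := by
      by_contra hle
      rcases he₁ with rfl | rfl
      · omega
      refine hd13 (p₁ + 1 + (p₁ - (ω r₁ 0).toNat)) (r₁ + 1) (by omega) (by omega) le_rfl (by omega) ?_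
      rw [(hrun1 (p₁ + 1 + (p₁ - (ω r₁ 0).toNat)) (by omega) (by omega)).1, h3s]; omega
    have hdb : ω p₃ 0 < ω p₂ 0 := by
      by_contra hle
      rcases he₁ with rfl | rfl
      · omega
      refine hd13 (p₁ + 1 + (p₁ - (ω p₃ 0).toNat)) p₃ (by omega) (by omega) (by omega) le_rfl ?_
      rw [(hrun1 (p₁ + 1 + (p₁ - (ω p₃ 0).toNat)) (by omega) (by omega)).1]; omega
    obtain rfl : e₄ = 1 := by rcases he₄ with rfl | rfl <;> omega
    refine hd24 (p₂ + 1) (p₃ + 1 + ((ω p₂ 0).toNat - (ω p₃ 0).toNat)) le_rfl (by omega) (by omega) (by omega) ?_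
    have h2s : ω (p₂ + 1) 0 = ω p₂ 0 := by simpa using (hrun2 (p₂ + 1) le_rfl (by omega)).1
    rw [h2s, (hrun4 (p₃ + 1 + ((ω p₂ 0).toNat - (ω p₃ 0).toNat)) (by omega) (by omega)).1]; omega
  · -- run 3 starts right of `p₁`: it lies right of run 5, and run 2 then passes under `ω r₂`
    have hdp : (p₁ : ℤ) < ω p₃ 0 := by
      by_contra hle
      obtain rfl : e₃ = -1 := by rcases he₃ with rfl | rfl <;> omega
      refine hd13 (p₁ + 1) (r₁ + 1 + ((ω r₁ 0).toNat - p₁)) le_rfl (by omega) (by omega) (by omega) ?_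
      rw [hP1x, (hrun3 (r₁ + 1 + ((ω r₁ 0).toNat - p₁)) (by omega) (by omega)).1]; omega
    -- run 3 does not contain the column `p₁ + 2 = ω r₃ 0`
    have hc3 : (p₁ : ℤ) + 3 ≤ ω r₁ 0 ∧ (p₁ : ℤ) + 3 ≤ ω p₃ 0 := by
      by_contra hcon
      rcases he₃ with rfl | rfl
      · refine hd35 (r₁ + 1 + (p₁ + 2 - (ω r₁ 0).toNat)) r₃ (by omega) (by omega) (by omega) le_rfl ?_
        rw [(hrun3 (r₁ + 1 + (p₁ + 2 - (ω r₁ 0).toNat)) (by omega) (by omega)).1, hg]; omega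
      · refine hd35 (r₁ + 1 + ((ω r₁ 0).toNat - (p₁ + 2))) r₃ (by omega) (by omega) (by omega) le_rfl ?_
        rw [(hrun3 (r₁ + 1 + ((ω r₁ 0).toNat - (p₁ + 2))) (by omega) (by omega)).1, hg]; omega
    have hce : ω r₂ 0 < ω r₁ 0 := by
      by_contra hle
      obtain rfl : e₅ = -1 := by rcases he₅ with rfl | rfl <;> omega
      refine hd35 (r₁ + 1) (r₂ + 1 + ((ω r₂ 0).toNat - (ω r₁ 0).toNat)) le_rfl (by omega) (by omega) (by omega) ?_
      rw [h3s, (hrun5 (r₂ + 1 + ((ω r₂ 0).toNat - (ω r₁ 0).toNat)) (by omega) (by omega)).1]; omega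
    have hde : ω r₂ 0 < ω p₃ 0 := by
      by_contra hle
      obtain rfl : e₅ = -1 := by rcases he₅ with rfl | rfl <;> omega
      refine hd35 p₃ (r₂ + 1 + ((ω r₂ 0).toNat - (ω p₃ 0).toNat)) (by omega) le_rfl (by omega) (by omega) ?_
      rw [(hrun5 (r₂ + 1 + ((ω r₂ 0).toNat - (ω p₃ 0).toNat)) (by omega) (by omega)).1]; omega
    obtain rfl : e₂ = 1 := by rcases he₂ with rfl | rfl <;> omega
    refine hd24 (p₂ + 1 + ((ω r₂ 0).toNat - (ω p₂ 0).toNat)) r₂ (by omega) (by omega) (by omega) le_rfl ?_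
    rw [(hrun2 (p₂ + 1 + ((ω r₂ 0).toNat - (ω p₂ 0).toNat)) (by omega) (by omega)).1]; omega

set_option maxHeartbeats 400000 in
/-- **The mixed orders are impossible at slack two**: with `r₁ < p₃` the profile is one of `D U D U D U`, `D U D D U U`,
`D D U U D U`, `D D U D U U` (a down time is never an up time), each excluded above. [cite: MadrasSlade1993, §4.2, Definition 4.2.1; EntingJensen2009, §7.4.2, Fig. 7.10] -/
theorem three_down_orders_false {k m : ℕ} (hk : 2 ≤ k) (hm : m = 6 * k + 2) (hω : ω ∈ ipwb m) (hv : visits m ω = k)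
    {p₁ p₂ p₃ r₁ r₂ r₃ : ℕ} (hD : stepsD m ω = {p₁, p₂, p₃}) (hU : stepsU m ω = {r₁, r₂, r₃}) (h12 : p₁ < p₂)
    (h23 : p₂ < p₃) (hr12 : r₁ < r₂) (hr23 : r₂ < r₃) (h1 : p₁ < r₁) (h2 : p₂ < r₂) (h3 : p₃ < r₃)
    (hp1 : 1 ≤ p₁) (hpodd : p₁ % 2 = 1) (hR0 : ∀ i, i ≤ p₁ → ω i 0 = i ∧ ω i 1 = 0)
    (hP1x : ω (p₁ + 1) 0 = p₁) (hP1y : ω (p₁ + 1) 1 = -1)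
    (hhor : ∀ i, i < m → i ∉ stepsD m ω → i ∉ stepsU m ω →
      ω (i + 1) 1 = ω i 1 ∧ (ω (i + 1) 0 = ω i 0 + 1 ∨ ω (i + 1) 0 = ω i 0 - 1))
    (hYt : ∀ t, t ≤ m → ω t 1 = ((if r₁ < t then 1 else 0) + (if r₂ < t then 1 else 0) + (if r₃ < t then 1 else 0)) -
      ((if p₁ < t then 1 else 0) + (if p₂ < t then 1 else 0) + (if p₃ < t then 1 else 0)))
    (hmix : r₁ < p₃) : False := by
  classical
  obtain ⟨hpw, -, -⟩ := mem_ipwb.1 hω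
  obtain ⟨-, -, hbw, -⟩ := mem_saws_iff.1 (saws_of_mem_pwb hpw)
  obtain ⟨-, -, hpy2, -⟩ := of_mem_stepsD_coord hbw (i := p₂) (by rw [hD]; simp)
  obtain ⟨-, -, hpy3, -⟩ := of_mem_stepsD_coord hbw (i := p₃) (by rw [hD]; simp)
  obtain ⟨-, -, hry1, -⟩ := of_mem_stepsU_coord hbw (i := r₁) (by rw [hU]; simp)
  obtain ⟨-, -, hry2, -⟩ := of_mem_stepsU_coord hbw (i := r₂) (by rw [hU]; simp)
  have hne : ∀ {a b : ℕ}, ω (a + 1) 1 = ω a 1 - 1 → ω (b + 1) 1 = ω b 1 + 1 → a ≠ b := by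
    intro a b ha hb h; rw [h] at ha; omega
  have n21 := hne hpy2 hry1
  have n32 := hne hpy3 hry2
  rcases Nat.lt_or_gt_of_ne n21 with h21 | h21
  · -- `p₂ < r₁ < p₃`
    rcases Nat.lt_or_gt_of_ne n32 with h32 | h32
    · exact dduduu_false hk hm hω hv hD hU h12 hr23 h2 hp1 hpodd hR0 hP1x hP1y hhor h21 hmix h32
    · exact dduudu_false hk hm hω hv hD hU h12 h23 hr12 hr23 h1 h2 h3 hp1 hpodd hR0 hP1y hhor h21 h32
  · -- `r₁ < p₂`
    rcases Nat.lt_or_gt_of_ne n32 with h32 | h32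
    · exact dudduu_false hk hm hω hv hD hU h12 h23 hr12 hr23 h1 h2 h3 hp1 hpodd hR0 hP1x hP1y hhor hYt h21 h32
    · exact dududu_false hm hω hv hD hU h12 h23 hr12 hr23 h1 h2 h3 hp1 hpodd hR0 hP1x hP1y hhor hYt h21 h32

set_option maxHeartbeats 400000 in
/-- DDDUUU, step 1 — **the runs**: rows `−1, −2, −3, −2, −1` with directions `e₁ … e₅`, then the final wall run
rightward; the down columns `c₂ = ω p₂ 0` even, `c₃ = ω p₃ 0` odd, the up columns `c₄ = ω r₁ 0` odd, `c₅ = ω r₂ 0`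
even; the visit count `v = ⌊p₁/2⌋ + (m − r₃)/2` and `X = 2k + 2` give `r₃ = p₁ + 4k + 1` and the last up column
`ω r₃ 0 = p₁ + 2`. [cite: MadrasSlade1993, §4.2, Definition 4.2.1; EntingJensen2009, §7.4.2, Fig. 7.10] -/
theorem ddduuu_runs {k m : ℕ} (hk : 2 ≤ k) (hm : m = 6 * k + 2) (hω : ω ∈ ipwb m) (hv : visits m ω = k)
    {p₁ p₂ p₃ r₁ r₂ r₃ : ℕ} (hD : stepsD m ω = {p₁, p₂, p₃}) (hU : stepsU m ω = {r₁, r₂, r₃}) (h12 : p₁ < p₂)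
    (h23 : p₂ < p₃) (hr12 : r₁ < r₂) (hr23 : r₂ < r₃) (h3 : p₃ < r₁) (hp1 : 1 ≤ p₁)
    (hR0 : ∀ i, i ≤ p₁ → ω i 0 = i ∧ ω i 1 = 0) (hP1x : ω (p₁ + 1) 0 = p₁) (hP1y : ω (p₁ + 1) 1 = -1)
    (hhor : ∀ i, i < m → i ∉ stepsD m ω → i ∉ stepsU m ω →
      ω (i + 1) 1 = ω i 1 ∧ (ω (i + 1) 0 = ω i 0 + 1 ∨ ω (i + 1) 0 = ω i 0 - 1)) :
    ∃ e₁ e₂ e₃ e₄ e₅ : ℤ, (e₁ = 1 ∨ e₁ = -1) ∧ (e₂ = 1 ∨ e₂ = -1) ∧ (e₃ = 1 ∨ e₃ = -1) ∧ (e₄ = 1 ∨ e₄ = -1) ∧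
      (e₅ = 1 ∨ e₅ = -1) ∧
      (∀ i, p₁ + 1 ≤ i → i ≤ p₂ → ω i 0 = p₁ + e₁ * ((i - (p₁ + 1) : ℕ) : ℤ) ∧ ω i 1 = -1) ∧
      (∀ i, p₂ + 1 ≤ i → i ≤ p₃ → ω i 0 = ω p₂ 0 + e₂ * ((i - (p₂ + 1) : ℕ) : ℤ) ∧ ω i 1 = -2) ∧
      (∀ i, p₃ + 1 ≤ i → i ≤ r₁ → ω i 0 = ω p₃ 0 + e₃ * ((i - (p₃ + 1) : ℕ) : ℤ) ∧ ω i 1 = -3) ∧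
      (∀ i, r₁ + 1 ≤ i → i ≤ r₂ → ω i 0 = ω r₁ 0 + e₄ * ((i - (r₁ + 1) : ℕ) : ℤ) ∧ ω i 1 = -2) ∧
      (∀ i, r₂ + 1 ≤ i → i ≤ r₃ → ω i 0 = ω r₂ 0 + e₅ * ((i - (r₂ + 1) : ℕ) : ℤ) ∧ ω i 1 = -1) ∧
      (∀ j, r₃ + 1 ≤ j → j ≤ m → ω j 0 = ω r₃ 0 + ((j - (r₃ + 1) : ℕ) : ℤ) ∧ ω j 1 = 0) ∧
      r₃ = p₁ + 4 * k + 1 ∧ ω r₃ 0 = p₁ + 2 ∧ ω p₂ 0 % 2 = 0 ∧ ω p₃ 0 % 2 = 1 ∧ ω r₁ 0 % 2 = 1 ∧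
      ω r₂ 0 % 2 = 0 ∧ 0 < ω p₂ 0 ∧ 0 < ω p₃ 0 ∧ 0 < ω r₁ 0 ∧ 0 < ω r₂ 0 ∧ p₁ + 2 ≤ p₂ ∧ p₂ + 2 ≤ p₃ ∧
      p₃ + 2 ≤ r₁ ∧ r₃ < m := by
  classical
  obtain ⟨hpw, hn1, hirr⟩ := mem_ipwb.1 hω
  obtain ⟨hw, hb⟩ := mem_pwb.1 hpw
  obtain ⟨ha, -⟩ := mem_wbr.1 hw
  obtain ⟨hh, -, -⟩ := mem_archs.1 ha
  obtain ⟨hs, hhp⟩ := mem_hpw.1 hh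
  obtain ⟨h0, -, hbw, hinj⟩ := mem_saws_iff.1 hs
  have hX0 : ω 0 0 = 0 := by rw [h0]; rfl
  have hb' : ∀ i, 1 ≤ i → i ≤ m → 0 < ω i 0 ∧ ω i 0 ≤ ω m 0 := fun i h1 h2 => by
    have := hb i h1 h2; rwa [hX0] at this
  have hmem : ∀ i, i ≤ m → i ∈ {i | i ≤ m} := fun i hi => hi
  have hmD : ∀ i, i ∈ stepsD m ω ↔ i = p₁ ∨ i = p₂ ∨ i = p₃ := fun i => by
    rw [hD]; simp only [Finset.mem_insert, Finset.mem_singleton]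
  have hmU : ∀ i, i ∈ stepsU m ω ↔ i = r₁ ∨ i = r₂ ∨ i = r₃ := fun i => by
    rw [hU]; simp only [Finset.mem_insert, Finset.mem_singleton]
  obtain ⟨-, -, -, hppar1⟩ := of_mem_stepsD_coord hbw (i := p₁) ((hmD _).2 (by simp))
  obtain ⟨hpn2, hpx2, hpy2, hppar2⟩ := of_mem_stepsD_coord hbw (i := p₂) ((hmD _).2 (by simp))
  obtain ⟨hpn3, hpx3, hpy3, hppar3⟩ := of_mem_stepsD_coord hbw (i := p₃) ((hmD _).2 (by simp))
  obtain ⟨hrn1, hrx1, hry1, hrpar1⟩ := of_mem_stepsU_coord hbw (i := r₁) ((hmU _).2 (by simp))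
  obtain ⟨hrn2, hrx2, hry2, hrpar2⟩ := of_mem_stepsU_coord hbw (i := r₂) ((hmU _).2 (by simp))
  obtain ⟨hrn3, hrx3, hry3, hrpar3⟩ := of_mem_stepsU_coord hbw (i := r₃) ((hmU _).2 (by simp))
  have hhor' : ∀ i, i < m → i ≠ p₁ → i ≠ p₂ → i ≠ p₃ → i ≠ r₁ → i ≠ r₂ → i ≠ r₃ →
      ω (i + 1) 1 = ω i 1 ∧ (ω (i + 1) 0 = ω i 0 + 1 ∨ ω (i + 1) 0 = ω i 0 - 1) :=
    fun i hi n1 n2 n3 n4 n5 n6 => hhor i hi (by rw [hmD]; omega) (by rw [hmU]; omega)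
  -- run 1 on row `−1`
  obtain ⟨e1, he1, hrun1⟩ := run_const_velocity hinj (a := p₁ + 1) (b := p₂) (by omega) (by omega)
    (fun i hi1 hi2 => hhor' i (by omega) (by omega) (by omega) (by omega) (by omega) (by omega) (by omega))
  have hQy : ω p₂ 1 = -1 := by rw [(hrun1 p₂ (by omega) le_rfl).2, hP1y]
  have hQ1y : ω (p₂ + 1) 1 = -2 := by rw [hpy2, hQy]; rfl
  have hbev : ω p₂ 0 % 2 = 0 := by rw [hpx2, hQ1y] at hppar2; omega
  have hb1 := (hb' p₂ (by omega) (by omega)).1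
  -- run 2 on row `−2`
  obtain ⟨e2, he2, hrun2⟩ := run_const_velocity hinj (a := p₂ + 1) (b := p₃) (by omega) (by omega)
    (fun i hi1 hi2 => hhor' i (by omega) (by omega) (by omega) (by omega) (by omega) (by omega) (by omega))
  have hCy : ω p₃ 1 = -2 := by rw [(hrun2 p₃ (by omega) le_rfl).2, hQ1y]
  have hC1y : ω (p₃ + 1) 1 = -3 := by rw [hpy3, hCy]; rfl
  have hcodd : ω p₃ 0 % 2 = 1 := by rw [hpx3, hC1y] at hppar3; omega
  have hc1 := (hb' p₃ (by omega) (by omega)).1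
  -- run 3 on row `−3`
  obtain ⟨e3, he3, hrun3⟩ := run_const_velocity hinj (a := p₃ + 1) (b := r₁) (by omega) (by omega)
    (fun i hi1 hi2 => hhor' i (by omega) (by omega) (by omega) (by omega) (by omega) (by omega) (by omega))
  have hDy : ω r₁ 1 = -3 := by rw [(hrun3 r₁ (by omega) le_rfl).2, hC1y]
  have hD1y : ω (r₁ + 1) 1 = -2 := by rw [hry1, hDy]; rfl
  have hdodd : ω r₁ 0 % 2 = 1 := by rw [hDy] at hrpar1; omega
  have hd1 := (hb' r₁ (by omega) (by omega)).1
  -- run 4 on row `−2`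
  obtain ⟨e4, he4, hrun4⟩ := run_const_velocity hinj (a := r₁ + 1) (b := r₂) (by omega) (by omega)
    (fun i hi1 hi2 => hhor' i (by omega) (by omega) (by omega) (by omega) (by omega) (by omega) (by omega))
  have hEy : ω r₂ 1 = -2 := by rw [(hrun4 r₂ (by omega) le_rfl).2, hD1y]
  have hE1y : ω (r₂ + 1) 1 = -1 := by rw [hry2, hEy]; rfl
  have heev : ω r₂ 0 % 2 = 0 := by rw [hEy] at hrpar2; omega
  have he1' := (hb' r₂ (by omega) (by omega)).1
  -- run 5 on row `−1`
  obtain ⟨e5, he5, hrun5⟩ := run_const_velocity hinj (a := r₂ + 1) (b := r₃) (by omega) (by omega)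
    (fun i hi1 hi2 => hhor' i (by omega) (by omega) (by omega) (by omega) (by omega) (by omega) (by omega))
  have hSy : ω r₃ 1 = -1 := by rw [(hrun5 r₃ (by omega) le_rfl).2, hE1y]
  have hS1y : ω (r₃ + 1) 1 = 0 := by rw [hry3, hSy]; rfl
  have hsev : r₃ % 2 = 0 := by have := parity_apply hs (show r₃ ≤ m by omega); rw [hSy] at this; omega
  -- run 6 on the wall goes right
  obtain ⟨e6, he6, hrun6⟩ := run_const_velocity hinj (a := r₃ + 1) (b := m) (by omega) le_rfl
    (fun i hi1 hi2 => hhor' i (by omega) (by omega) (by omega) (by omega) (by omega) (by omega) (by omega))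
  obtain rfl : e6 = 1 := by
    rcases he6 with h | rfl
    · exact h
    exfalso
    have hN := (hrun6 m (by omega) le_rfl).1
    have hbn := (hb' (r₃ + 1) (by omega) (by omega)).2
    rw [hrx3] at hN hbn
    omega
  have hR6 : ∀ j, r₃ + 1 ≤ j → j ≤ m → ω j 0 = ω r₃ 0 + ((j - (r₃ + 1) : ℕ) : ℤ) ∧ ω j 1 = 0 := fun j hj1 hj2 => by
    obtain ⟨hx, hy⟩ := hrun6 j hj1 hj2
    rw [hrx3] at hx; rw [hS1y] at hy
    exact ⟨by rw [hx]; ring, hy⟩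
  -- the visit count
  have hvf : visits m ω = p₁ / 2 + (m - r₃) / 2 := by
    have hv1 : visits p₁ ω = p₁ / 2 := visits_eq_div_two_of_wall (fun i _ hi2 => (hR0 i hi2).2)
    have hv2 : visits r₃ ω = visits p₁ ω := by
      have := visits_add_eq_left (k := p₁) (b := r₃ - p₁) (ζ := ω) (fun j hj1 hj2 => ?_)
      · rwa [show p₁ + (r₃ - p₁) = r₃ by omega] at this
      rintro ⟨-, hy⟩
      rcases Nat.lt_or_ge (p₁ + j) (p₂ + 1) with hj | hj
      · have := (hrun1 (p₁ + j) (by omega) (by omega)).2; rw [hP1y] at this; omega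
      rcases Nat.lt_or_ge (p₁ + j) (p₃ + 1) with hja | hja
      · have := (hrun2 (p₁ + j) hj (by omega)).2; rw [hQ1y] at this; omega
      rcases Nat.lt_or_ge (p₁ + j) (r₁ + 1) with hjb | hjb
      · have := (hrun3 (p₁ + j) hja (by omega)).2; rw [hC1y] at this; omega
      rcases Nat.lt_or_ge (p₁ + j) (r₂ + 1) with hjc | hjc
      · have := (hrun4 (p₁ + j) hjb (by omega)).2; rw [hD1y] at this; omega
      · have := (hrun5 (p₁ + j) hjc (by omega)).2; rw [hE1y] at this; omega
    have hv3 : visits m ω = visits r₃ ω + visits (m - r₃) (fun _ => (0 : Site 2)) := by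
      have := visits_add (a := r₃) (b := m - r₃) (ζ := ω) (ξ := fun _ => (0 : Site 2)) hsev (fun j hj1 hj2 => ?_)
      · rwa [show r₃ + (m - r₃) = m by omega] at this
      rw [(hR6 (r₃ + j) (by omega) (by omega)).2]; rfl
    have hv4 : visits (m - r₃) (fun _ => (0 : Site 2)) = (m - r₃) / 2 := visits_eq_div_two_of_wall (fun i _ _ => rfl)
    rw [hv3, hv2, hv1, hv4]
  -- slack-two numerics: three down steps force `X = 2k + 2`
  have hcard : #(stepsD m ω) = 3 := by
    rw [hD, Finset.card_insert_of_notMem (by simp; omega), Finset.card_insert_of_notMem (by simp; omega),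
      Finset.card_singleton]
  obtain ⟨hX, -, -, hX4, -, -, -⟩ := slack_two_counts hk hm hω hv
  have hX2 : ω m 0 = 2 * k + 2 := by
    rcases hX with h | h
    · exact h
    · have := hX4 h; omega
  have hN := (hR6 m (by omega) le_rfl).1
  rw [hvf] at hv
  have hpodd : p₁ % 2 = 1 := by rw [hP1x, hP1y] at hppar1; omega
  have hs_eq : r₃ = p₁ + 4 * k + 1 := by omega
  have hg : ω r₃ 0 = p₁ + 2 := by rw [hN] at hX2; omega
  -- interior runs are non-empty
  have hq2 : p₁ + 2 ≤ p₂ := by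
    by_contra h
    obtain rfl : p₂ = p₁ + 1 := by omega
    rw [hpx2, hP1x] at hppar2; rw [hQ1y] at hppar2; omega
  have hq3 : p₂ + 2 ≤ p₃ := by
    by_contra h
    obtain rfl : p₃ = p₂ + 1 := by omega
    rw [hpx3, hpx2] at hppar3; rw [hC1y] at hppar3; rw [hpx2, hQ1y] at hppar2; omega
  have hr2 : p₃ + 2 ≤ r₁ := by
    by_contra h
    obtain rfl : r₁ = p₃ + 1 := by omega
    have := hinj (hmem (p₃ + 1 + 1) (by omega)) (hmem p₃ (by omega))
      (site_ext_cls (by rw [hrx1, hpx3]) (by rw [hD1y, hCy]))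
    omega
  refine ⟨e1, e2, e3, e4, e5, he1, he2, he3, he4, he5,
    fun i hi1 hi2 => ⟨by rw [(hrun1 i hi1 hi2).1, hP1x], by rw [(hrun1 i hi1 hi2).2, hP1y]⟩,
    fun i hi1 hi2 => ⟨by rw [(hrun2 i hi1 hi2).1, hpx2], by rw [(hrun2 i hi1 hi2).2, hQ1y]⟩,
    fun i hi1 hi2 => ⟨by rw [(hrun3 i hi1 hi2).1, hpx3], by rw [(hrun3 i hi1 hi2).2, hC1y]⟩,
    fun i hi1 hi2 => ⟨by rw [(hrun4 i hi1 hi2).1, hrx1], by rw [(hrun4 i hi1 hi2).2, hD1y]⟩,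
    fun i hi1 hi2 => ⟨by rw [(hrun5 i hi1 hi2).1, hrx2], by rw [(hrun5 i hi1 hi2).2, hE1y]⟩,
    hR6, hs_eq, hg, hbev, hcodd, hdodd, heev, hb1, hc1, hd1, he1', hq2, hq3, hr2, hrn3⟩

/-- DDDUUU, step 2b — **(I1)**: if the initial wall run carries a visit (`p ≥ 3`), some later column below the wall is
`≤ 2`, i.e. `min (c₂, c₃, c₄, c₅) ≤ 2`; else `2` is a wall-renewal time. [cite: MadrasSlade1993, §4.2, Definition 4.2.1; EntingJensen2009, §7.4.2, Fig. 7.10] -/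
theorem ddduuu_shield_low {m p p₂ p₃ r₁ r₂ r₃ : ℕ} {e₁ e₂ e₃ e₄ e₅ : ℤ}
    (hbr : ∀ i, 1 ≤ i → i ≤ m → ω 0 0 < ω i 0 ∧ ω i 0 ≤ ω m 0) (hirr : ∀ t, 1 ≤ t → t < m → ¬ IsWRen m ω t)
    (hR0 : ∀ i, i ≤ p → ω i 0 = i ∧ ω i 1 = 0) (he₁ : e₁ = 1 ∨ e₁ = -1) (he₂ : e₂ = 1 ∨ e₂ = -1) (he₃ : e₃ = 1 ∨ e₃ = -1) (he₄ : e₄ = 1 ∨ e₄ = -1)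
    (he₅ : e₅ = 1 ∨ e₅ = -1)
    (hrun1 : ∀ i, p + 1 ≤ i → i ≤ p₂ → ω i 0 = p + e₁ * ((i - (p + 1) : ℕ) : ℤ) ∧ ω i 1 = -1)
    (hrun2 : ∀ i, p₂ + 1 ≤ i → i ≤ p₃ → ω i 0 = ω p₂ 0 + e₂ * ((i - (p₂ + 1) : ℕ) : ℤ) ∧ ω i 1 = -2)
    (hrun3 : ∀ i, p₃ + 1 ≤ i → i ≤ r₁ → ω i 0 = ω p₃ 0 + e₃ * ((i - (p₃ + 1) : ℕ) : ℤ) ∧ ω i 1 = -3)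
    (hrun4 : ∀ i, r₁ + 1 ≤ i → i ≤ r₂ → ω i 0 = ω r₁ 0 + e₄ * ((i - (r₁ + 1) : ℕ) : ℤ) ∧ ω i 1 = -2)
    (hrun5 : ∀ i, r₂ + 1 ≤ i → i ≤ r₃ → ω i 0 = ω r₂ 0 + e₅ * ((i - (r₂ + 1) : ℕ) : ℤ) ∧ ω i 1 = -1)
    (hR6 : ∀ j, r₃ + 1 ≤ j → j ≤ m → ω j 0 = ω r₃ 0 + ((j - (r₃ + 1) : ℕ) : ℤ) ∧ ω j 1 = 0)
    (hp3 : 3 ≤ p) (h12 : p < p₂) (h23 : p₂ < p₃) (h3 : p₃ < r₁) (hr12 : r₁ < r₂) (hr23 : r₂ < r₃) (hsm : r₃ < m)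
    (hg2 : ω r₃ 0 = p + 2) (hb : ω p₂ 0 = p + e₁ * ((p₂ - (p + 1) : ℕ) : ℤ)) (hc : ω p₃ 0 = ω p₂ 0 + e₂ * ((p₃ - (p₂ + 1) : ℕ) : ℤ))
    (hd : ω r₁ 0 = ω p₃ 0 + e₃ * ((r₁ - (p₃ + 1) : ℕ) : ℤ)) (he : ω r₂ 0 = ω r₁ 0 + e₄ * ((r₂ - (r₁ + 1) : ℕ) : ℤ))
    (hg : ω r₃ 0 = ω r₂ 0 + e₅ * ((r₃ - (r₂ + 1) : ℕ) : ℤ)) :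
    ω p₂ 0 ≤ 2 ∨ ω p₃ 0 ≤ 2 ∨ ω r₁ 0 ≤ 2 ∨ ω r₂ 0 ≤ 2 := by
  by_contra hcon
  simp only [not_or, not_le] at hcon
  obtain ⟨hb2, hc2, hd2, he2⟩ := hcon
  refine hirr 2 (by omega) (by omega) (isWRen_of_profile hbr (by omega) (by omega) (hR0 2 (by omega)).2 ?_ ?_)
  · intro i hi1 hi2; rw [(hR0 i (by omega)).1, (hR0 2 (by omega)).1]; omega
  · intro j hj1 hj2
    rw [(hR0 2 (by omega)).1]
    rcases Nat.lt_or_ge j (p + 1) with hj | hj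
    · rw [(hR0 j (by omega)).1]; omega
    rcases Nat.lt_or_ge j (p₂ + 1) with hja | hja
    · have := (hrun1 j hj (by omega)).1; rcases he₁ with rfl | rfl <;> omega
    rcases Nat.lt_or_ge j (p₃ + 1) with hjb | hjb
    · have := (hrun2 j hja (by omega)).1; rcases he₂ with rfl | rfl <;> omega
    rcases Nat.lt_or_ge j (r₁ + 1) with hjc | hjc
    · have := (hrun3 j hjb (by omega)).1; rcases he₃ with rfl | rfl <;> omega
    rcases Nat.lt_or_ge j (r₂ + 1) with hjd | hjd
    · have := (hrun4 j hjc (by omega)).1; rcases he₄ with rfl | rfl <;> omega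
    rcases Nat.lt_or_ge j (r₃ + 1) with hje | hje
    · have := (hrun5 j hjd (by omega)).1; rcases he₅ with rfl | rfl <;> omega
    · have := (hR6 j hje hj2).1; omega

/-- DDDUUU, step 2c — **(I2)**: if the final wall run carries two visits (`r₃ + 4 ≤ m`), some earlier column below the
wall is `≥ X − 1`, i.e. `max (c₂, c₃, c₄, c₅) ≥ X − 1`; else `m − 2` is a wall-renewal time. [cite: MadrasSlade1993, §4.2, Definition 4.2.1; EntingJensen2009, §7.4.2, Fig. 7.10] -/
theorem ddduuu_shield_high {m p p₂ p₃ r₁ r₂ r₃ : ℕ} {e₁ e₂ e₃ e₄ e₅ : ℤ}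
    (hbr : ∀ i, 1 ≤ i → i ≤ m → ω 0 0 < ω i 0 ∧ ω i 0 ≤ ω m 0) (hirr : ∀ t, 1 ≤ t → t < m → ¬ IsWRen m ω t)
    (hR0 : ∀ i, i ≤ p → ω i 0 = i ∧ ω i 1 = 0) (he₁ : e₁ = 1 ∨ e₁ = -1) (he₂ : e₂ = 1 ∨ e₂ = -1) (he₃ : e₃ = 1 ∨ e₃ = -1) (he₄ : e₄ = 1 ∨ e₄ = -1)
    (he₅ : e₅ = 1 ∨ e₅ = -1)
    (hrun1 : ∀ i, p + 1 ≤ i → i ≤ p₂ → ω i 0 = p + e₁ * ((i - (p + 1) : ℕ) : ℤ) ∧ ω i 1 = -1)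
    (hrun2 : ∀ i, p₂ + 1 ≤ i → i ≤ p₃ → ω i 0 = ω p₂ 0 + e₂ * ((i - (p₂ + 1) : ℕ) : ℤ) ∧ ω i 1 = -2)
    (hrun3 : ∀ i, p₃ + 1 ≤ i → i ≤ r₁ → ω i 0 = ω p₃ 0 + e₃ * ((i - (p₃ + 1) : ℕ) : ℤ) ∧ ω i 1 = -3)
    (hrun4 : ∀ i, r₁ + 1 ≤ i → i ≤ r₂ → ω i 0 = ω r₁ 0 + e₄ * ((i - (r₁ + 1) : ℕ) : ℤ) ∧ ω i 1 = -2)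
    (hrun5 : ∀ i, r₂ + 1 ≤ i → i ≤ r₃ → ω i 0 = ω r₂ 0 + e₅ * ((i - (r₂ + 1) : ℕ) : ℤ) ∧ ω i 1 = -1)
    (hR6 : ∀ j, r₃ + 1 ≤ j → j ≤ m → ω j 0 = ω r₃ 0 + ((j - (r₃ + 1) : ℕ) : ℤ) ∧ ω j 1 = 0)
    (hs4 : r₃ + 4 ≤ m) (hm2 : m % 2 = 0) (h12 : p < p₂) (h23 : p₂ < p₃) (h3 : p₃ < r₁) (hr12 : r₁ < r₂)
    (hr23 : r₂ < r₃) (hg2 : ω r₃ 0 = p + 2) (hb : ω p₂ 0 = p + e₁ * ((p₂ - (p + 1) : ℕ) : ℤ)) (hc : ω p₃ 0 = ω p₂ 0 + e₂ * ((p₃ - (p₂ + 1) : ℕ) : ℤ))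
    (hd : ω r₁ 0 = ω p₃ 0 + e₃ * ((r₁ - (p₃ + 1) : ℕ) : ℤ)) (he : ω r₂ 0 = ω r₁ 0 + e₄ * ((r₂ - (r₁ + 1) : ℕ) : ℤ))
    (hg : ω r₃ 0 = ω r₂ 0 + e₅ * ((r₃ - (r₂ + 1) : ℕ) : ℤ)) :
    ω m 0 ≤ ω p₂ 0 + 1 ∨ ω m 0 ≤ ω p₃ 0 + 1 ∨ ω m 0 ≤ ω r₁ 0 + 1 ∨ ω m 0 ≤ ω r₂ 0 + 1 := by
  by_contra hcon
  simp only [not_or, not_le] at hcon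
  obtain ⟨hb2, hc2, hd2, he2⟩ := hcon
  have hM2 := hR6 (m - 2) (by omega) (by omega)
  have hN := (hR6 m (by omega) le_rfl).1
  refine hirr (m - 2) (by omega) (by omega) (isWRen_of_profile hbr (by omega) (by omega) hM2.2 ?_ ?_)
  · intro i hi1 hi2
    rw [hM2.1]
    rcases Nat.lt_or_ge i (p + 1) with hi | hi
    · rw [(hR0 i (by omega)).1]; omega
    rcases Nat.lt_or_ge i (p₂ + 1) with hia | hia
    · have := (hrun1 i hi (by omega)).1; rcases he₁ with rfl | rfl <;> omega
    rcases Nat.lt_or_ge i (p₃ + 1) with hib | hib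
    · have := (hrun2 i hia (by omega)).1; rcases he₂ with rfl | rfl <;> omega
    rcases Nat.lt_or_ge i (r₁ + 1) with hic | hic
    · have := (hrun3 i hib (by omega)).1; rcases he₃ with rfl | rfl <;> omega
    rcases Nat.lt_or_ge i (r₂ + 1) with hid | hid
    · have := (hrun4 i hic (by omega)).1; rcases he₄ with rfl | rfl <;> omega
    rcases Nat.lt_or_ge i (r₃ + 1) with hie | hie
    · have := (hrun5 i hid (by omega)).1; rcases he₅ with rfl | rfl <;> omega
    · have := (hR6 i hie (by omega)).1; omega
  · intro j hj1 hj2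
    rw [hM2.1, (hR6 j (by omega) hj2).1]; omega

/-- DDDUUU, step 4a — **the F3R table** from the run data with exit pair `(+1, +1)`. [cite: MadrasSlade1993, §4.2, Definition 4.2.1; EntingJensen2009, §7.4.2, Fig. 7.10] -/
theorem ddduuu_table_r {k m p p₂ p₃ r₁ r₂ r₃ b c : ℕ} (hm : m = 6 * k + 2) (hk : 2 ≤ k)
    (hR0 : ∀ i, i ≤ p → ω i 0 = i ∧ ω i 1 = 0)
    (hrun1 : ∀ i, p + 1 ≤ i → i ≤ p₂ → ω i 0 = p + (-1) * ((i - (p + 1) : ℕ) : ℤ) ∧ ω i 1 = -1)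
    (hrun2 : ∀ i, p₂ + 1 ≤ i → i ≤ p₃ → ω i 0 = ω p₂ 0 + 1 * ((i - (p₂ + 1) : ℕ) : ℤ) ∧ ω i 1 = -2)
    (hrun3 : ∀ i, p₃ + 1 ≤ i → i ≤ r₁ → ω i 0 = ω p₃ 0 + 1 * ((i - (p₃ + 1) : ℕ) : ℤ) ∧ ω i 1 = -3)
    (hrun4 : ∀ i, r₁ + 1 ≤ i → i ≤ r₂ → ω i 0 = ω r₁ 0 + 1 * ((i - (r₁ + 1) : ℕ) : ℤ) ∧ ω i 1 = -2)
    (hrun5 : ∀ i, r₂ + 1 ≤ i → i ≤ r₃ → ω i 0 = ω r₂ 0 + 1 * ((i - (r₂ + 1) : ℕ) : ℤ) ∧ ω i 1 = -1)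
    (hR6 : ∀ j, r₃ + 1 ≤ j → j ≤ m → ω j 0 = ω r₃ 0 + ((j - (r₃ + 1) : ℕ) : ℤ) ∧ ω j 1 = 0)
    (hp : p = 2 * k - 1) (hp2 : p₂ = 4 * k - 3) (hp3 : p₃ = 4 * k + 2 * b - 1) (hr1 : r₁ = 4 * k + 2 * b + 2 * c)
    (hr2 : r₂ = 6 * k - 2) (hr3 : r₃ = 6 * k) (hcb : ω p₂ 0 = 2) (hcc : ω p₃ 0 = 2 * b + 3)
    (hcd : ω r₁ 0 = 2 * b + 2 * c + 3) (hce : ω r₂ 0 = 2 * k) (hcg : ω r₃ 0 = 2 * k + 1) :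
    ∀ i, i ≤ m → ω i 0 = f3rX k b c i ∧ ω i 1 = f3rY k b c i := by
  intro i hi
  simp only [f3rX, f3rY]
  rcases Nat.lt_or_ge i (p + 1) with h1 | h1
  · obtain ⟨hx, hy⟩ := hR0 i (by omega)
    have hc1 : i + 1 ≤ 2 * k := by omega
    rw [hx, hy, if_pos hc1, if_pos hc1]
    constructor <;> omega
  rcases Nat.lt_or_ge i (p₂ + 1) with h2 | h2
  · obtain ⟨hx, hy⟩ := hrun1 i h1 (by omega)
    have hc1 : ¬ (i + 1 ≤ 2 * k) := by omega
    have hc2 : i + 3 ≤ 4 * k := by omega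
    rw [hx, hy, if_neg hc1, if_neg hc1, if_pos hc2, if_pos hc2]
    constructor <;> omega
  rcases Nat.lt_or_ge i (p₃ + 1) with h3 | h3
  · obtain ⟨hx, hy⟩ := hrun2 i h2 (by omega)
    have hc1 : ¬ (i + 1 ≤ 2 * k) := by omega
    have hc2 : ¬ (i + 3 ≤ 4 * k) := by omega
    have hc3 : i + 1 ≤ 4 * k + 2 * b := by omega
    rw [hx, hy, if_neg hc1, if_neg hc1, if_neg hc2, if_neg hc2, if_pos hc3, if_pos hc3]
    constructor <;> omega
  rcases Nat.lt_or_ge i (r₁ + 1) with h4 | h4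
  · obtain ⟨hx, hy⟩ := hrun3 i h3 (by omega)
    have hc1 : ¬ (i + 1 ≤ 2 * k) := by omega
    have hc2 : ¬ (i + 3 ≤ 4 * k) := by omega
    have hc3 : ¬ (i + 1 ≤ 4 * k + 2 * b) := by omega
    have hc4 : i ≤ 4 * k + 2 * b + 2 * c := by omega
    rw [hx, hy, if_neg hc1, if_neg hc1, if_neg hc2, if_neg hc2, if_neg hc3, if_neg hc3, if_pos hc4, if_pos hc4]
    constructor <;> omega
  rcases Nat.lt_or_ge i (r₂ + 1) with h5 | h5
  · obtain ⟨hx, hy⟩ := hrun4 i h4 (by omega)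
    have hc1 : ¬ (i + 1 ≤ 2 * k) := by omega
    have hc2 : ¬ (i + 3 ≤ 4 * k) := by omega
    have hc3 : ¬ (i + 1 ≤ 4 * k + 2 * b) := by omega
    have hc4 : ¬ (i ≤ 4 * k + 2 * b + 2 * c) := by omega
    have hc5 : i + 2 ≤ 6 * k := by omega
    rw [hx, hy, if_neg hc1, if_neg hc1, if_neg hc2, if_neg hc2, if_neg hc3, if_neg hc3, if_neg hc4, if_neg hc4, if_pos hc5, if_pos hc5]
    constructor <;> omega
  rcases Nat.lt_or_ge i (r₃ + 1) with h6 | h6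
  · obtain ⟨hx, hy⟩ := hrun5 i h5 (by omega)
    have hc1 : ¬ (i + 1 ≤ 2 * k) := by omega
    have hc2 : ¬ (i + 3 ≤ 4 * k) := by omega
    have hc3 : ¬ (i + 1 ≤ 4 * k + 2 * b) := by omega
    have hc4 : ¬ (i ≤ 4 * k + 2 * b + 2 * c) := by omega
    have hc5 : ¬ (i + 2 ≤ 6 * k) := by omega
    have hc6 : i ≤ 6 * k := by omega
    rw [hx, hy, if_neg hc1, if_neg hc1, if_neg hc2, if_neg hc2, if_neg hc3, if_neg hc3, if_neg hc4, if_neg hc4, if_neg hc5, if_neg hc5, if_pos hc6, if_pos hc6]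
    constructor <;> omega
  obtain ⟨hx, hy⟩ := hR6 i h6 hi
  have hc1 : ¬ (i + 1 ≤ 2 * k) := by omega
  have hc2 : ¬ (i + 3 ≤ 4 * k) := by omega
  have hc3 : ¬ (i + 1 ≤ 4 * k + 2 * b) := by omega
  have hc4 : ¬ (i ≤ 4 * k + 2 * b + 2 * c) := by omega
  have hc5 : ¬ (i + 2 ≤ 6 * k) := by omega
  have hc6 : ¬ (i ≤ 6 * k) := by omega
  rw [hx, hy, if_neg hc1, if_neg hc1, if_neg hc2, if_neg hc2, if_neg hc3, if_neg hc3, if_neg hc4, if_neg hc4, if_neg hc5, if_neg hc5, if_neg hc6, if_neg hc6]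
  constructor <;> omega

/-- DDDUUU, step 4b — **the F3L table** from the run data with exit pair `(−1, −1)`. [cite: MadrasSlade1993, §4.2, Definition 4.2.1; EntingJensen2009, §7.4.2, Fig. 7.10] -/
theorem ddduuu_table_l {k m p p₂ p₃ r₁ r₂ r₃ a b c : ℕ}
    (hR0 : ∀ i, i ≤ p → ω i 0 = i ∧ ω i 1 = 0)
    (hrun1 : ∀ i, p + 1 ≤ i → i ≤ p₂ → ω i 0 = p + (-1) * ((i - (p + 1) : ℕ) : ℤ) ∧ ω i 1 = -1)
    (hrun2 : ∀ i, p₂ + 1 ≤ i → i ≤ p₃ → ω i 0 = ω p₂ 0 + 1 * ((i - (p₂ + 1) : ℕ) : ℤ) ∧ ω i 1 = -2)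
    (hrun3 : ∀ i, p₃ + 1 ≤ i → i ≤ r₁ → ω i 0 = ω p₃ 0 + 1 * ((i - (p₃ + 1) : ℕ) : ℤ) ∧ ω i 1 = -3)
    (hrun4 : ∀ i, r₁ + 1 ≤ i → i ≤ r₂ → ω i 0 = ω r₁ 0 + (-1) * ((i - (r₁ + 1) : ℕ) : ℤ) ∧ ω i 1 = -2)
    (hrun5 : ∀ i, r₂ + 1 ≤ i → i ≤ r₃ → ω i 0 = ω r₂ 0 + (-1) * ((i - (r₂ + 1) : ℕ) : ℤ) ∧ ω i 1 = -1)
    (hR6 : ∀ j, r₃ + 1 ≤ j → j ≤ m → ω j 0 = ω r₃ 0 + ((j - (r₃ + 1) : ℕ) : ℤ) ∧ ω j 1 = 0)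
    (hp : p = 2 * a + 1) (hp2 : p₂ = 4 * a + 1) (hp3 : p₃ = 4 * a + 2 * b + 3) (hr1 : r₁ = 4 * a + 2 * k + 2)
    (hr2 : r₂ = 4 * a + 2 * k + 2 * c + 2) (hr3 : r₃ = 2 * a + 4 * k + 2) (hcb : ω p₂ 0 = 2)
    (hcc : ω p₃ 0 = 2 * b + 3) (hcd : ω r₁ 0 = 2 * k + 1) (hce : ω r₂ 0 = 2 * k + 2 - 2 * c)
    (hcg : ω r₃ 0 = 2 * a + 3) :
    ∀ i, i ≤ m → ω i 0 = f3lX k a b c i ∧ ω i 1 = f3lY k a b c i := by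
  intro i hi
  simp only [f3lX, f3lY]
  rcases Nat.lt_or_ge i (p + 1) with h1 | h1
  · obtain ⟨hx, hy⟩ := hR0 i (by omega)
    have hc1 : i ≤ 2 * a + 1 := by omega
    rw [hx, hy, if_pos hc1, if_pos hc1]
    constructor <;> omega
  rcases Nat.lt_or_ge i (p₂ + 1) with h2 | h2
  · obtain ⟨hx, hy⟩ := hrun1 i h1 (by omega)
    have hc1 : ¬ (i ≤ 2 * a + 1) := by omega
    have hc2 : i ≤ 4 * a + 1 := by omega
    rw [hx, hy, if_neg hc1, if_neg hc1, if_pos hc2, if_pos hc2]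
    constructor <;> omega
  rcases Nat.lt_or_ge i (p₃ + 1) with h3 | h3
  · obtain ⟨hx, hy⟩ := hrun2 i h2 (by omega)
    have hc1 : ¬ (i ≤ 2 * a + 1) := by omega
    have hc2 : ¬ (i ≤ 4 * a + 1) := by omega
    have hc3 : i ≤ 4 * a + 2 * b + 3 := by omega
    rw [hx, hy, if_neg hc1, if_neg hc1, if_neg hc2, if_neg hc2, if_pos hc3, if_pos hc3]
    constructor <;> omega
  rcases Nat.lt_or_ge i (r₁ + 1) with h4 | h4
  · obtain ⟨hx, hy⟩ := hrun3 i h3 (by omega)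
    have hc1 : ¬ (i ≤ 2 * a + 1) := by omega
    have hc2 : ¬ (i ≤ 4 * a + 1) := by omega
    have hc3 : ¬ (i ≤ 4 * a + 2 * b + 3) := by omega
    have hc4 : i ≤ 4 * a + 2 * k + 2 := by omega
    rw [hx, hy, if_neg hc1, if_neg hc1, if_neg hc2, if_neg hc2, if_neg hc3, if_neg hc3, if_pos hc4, if_pos hc4]
    constructor <;> omega
  rcases Nat.lt_or_ge i (r₂ + 1) with h5 | h5
  · obtain ⟨hx, hy⟩ := hrun4 i h4 (by omega)
    have hc1 : ¬ (i ≤ 2 * a + 1) := by omega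
    have hc2 : ¬ (i ≤ 4 * a + 1) := by omega
    have hc3 : ¬ (i ≤ 4 * a + 2 * b + 3) := by omega
    have hc4 : ¬ (i ≤ 4 * a + 2 * k + 2) := by omega
    have hc5 : i ≤ 4 * a + 2 * k + 2 * c + 2 := by omega
    rw [hx, hy, if_neg hc1, if_neg hc1, if_neg hc2, if_neg hc2, if_neg hc3, if_neg hc3, if_neg hc4, if_neg hc4, if_pos hc5, if_pos hc5]
    constructor <;> omega
  rcases Nat.lt_or_ge i (r₃ + 1) with h6 | h6
  · obtain ⟨hx, hy⟩ := hrun5 i h5 (by omega)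
    have hc1 : ¬ (i ≤ 2 * a + 1) := by omega
    have hc2 : ¬ (i ≤ 4 * a + 1) := by omega
    have hc3 : ¬ (i ≤ 4 * a + 2 * b + 3) := by omega
    have hc4 : ¬ (i ≤ 4 * a + 2 * k + 2) := by omega
    have hc5 : ¬ (i ≤ 4 * a + 2 * k + 2 * c + 2) := by omega
    have hc6 : i ≤ 2 * a + 4 * k + 2 := by omega
    rw [hx, hy, if_neg hc1, if_neg hc1, if_neg hc2, if_neg hc2, if_neg hc3, if_neg hc3, if_neg hc4, if_neg hc4, if_neg hc5, if_neg hc5, if_pos hc6, if_pos hc6]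
    constructor <;> omega
  obtain ⟨hx, hy⟩ := hR6 i h6 hi
  have hc1 : ¬ (i ≤ 2 * a + 1) := by omega
  have hc2 : ¬ (i ≤ 4 * a + 1) := by omega
  have hc3 : ¬ (i ≤ 4 * a + 2 * b + 3) := by omega
  have hc4 : ¬ (i ≤ 4 * a + 2 * k + 2) := by omega
  have hc5 : ¬ (i ≤ 4 * a + 2 * k + 2 * c + 2) := by omega
  have hc6 : ¬ (i ≤ 2 * a + 4 * k + 2) := by omega
  rw [hx, hy, if_neg hc1, if_neg hc1, if_neg hc2, if_neg hc2, if_neg hc3, if_neg hc3, if_neg hc4, if_neg hc4, if_neg hc5, if_neg hc5, if_neg hc6, if_neg hc6]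
  constructor <;> omega

/-- DDDUUU, step 4 — **the tables**: with the hairpin (`c₂ = 2`), runs 2 and 3 rightward, the exit pair `(e₄, e₅) =
(+1, +1)` forces `p = 2k − 1` and F3R with `b = (ℓ₂ − 1)/2`, `c = ℓ₃/2`; `(−1, −1)` forces `c₄ = 2k + 1` and F3L with
`a = (p−1)/2`, `b = (ℓ₂ − 1)/2`, `c = (ℓ₄ + 1)/2` (the side condition `b + c ≤ k − 1` is row-`−2` disjointness `c₃ < c₅`).
[cite: MadrasSlade1993, §4.2, Definition 4.2.1; EntingJensen2009, §7.4.2, Fig. 7.10] -/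
theorem ddduuu_tables {k m p p₂ p₃ r₁ r₂ r₃ : ℕ} {e₄ e₅ : ℤ} (hk : 2 ≤ k) (hm : m = 6 * k + 2)
    (he45 : (e₄ = 1 ∧ e₅ = 1) ∨ (e₄ = -1 ∧ e₅ = -1)) (hR0 : ∀ i, i ≤ p → ω i 0 = i ∧ ω i 1 = 0)
    (hrun1 : ∀ i, p + 1 ≤ i → i ≤ p₂ → ω i 0 = p + (-1) * ((i - (p + 1) : ℕ) : ℤ) ∧ ω i 1 = -1)
    (hrun2 : ∀ i, p₂ + 1 ≤ i → i ≤ p₃ → ω i 0 = ω p₂ 0 + 1 * ((i - (p₂ + 1) : ℕ) : ℤ) ∧ ω i 1 = -2)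
    (hrun3 : ∀ i, p₃ + 1 ≤ i → i ≤ r₁ → ω i 0 = ω p₃ 0 + 1 * ((i - (p₃ + 1) : ℕ) : ℤ) ∧ ω i 1 = -3)
    (hrun4 : ∀ i, r₁ + 1 ≤ i → i ≤ r₂ → ω i 0 = ω r₁ 0 + e₄ * ((i - (r₁ + 1) : ℕ) : ℤ) ∧ ω i 1 = -2)
    (hrun5 : ∀ i, r₂ + 1 ≤ i → i ≤ r₃ → ω i 0 = ω r₂ 0 + e₅ * ((i - (r₂ + 1) : ℕ) : ℤ) ∧ ω i 1 = -1)
    (hR6 : ∀ j, r₃ + 1 ≤ j → j ≤ m → ω j 0 = ω r₃ 0 + ((j - (r₃ + 1) : ℕ) : ℤ) ∧ ω j 1 = 0)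
    (hpodd : p % 2 = 1) (h12 : p < p₂) (h23 : p₂ < p₃) (hr2 : p₃ + 2 ≤ r₁) (hr12 : r₁ < r₂) (hr23 : r₂ < r₃)
    (hs_eq : r₃ = p + 4 * k + 1) (hg2 : ω r₃ 0 = p + 2) (hcodd : ω p₃ 0 % 2 = 1) (hdodd : ω r₁ 0 % 2 = 1)
    (heev : ω r₂ 0 % 2 = 0) (hb2 : ω p₂ 0 = 2) (hb : ω p₂ 0 = p + (-1) * ((p₂ - (p + 1) : ℕ) : ℤ))
    (hc : ω p₃ 0 = ω p₂ 0 + 1 * ((p₃ - (p₂ + 1) : ℕ) : ℤ)) (hd : ω r₁ 0 = ω p₃ 0 + 1 * ((r₁ - (p₃ + 1) : ℕ) : ℤ))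
    (he : ω r₂ 0 = ω r₁ 0 + e₄ * ((r₂ - (r₁ + 1) : ℕ) : ℤ)) (hg : ω r₃ 0 = ω r₂ 0 + e₅ * ((r₃ - (r₂ + 1) : ℕ) : ℤ))
    (hce : ω p₃ 0 < ω r₂ 0) (hep : (p : ℤ) + 1 ≤ ω r₂ 0) :
    (∃ a b c, 1 ≤ a ∧ 1 ≤ c ∧ a + c + 1 ≤ k ∧ b + c + 1 ≤ k ∧
        ∀ i, i ≤ m → ω i 0 = f3lX k a b c i ∧ ω i 1 = f3lY k a b c i) ∨
      ∃ b c, 1 ≤ c ∧ b + c + 2 ≤ k ∧ ∀ i, i ≤ m → ω i 0 = f3rX k b c i ∧ ω i 1 = f3rY k b c i := by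
  have hq_eq : p₂ = 2 * p - 1 := by omega
  obtain ⟨b', hb'⟩ : ∃ b', p₃ = p₂ + 2 + 2 * b' := ⟨(p₃ - p₂ - 2) / 2, by omega⟩
  have hcc : ω p₃ 0 = 2 * b' + 3 := by omega
  rcases he45 with ⟨rfl, rfl⟩ | ⟨rfl, rfl⟩
  · -- exit pair rightward: F3R
    right
    obtain ⟨c', hc'⟩ : ∃ c', r₁ = p₃ + 1 + 2 * c' := ⟨(r₁ - p₃ - 1) / 2, by omega⟩
    have hp_eq : p = 2 * k - 1 := by omega
    have he_eq : ω r₂ 0 = 2 * k := by omega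
    exact ⟨b', c', by omega, by omega, ddduuu_table_r hm hk hR0 hrun1 hrun2 hrun3 hrun4 hrun5 hR6 hp_eq (by omega)
      (by omega) (by omega) (by omega) (by omega) hb2 hcc (by omega) he_eq (by omega)⟩
  · -- exit pair leftward: F3L
    left
    obtain ⟨c', hc'⟩ : ∃ c', r₂ = r₁ + 2 * c' := ⟨(r₂ - r₁) / 2, by omega⟩
    have hd_eq : ω r₁ 0 = 2 * k + 1 := by omega
    exact ⟨p / 2, b', c', by omega, by omega, by omega, by omega, ddduuu_table_l hR0 hrun1 hrun2 hrun3 hrun4 hrun5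
      hR6 (by omega) (by omega) (by omega) (by omega) (by omega) (by omega) hb2 hcc hd_eq (by omega) (by omega)⟩

/-- DDDUUU, step 3a — **the last up column bounds `c₅` from below**: `c₅ ≥ p + 1`, else the final row-`−1` run
from `c₅` up to `p + 2` crosses the column `p` of `ω (p+1) = (p, −1)`. [cite: MadrasSlade1993, §4.2, Definition 4.2.1; EntingJensen2009, §7.4.2, Fig. 7.10] -/
theorem ddduuu_e_ge {p p₂ r₂ r₃ : ℕ} {e₅ : ℤ} (he₅ : e₅ = 1 ∨ e₅ = -1) (hpodd : p % 2 = 1) (hq2 : p + 2 ≤ p₂)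
    (hr23 : r₂ < r₃) (hg2 : ω r₃ 0 = p + 2) (heev : ω r₂ 0 % 2 = 0) (he1 : 0 < ω r₂ 0) (hP1x : ω (p + 1) 0 = p)
    (hrun5 : ∀ i, r₂ + 1 ≤ i → i ≤ r₃ → ω i 0 = ω r₂ 0 + e₅ * ((i - (r₂ + 1) : ℕ) : ℤ) ∧ ω i 1 = -1)
    (hg : ω r₃ 0 = ω r₂ 0 + e₅ * ((r₃ - (r₂ + 1) : ℕ) : ℤ))
    (hd15 : ∀ i j, p + 1 ≤ i → i ≤ p₂ → r₂ + 1 ≤ j → j ≤ r₃ → ω i 0 ≠ ω j 0) : (p : ℤ) + 1 ≤ ω r₂ 0 := by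
  by_contra hlt
  rcases he₅ with rfl | rfl
  · refine hd15 (p + 1) (r₂ + 1 + (p - (ω r₂ 0).toNat)) le_rfl (by omega) (by omega) (by omega) ?_
    rw [hP1x, (hrun5 (r₂ + 1 + (p - (ω r₂ 0).toNat)) (by omega) (by omega)).1]; omega
  · omega

/-- DDDUUU, step 3b — **the first below-wall run cannot go right** (`e₁ = +1` is impossible): it would force `c₂ = p+1`,
all later columns `≥ p + 1`, hence `p = 1` by (I1), and then the length count contradicts (I2) or a parity.
[cite: MadrasSlade1993, §4.2, Definition 4.2.1; EntingJensen2009, §7.4.2, Fig. 7.10] -/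
theorem ddduuu_signs_r {k m p p₂ p₃ r₁ r₂ r₃ : ℕ} {e₂ e₃ e₄ e₅ : ℤ} (hk : 2 ≤ k) (hm : m = 6 * k + 2)
    (he₂ : e₂ = 1 ∨ e₂ = -1) (he₃ : e₃ = 1 ∨ e₃ = -1) (he₄ : e₄ = 1 ∨ e₄ = -1) (he₅ : e₅ = 1 ∨ e₅ = -1)
    (hp1 : 1 ≤ p) (hpodd : p % 2 = 1) (hq2 : p + 2 ≤ p₂) (hq3 : p₂ + 2 ≤ p₃) (hr2 : p₃ + 2 ≤ r₁) (hr12 : r₁ < r₂)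
    (hr23 : r₂ < r₃) (hsm : r₃ < m) (hs_eq : r₃ = p + 4 * k + 1) (hg2 : ω r₃ 0 = p + 2) (hX : ω m 0 = 2 * k + 2)
    (hbev : ω p₂ 0 % 2 = 0) (hcodd : ω p₃ 0 % 2 = 1) (hdodd : ω r₁ 0 % 2 = 1) (heev : ω r₂ 0 % 2 = 0)
    (hb1 : 0 < ω p₂ 0) (hc1 : 0 < ω p₃ 0) (hd1 : 0 < ω r₁ 0) (he1 : 0 < ω r₂ 0)
    (hrun1 : ∀ i, p + 1 ≤ i → i ≤ p₂ → ω i 0 = p + 1 * ((i - (p + 1) : ℕ) : ℤ) ∧ ω i 1 = -1)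
    (hrun2 : ∀ i, p₂ + 1 ≤ i → i ≤ p₃ → ω i 0 = ω p₂ 0 + e₂ * ((i - (p₂ + 1) : ℕ) : ℤ) ∧ ω i 1 = -2)
    (hrun4 : ∀ i, r₁ + 1 ≤ i → i ≤ r₂ → ω i 0 = ω r₁ 0 + e₄ * ((i - (r₁ + 1) : ℕ) : ℤ) ∧ ω i 1 = -2)
    (hrun5 : ∀ i, r₂ + 1 ≤ i → i ≤ r₃ → ω i 0 = ω r₂ 0 + e₅ * ((i - (r₂ + 1) : ℕ) : ℤ) ∧ ω i 1 = -1)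
    (hb : ω p₂ 0 = p + 1 * ((p₂ - (p + 1) : ℕ) : ℤ)) (hc : ω p₃ 0 = ω p₂ 0 + e₂ * ((p₃ - (p₂ + 1) : ℕ) : ℤ))
    (hd : ω r₁ 0 = ω p₃ 0 + e₃ * ((r₁ - (p₃ + 1) : ℕ) : ℤ)) (he : ω r₂ 0 = ω r₁ 0 + e₄ * ((r₂ - (r₁ + 1) : ℕ) : ℤ))
    (hg : ω r₃ 0 = ω r₂ 0 + e₅ * ((r₃ - (r₂ + 1) : ℕ) : ℤ))
    (hd15 : ∀ i j, p + 1 ≤ i → i ≤ p₂ → r₂ + 1 ≤ j → j ≤ r₃ → ω i 0 ≠ ω j 0)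
    (hd24 : ∀ i j, p₂ + 1 ≤ i → i ≤ p₃ → r₁ + 1 ≤ j → j ≤ r₂ → ω i 0 ≠ ω j 0)
    (hI1 : 3 ≤ p → ω p₂ 0 ≤ 2 ∨ ω p₃ 0 ≤ 2 ∨ ω r₁ 0 ≤ 2 ∨ ω r₂ 0 ≤ 2)
    (hI2 : r₃ + 4 ≤ m → ω m 0 ≤ ω p₂ 0 + 1 ∨ ω m 0 ≤ ω p₃ 0 + 1 ∨ ω m 0 ≤ ω r₁ 0 + 1 ∨ ω m 0 ≤ ω r₂ 0 + 1)
    (hep : (p : ℤ) + 1 ≤ ω r₂ 0) : False := by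
  have h4s : ω (r₁ + 1) 0 = ω r₁ 0 := by simpa using (hrun4 (r₁ + 1) le_rfl (by omega)).1
  have h5s : ω (r₂ + 1) 0 = ω r₂ 0 := by simpa using (hrun5 (r₂ + 1) le_rfl (by omega)).1
  -- `c₅ ≠ p + 1`: the landing `(c₅, −1)` of the second up step would lie on run 1
  have he3 : (p : ℤ) + 3 ≤ ω r₂ 0 := by
    by_contra hlt
    refine hd15 (p + 2) (r₂ + 1) (by omega) (by omega) le_rfl (by omega) ?_
    rw [(hrun1 (p + 2) (by omega) (by omega)).1, h5s]; omega
  -- so run 5 goes left from `c₅ ≥ p+3` down to `p+2`, and `(p+2, −1)` must not lie on run 1: `c₂ = p + 1`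
  obtain rfl : e₅ = -1 := by rcases he₅ with rfl | rfl <;> omega
  have hb2 : ω p₂ 0 = p + 1 := by
    by_contra hne
    refine hd15 (p + 3) r₃ (by omega) (by omega) (by omega) le_rfl ?_
    rw [(hrun1 (p + 3) (by omega) (by omega)).1, hg2]; omega
  rcases he₂ with rfl | rfl
  · -- run 2 rightward `[p+1, c₃]`; run 4 joins `c₄` to `c₅ ≥ p+3` avoiding it, so `c₄ > c₃`
    have hdc : ω p₃ 0 < ω r₁ 0 := by
      by_contra hle
      rcases lt_or_ge (ω r₁ 0) (p + 1 : ℤ) with hlow | hhigh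
      · obtain rfl : e₄ = 1 := by rcases he₄ with rfl | rfl <;> omega
        refine hd24 (p₂ + 1) (r₁ + 1 + (p + 1 - (ω r₁ 0).toNat)) le_rfl (by omega) (by omega) (by omega) ?_
        rw [(hrun2 (p₂ + 1) le_rfl (by omega)).1, (hrun4 (r₁ + 1 + (p + 1 - (ω r₁ 0).toNat)) (by omega) (by omega)).1]
        omega
      · refine hd24 (p₂ + 1 + ((ω r₁ 0).toNat - (p + 1))) (r₁ + 1) (by omega) (by omega) le_rfl (by omega) ?_
        rw [(hrun2 (p₂ + 1 + ((ω r₁ 0).toNat - (p + 1))) (by omega) (by omega)).1, h4s]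
        rcases he₃ with rfl | rfl <;> omega
    obtain rfl : e₃ = 1 := by rcases he₃ with rfl | rfl <;> omega
    -- all columns below the wall are `≥ p + 1`, so (I1) forces `p = 1`; then (I2) and the length count clash
    have hp_eq : p = 1 := by
      by_contra hp
      rcases hI1 (by omega) with h | h | h | h <;> rcases he₄ with rfl | rfl <;> omega
    subst hp_eq
    rcases hI2 (by omega) with h | h | h | h <;> rcases he₄ with rfl | rfl <;> omega
  · -- run 2 leftward `[c₃, p+1]`; run 4 must pass above it: `c₄ ≥ p + 2`
    have hdp : (p : ℤ) + 2 ≤ ω r₁ 0 := by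
      by_contra hle
      rcases lt_or_ge (ω r₁ 0) (ω p₃ 0) with hlow | hhigh
      · obtain rfl : e₄ = 1 := by rcases he₄ with rfl | rfl <;> omega
        refine hd24 p₃ (r₁ + 1 + ((ω p₃ 0).toNat - (ω r₁ 0).toNat)) (by omega) le_rfl (by omega) (by omega) ?_
        rw [(hrun4 (r₁ + 1 + ((ω p₃ 0).toNat - (ω r₁ 0).toNat)) (by omega) (by omega)).1]; omega
      · refine hd24 (p₂ + 1 + (p + 1 - (ω r₁ 0).toNat)) (r₁ + 1) (by omega) (by omega) le_rfl (by omega) ?_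
        rw [(hrun2 (p₂ + 1 + (p + 1 - (ω r₁ 0).toNat)) (by omega) (by omega)).1, h4s]
        omega
    obtain rfl : e₃ = 1 := by rcases he₃ with rfl | rfl <;> omega
    -- the minimum column is `c₃`, so `c₃ = 1`
    have hc_eq : ω p₃ 0 = 1 := by
      rcases Nat.lt_or_ge p 3 with hp | hp
      · omega
      · rcases hI1 hp with h | h | h | h <;> omega
    rcases he₄ with rfl | rfl
    · omega
    · rcases Nat.lt_or_ge (r₃ + 3) m with hf | hf
      · rcases hI2 (by omega) with h | h | h | h <;> omega
      · omega

set_option maxHeartbeats 400000 in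
/-- DDDUUU, step 3c — **the signs when the first run returns** (`e₁ = −1`): the hairpin `c₂ = 2`, runs 2 and 3 go
right, the exit pair `(e₄, e₅)` is `(+1,+1)` or `(−1,−1)` (mixed pairs fail a parity), and `c₃ < c₅`. [cite: MadrasSlade1993, §4.2, Definition 4.2.1; EntingJensen2009, §7.4.2, Fig. 7.10] -/
theorem ddduuu_signs_l {k m p p₂ p₃ r₁ r₂ r₃ : ℕ} {e₂ e₃ e₄ e₅ : ℤ} (hk : 2 ≤ k) (hm : m = 6 * k + 2)
    (he₂ : e₂ = 1 ∨ e₂ = -1) (he₃ : e₃ = 1 ∨ e₃ = -1) (he₄ : e₄ = 1 ∨ e₄ = -1) (he₅ : e₅ = 1 ∨ e₅ = -1)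
    (hp1 : 1 ≤ p) (hpodd : p % 2 = 1) (hq2 : p + 2 ≤ p₂) (hq3 : p₂ + 2 ≤ p₃) (hr2 : p₃ + 2 ≤ r₁) (hr12 : r₁ < r₂)
    (hr23 : r₂ < r₃) (hsm : r₃ < m) (hs_eq : r₃ = p + 4 * k + 1) (hg2 : ω r₃ 0 = p + 2) (hX : ω m 0 = 2 * k + 2)
    (hbev : ω p₂ 0 % 2 = 0) (hcodd : ω p₃ 0 % 2 = 1) (hdodd : ω r₁ 0 % 2 = 1) (heev : ω r₂ 0 % 2 = 0)
    (hb1 : 0 < ω p₂ 0) (hc1 : 0 < ω p₃ 0) (hd1 : 0 < ω r₁ 0) (he1 : 0 < ω r₂ 0)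
    (hrun2 : ∀ i, p₂ + 1 ≤ i → i ≤ p₃ → ω i 0 = ω p₂ 0 + e₂ * ((i - (p₂ + 1) : ℕ) : ℤ) ∧ ω i 1 = -2)
    (hrun4 : ∀ i, r₁ + 1 ≤ i → i ≤ r₂ → ω i 0 = ω r₁ 0 + e₄ * ((i - (r₁ + 1) : ℕ) : ℤ) ∧ ω i 1 = -2)
    (hrun5 : ∀ i, r₂ + 1 ≤ i → i ≤ r₃ → ω i 0 = ω r₂ 0 + e₅ * ((i - (r₂ + 1) : ℕ) : ℤ) ∧ ω i 1 = -1)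
    (hb : ω p₂ 0 = p + (-1) * ((p₂ - (p + 1) : ℕ) : ℤ)) (hc : ω p₃ 0 = ω p₂ 0 + e₂ * ((p₃ - (p₂ + 1) : ℕ) : ℤ))
    (hd : ω r₁ 0 = ω p₃ 0 + e₃ * ((r₁ - (p₃ + 1) : ℕ) : ℤ)) (he : ω r₂ 0 = ω r₁ 0 + e₄ * ((r₂ - (r₁ + 1) : ℕ) : ℤ))
    (hg : ω r₃ 0 = ω r₂ 0 + e₅ * ((r₃ - (r₂ + 1) : ℕ) : ℤ))
    (hd24 : ∀ i j, p₂ + 1 ≤ i → i ≤ p₃ → r₁ + 1 ≤ j → j ≤ r₂ → ω i 0 ≠ ω j 0)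
    (hI1 : 3 ≤ p → ω p₂ 0 ≤ 2 ∨ ω p₃ 0 ≤ 2 ∨ ω r₁ 0 ≤ 2 ∨ ω r₂ 0 ≤ 2)
    (hI2 : r₃ + 4 ≤ m → ω m 0 ≤ ω p₂ 0 + 1 ∨ ω m 0 ≤ ω p₃ 0 + 1 ∨ ω m 0 ≤ ω r₁ 0 + 1 ∨ ω m 0 ≤ ω r₂ 0 + 1)
    (hep : (p : ℤ) + 1 ≤ ω r₂ 0) :
    ω p₂ 0 = 2 ∧ e₂ = 1 ∧ e₃ = 1 ∧ ((e₄ = 1 ∧ e₅ = 1) ∨ (e₄ = -1 ∧ e₅ = -1)) ∧ ω p₃ 0 < ω r₂ 0 := by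
  have h4s : ω (r₁ + 1) 0 = ω r₁ 0 := by simpa using (hrun4 (r₁ + 1) le_rfl (by omega)).1
  have h5s : ω (r₂ + 1) 0 = ω r₂ 0 := by simpa using (hrun5 (r₂ + 1) le_rfl (by omega)).1
  have hp3 : 3 ≤ p := by omega
  rcases he₂ with rfl | rfl
  · -- run 2 rightward `[c₂, c₃]`: run 4 joins `c₄` to `c₅ > c₂` avoiding it, so `c₄ > c₃` and `c₅ > c₃`
    have hdc : ω p₃ 0 < ω r₁ 0 := by
      by_contra hle
      rcases lt_or_ge (ω r₁ 0) (ω p₂ 0) with hlow | hhigh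
      · obtain rfl : e₄ = 1 := by rcases he₄ with rfl | rfl <;> omega
        refine hd24 (p₂ + 1) (r₁ + 1 + ((ω p₂ 0).toNat - (ω r₁ 0).toNat)) le_rfl (by omega) (by omega) (by omega) ?_
        rw [(hrun2 (p₂ + 1) le_rfl (by omega)).1, (hrun4 (r₁ + 1 + ((ω p₂ 0).toNat - (ω r₁ 0).toNat)) (by omega)
          (by omega)).1]
        omega
      · refine hd24 (p₂ + 1 + ((ω r₁ 0).toNat - (ω p₂ 0).toNat)) (r₁ + 1) (by omega) (by omega) le_rfl (by omega) ?_
        rw [(hrun2 (p₂ + 1 + ((ω r₁ 0).toNat - (ω p₂ 0).toNat)) (by omega) (by omega)).1, h4s]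
        rcases he₃ with rfl | rfl <;> omega
    obtain rfl : e₃ = 1 := by rcases he₃ with rfl | rfl <;> omega
    have hce : ω p₃ 0 < ω r₂ 0 := by
      by_contra hle
      refine hd24 (p₂ + 1 + ((ω r₂ 0).toNat - (ω p₂ 0).toNat)) r₂ (by omega) (by omega) (by omega) le_rfl ?_
      rw [(hrun2 (p₂ + 1 + ((ω r₂ 0).toNat - (ω p₂ 0).toNat)) (by omega) (by omega)).1]; omega
    have hb2 : ω p₂ 0 = 2 := by rcases hI1 hp3 with h | h | h | h <;> omega
    refine ⟨hb2, rfl, rfl, ?_, hce⟩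
    rcases he₄ with rfl | rfl <;> rcases he₅ with rfl | rfl
    · exact Or.inl ⟨rfl, rfl⟩
    · exfalso; omega
    · exfalso; omega
    · exact Or.inr ⟨rfl, rfl⟩
  · -- run 2 leftward `[c₃, c₂]`: run 4 must pass to the right of `c₂`, so `c₄ > c₂ > c₃`, `e₃ = +1`, `c₃ = 1`,
    -- and every exit pair contradicts the length count, (I2) or a parity
    exfalso
    have hdb : ω p₂ 0 < ω r₁ 0 := by
      by_contra hle
      rcases lt_or_ge (ω r₁ 0) (ω p₃ 0) with hlow | hhigh
      · obtain rfl : e₄ = 1 := by rcases he₄ with rfl | rfl <;> omega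
        refine hd24 p₃ (r₁ + 1 + ((ω p₃ 0).toNat - (ω r₁ 0).toNat)) (by omega) le_rfl (by omega) (by omega) ?_
        rw [(hrun4 (r₁ + 1 + ((ω p₃ 0).toNat - (ω r₁ 0).toNat)) (by omega) (by omega)).1]; omega
      · refine hd24 (p₂ + 1 + ((ω p₂ 0).toNat - (ω r₁ 0).toNat)) (r₁ + 1) (by omega) (by omega) le_rfl (by omega) ?_
        rw [(hrun2 (p₂ + 1 + ((ω p₂ 0).toNat - (ω r₁ 0).toNat)) (by omega) (by omega)).1, h4s]
        omega
    obtain rfl : e₃ = 1 := by rcases he₃ with rfl | rfl <;> omega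
    have hc_eq : ω p₃ 0 = 1 := by rcases hI1 hp3 with h | h | h | h <;> omega
    rcases he₄ with rfl | rfl <;> rcases he₅ with rfl | rfl
    · omega
    · rcases Nat.lt_or_ge (r₃ + 3) m with hf | hf
      · rcases hI2 (by omega) with h | h | h | h <;> omega
      · omega
    · rcases Nat.lt_or_ge (r₃ + 3) m with hf | hf
      · rcases hI2 (by omega) with h | h | h | h <;> omega
      · omega
    · omega

/-- **Profile `D D D U U U` at slack two is F3L or F3R** (as coordinate tables). PROOF-slack2 §5 (last case):
`e₄ = e₅ = +1` gives F3R (`q = 1`), `e₄ = e₅ = −1` gives F3L.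
[cite: MadrasSlade1993, §4.2, Definition 4.2.1; EntingJensen2009, §7.4.2, Fig. 7.10] -/
theorem ddduuu_slack_two {k m : ℕ} (hk : 2 ≤ k) (hm : m = 6 * k + 2) (hω : ω ∈ ipwb m) (hv : visits m ω = k)
    {p₁ p₂ p₃ r₁ r₂ r₃ : ℕ} (hD : stepsD m ω = {p₁, p₂, p₃}) (hU : stepsU m ω = {r₁, r₂, r₃}) (h12 : p₁ < p₂)
    (h23 : p₂ < p₃) (hr12 : r₁ < r₂) (hr23 : r₂ < r₃) (h3 : p₃ < r₁) (hp1 : 1 ≤ p₁) (hpodd : p₁ % 2 = 1)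
    (hR0 : ∀ i, i ≤ p₁ → ω i 0 = i ∧ ω i 1 = 0) (hP1x : ω (p₁ + 1) 0 = p₁) (hP1y : ω (p₁ + 1) 1 = -1)
    (hhor : ∀ i, i < m → i ∉ stepsD m ω → i ∉ stepsU m ω →
      ω (i + 1) 1 = ω i 1 ∧ (ω (i + 1) 0 = ω i 0 + 1 ∨ ω (i + 1) 0 = ω i 0 - 1)) :
    (∃ a b c, 1 ≤ a ∧ 1 ≤ c ∧ a + c + 1 ≤ k ∧ b + c + 1 ≤ k ∧
        ∀ i, i ≤ m → ω i 0 = f3lX k a b c i ∧ ω i 1 = f3lY k a b c i) ∨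
      ∃ b c, 1 ≤ c ∧ b + c + 2 ≤ k ∧ ∀ i, i ≤ m → ω i 0 = f3rX k b c i ∧ ω i 1 = f3rY k b c i := by
  obtain ⟨hpw, -, hirr⟩ := mem_ipwb.1 hω
  obtain ⟨hw, hbr⟩ := mem_pwb.1 hpw
  have hinj : Set.InjOn ω {i | i ≤ m} :=
    (mem_saws_iff.1 (mem_hpw.1 (mem_archs.1 (mem_wbr.1 hw).1).1).1).2.2.2
  obtain ⟨e₁, e₂, e₃, e₄, e₅, he₁, he₂, he₃, he₄, he₅, hrun1, hrun2, hrun3, hrun4, hrun5, hR6, hs_eq, hg2, hbev, hcodd,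
    hdodd, heev, hb1, hc1, hd1, he1, hq2, hq3, hr2, hsm⟩ :=
    ddduuu_runs hk hm hω hv hD hU h12 h23 hr12 hr23 h3 hp1 hR0 hP1x hP1y hhor
  have hX : ω m 0 = 2 * k + 2 := by have := (hR6 m (by omega) le_rfl).1; omega
  have hb := (hrun1 p₂ (by omega) le_rfl).1
  have hc := (hrun2 p₃ (by omega) le_rfl).1
  have hd := (hrun3 r₁ (by omega) le_rfl).1
  have he := (hrun4 r₂ (by omega) le_rfl).1
  have hg := (hrun5 r₃ (by omega) le_rfl).1
  have hd15 := runs_disjoint hinj (show p₂ < r₂ + 1 by omega) hsm.le hrun1 hrun5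
  have hd24 := runs_disjoint hinj (show p₃ < r₁ + 1 by omega) (show r₂ ≤ m by omega) hrun2 hrun4
  have hI1 := fun hp3 : 3 ≤ p₁ => ddduuu_shield_low hbr hirr hR0 he₁ he₂ he₃ he₄ he₅ hrun1 hrun2 hrun3 hrun4 hrun5
    hR6 hp3 h12 h23 h3 hr12 hr23 hsm hg2 hb hc hd he hg
  have hI2 := fun hs4 : r₃ + 4 ≤ m => ddduuu_shield_high hbr hirr hR0 he₁ he₂ he₃ he₄ he₅ hrun1 hrun2 hrun3 hrun4
    hrun5 hR6 hs4 (by omega) h12 h23 h3 hr12 hr23 hg2 hb hc hd he hg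
  have hep := ddduuu_e_ge he₅ hpodd hq2 hr23 hg2 heev he1 hP1x hrun5 hg hd15
  rcases he₁ with rfl | rfl
  · exact (ddduuu_signs_r hk hm he₂ he₃ he₄ he₅ hp1 hpodd hq2 hq3 hr2 hr12 hr23 hsm hs_eq hg2 hX hbev hcodd hdodd heev
      hb1 hc1 hd1 he1 hrun1 hrun2 hrun4 hrun5 hb hc hd he hg hd15 hd24 hI1 hI2 hep).elim
  · obtain ⟨hb2, rfl, rfl, he45, hce⟩ := ddduuu_signs_l hk hm he₂ he₃ he₄ he₅ hp1 hpodd hq2 hq3 hr2 hr12 hr23 hsm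
      hs_eq hg2 hX hbev hcodd hdodd heev hb1 hc1 hd1 he1 hrun2 hrun4 hrun5 hb hc hd he hg hd24 hI1 hI2 hep
    exact ddduuu_tables hk hm he45 hR0 hrun1 hrun2 hrun3 hrun4 hrun5 hR6 hpodd h12 h23 hr2 hr12 hr23 hs_eq hg2 hcodd
      hdodd heev hb2 hb hc hd he hg hce hep

/-! ### §4 Assembly -/

/-- A walk of `saws m` that agrees with a table walk of length `m` at all times `≤ m` IS that table walk (both are
eventually constant). [cite: MadrasSlade1993, §1.2] -/
theorem eq_tab_walk_of_forall {m : ℕ} {X Y : ℕ → ℤ} (hs : ω ∈ saws m)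
    (h : ∀ i, i ≤ m → ω i 0 = X i ∧ ω i 1 = Y i) : ω = Tab.walk m X Y := by
  obtain ⟨-, hend, -, -⟩ := mem_saws_iff.1 hs
  funext i
  rcases le_or_gt i m with hi | hi
  · obtain ⟨hx, hy⟩ := h i hi
    obtain ⟨hx', hy'⟩ := tab_walk_apply (X := X) (Y := Y) hi
    exact site_ext_cls (by rw [hx, hx']) (by rw [hy, hy'])
  · obtain ⟨hx, hy⟩ := h m le_rfl
    obtain ⟨hx', hy'⟩ := tab_walk_apply (X := X) (Y := Y) (le_refl m)
    have hfr : Tab.walk m X Y i = Tab.walk m X Y m := by simp only [Tab.walk, min_eq_right hi.le, min_self]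
    rw [hend i hi.le, hfr]
    exact site_ext_cls (by rw [hx, hx']) (by rw [hy, hy'])

/-- **Slack-two rigidity**: an irreducible positive wall bridge of length `6k + 2` with `k` visits (`k ≥ 2`) is one
of the `2 + Σ_{j<k} j²` blocks of the five families. OURS. [cite: MadrasSlade1993, §4.2, remark before (4.2.21) (p. 94)]
[cite: EntingJensen2009, §7.4.2, Fig. 7.10] -/
theorem mem_slackTwoBlocks_of_visits_eq {k m : ℕ} (hk : 2 ≤ k) (hm : m = 6 * k + 2) (hω : ω ∈ ipwb m)
    (hv : visits m ω = k) : ω ∈ slackTwoBlocks k := by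
  classical
  obtain ⟨-, hUD, hD3, -, -, -, -⟩ := slack_two_counts hk hm hω hv
  have hD2 := two_le_card_stepsD_of_slack_two hk hm hω hv
  have hs : ω ∈ saws m := saws_of_mem_pwb (mem_ipwb.1 hω).1
  have hm' : 6 * k + 2 = m := hm.symm
  rcases Nat.lt_or_ge #(stepsD m ω) 3 with hlt | hge
  · -- two down steps
    have hD : #(stepsD m ω) = 2 := by omega
    obtain ⟨p, q, r, s, hDpq, hUrs, hpq, hrs, hpr, hqs, hp1, hpodd, hR0, hP1x, hP1y, hhor, hYt⟩ :=
      profile_of_card_stepsD_eq_two hω hD (by rw [hUD, hD])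
    have hqr' : q ≠ r := by
      intro h
      obtain ⟨-, -, hbw, -⟩ := mem_saws_iff.1 hs
      obtain ⟨-, -, hqy, -⟩ := of_mem_stepsD_coord hbw (i := q) (by rw [hDpq]; simp)
      obtain ⟨-, -, hry, -⟩ := of_mem_stepsU_coord hbw (i := r) (by rw [hUrs]; simp)
      rw [h] at hqy; omega
    rcases lt_or_gt_of_ne hqr' with hqr | hrq
    · rcases dduu_slack_two hk hm hω hv hDpq hUrs hpq hrs hqr hp1 hpodd hR0 hP1x hP1y hhor with
        ⟨a, ha, hak, htab⟩ | ⟨j, hj, htab⟩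
      · rw [show ω = f2a k a from by rw [f2a, hm']; exact eq_tab_walk_of_forall hs (by rw [← hm'] at htab ⊢; exact htab)]
        exact f2a_mem_slackTwoBlocks ha hak
      · rw [show ω = f2bc k j from by rw [f2bc, hm']; exact eq_tab_walk_of_forall hs (by rw [← hm'] at htab ⊢; exact htab)]
        exact f2bc_mem_slackTwoBlocks hj
    · exact (dudu_false_of_mem_ipwb hω hDpq hUrs hpq hrs hpr hqs hrq hR0 hP1x hP1y hhor).elim
  · -- three down steps
    have hD : #(stepsD m ω) = 3 := by omega
    obtain ⟨p₁, p₂, p₃, r₁, r₂, r₃, hDs, hUs, h12, h23, hr12, hr23, h1, h2, h3, hp1, hpodd, hR0, hP1x, hP1y,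
        hhor, hYt⟩ := profile_of_card_stepsD_eq_three hω hD (by rw [hUD, hD])
    have hne : p₃ ≠ r₁ := by
      intro h
      obtain ⟨-, -, hbw, -⟩ := mem_saws_iff.1 hs
      obtain ⟨-, -, hqy, -⟩ := of_mem_stepsD_coord hbw (i := p₃) (by rw [hDs]; simp)
      obtain ⟨-, -, hry, -⟩ := of_mem_stepsU_coord hbw (i := r₁) (by rw [hUs]; simp)
      rw [h] at hqy; omega
    rcases lt_or_gt_of_ne hne with hlt3 | hgt3
    · rcases ddduuu_slack_two hk hm hω hv hDs hUs h12 h23 hr12 hr23 hlt3 hp1 hpodd hR0 hP1x hP1y hhor with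
        ⟨a, b, c, ha, hc, hac, hbc, htab⟩ | ⟨b, c, hc, hbc, htab⟩
      · rw [show ω = f3l k a b c from by rw [f3l, hm']; exact eq_tab_walk_of_forall hs (by rw [← hm'] at htab ⊢; exact htab)]
        exact f3l_mem_slackTwoBlocks ha hc hac hbc
      · rw [show ω = f3r k b c from by rw [f3r, hm']; exact eq_tab_walk_of_forall hs (by rw [← hm'] at htab ⊢; exact htab)]
        exact f3r_mem_slackTwoBlocks hc hbc
    · exact (three_down_orders_false hk hm hω hv hDs hUs h12 h23 hr12 hr23 h1 h2 h3 hp1 hpodd hR0 hP1x hP1y hhor hYt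
        hgt3).elim

/-- **`N_{3k+1,k}` as a set**: for `k ≥ 2` and `m = 6k + 2`, the irreducible positive wall bridges of length `m`
with `k` visits are exactly the slack-two blocks. OURS. [cite: MadrasSlade1993, §4.2, remark before (4.2.21) (p. 94)]
[cite: EntingJensen2009, §7.4.2, Fig. 7.10] -/
theorem filter_visits_eq_slackTwoBlocks {k m : ℕ} (hk : 2 ≤ k) (hm : m = 6 * k + 2) :
    (ipwb m).filter (fun ω => visits m ω = k) = slackTwoBlocks k := by
  refine Finset.Subset.antisymm (fun ζ hζ => ?_) (slackTwoBlocks_subset hk hm)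
  rw [Finset.mem_filter] at hζ
  exact mem_slackTwoBlocks_of_visits_eq hk hm hζ.1 hζ.2

/-- **`N_{3k+1,k} = 2 + Σ_{j<k} j² = 2 + (k−1)k(2k−1)/6`** (`k ≥ 2`): `3, 7, 16, 32, 57, 93, 142, …`. OURS.
[cite: MadrasSlade1993, §4.2, remark before (4.2.21) (p. 94)] [cite: EntingJensen2009, §7.4.2, Fig. 7.10] -/
theorem card_filter_visits_eq_slack_two {k m : ℕ} (hk : 2 ≤ k) (hm : m = 6 * k + 2) :
    #((ipwb m).filter fun ω => visits m ω = k) = 2 + ∑ j ∈ range k, j ^ 2 := by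
  rw [filter_visits_eq_slackTwoBlocks hk hm, card_slackTwoBlocks hk]

end Literature.Probability.RandomPlanarGeometry.SAW.HexBW.Wall
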